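import Summits.BirchSwinnertonDyer.BirchSwinnertonDyer.Theses.ByReductionTypeAtTwo
import Summits.BirchSwinnertonDyer.BirchSwinnertonDyer.Theorems.ByReductionTypeAtTwoSupersingularUniformFlatLine
import Summits.BirchSwinnertonDyer.BirchSwinnertonDyer.Theorems.ByReductionTypeAtTwoSupersingularUniformFlatLineFineMu
import Summits.BirchSwinnertonDyer.BirchSwinnertonDyer.Theorems.ByReductionTypeAtTwoSupersingularFlatBlindEulerChar
import Summits.BirchSwinnertonDyer.BirchSwinnertonDyer.Theorems.ByReductionTypeAtTwoSupersingularFlatBlindNoCotorsion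
import Summits.BirchSwinnertonDyer.BirchSwinnertonDyer.Theorems.ByReductionTypeAtTwoSupersingularFlatBlindLocalTransversalityApZero
import Summits.BirchSwinnertonDyer.BirchSwinnertonDyer.Theorems.ByReductionTypeAtTwoSupersingularFlatBlindHondaRung
import Summits.BirchSwinnertonDyer.BirchSwinnertonDyer.Theorems.ByReductionTypeAtTwoSupersingularFlatBlindControlOfLocal
import Summits.BirchSwinnertonDyer.BirchSwinnertonDyer.Theorems.ByReductionTypeAtTwoSupersingularFlatBlindCardHondaHolds
import Summits.BirchSwinnertonDyer.BirchSwinnertonDyer.Theorems.ByReductionTypeAtTwoSupersingularFlatNoFiniteSubmoduleHondaOfClassical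
import Summits.BirchSwinnertonDyer.BirchSwinnertonDyer.Theorems.ByReductionTypeAtTwoSupersingularClassicalNoFiniteSubmoduleAtTwo
import Summits.BirchSwinnertonDyer.BirchSwinnertonDyer.Theorems.ByReductionTypeAtTwoSupersingularSelmerCorankCyclotomicLayersBounded
import Literature.NumberTheory.EllipticCurves.KatoTwistedSelmerFinitenessLayers
import Summits.BirchSwinnertonDyer.BirchSwinnertonDyer.Theorems.ByReductionTypeAtTwoSupersingularFlatLocalDataOfHondaSystem
import Literature.NumberTheory.EllipticCurves.Kato2004.EulerSystemBoundFineSelmerTwo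
import Literature.NumberTheory.EllipticCurves.Kato2004.MainConjecturePrimeTDoorProofs
import Summits.BirchSwinnertonDyer.BirchSwinnertonDyer.Theorems.ByReductionTypeAtTwoSupersingularRankZeroAtTwoStubHondaAtTwo
import Summits.BirchSwinnertonDyer.BirchSwinnertonDyer.Theorems.ByReductionTypeAtTwoSupersingularFlatRoadCountTwo
import Summits.BirchSwinnertonDyer.BirchSwinnertonDyer.Theorems.ByReductionTypeAtTwoSupersingularFlatBlindPinchBSDp
import Summits.BirchSwinnertonDyer.BirchSwinnertonDyer.Theorems.ByReductionTypeAtTwoSupersingularFlatBlindPinchOfAvatar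
import Summits.BirchSwinnertonDyer.BirchSwinnertonDyer.Theorems.ByReductionTypeAtTwoSupersingularFlatRoadContra
import Summits.BirchSwinnertonDyer.BirchSwinnertonDyer.Theorems.ByReductionTypeAtTwoSupersingularFlatRoadContraGlue
import Summits.BirchSwinnertonDyer.BirchSwinnertonDyer.Theorems.ByReductionTypeAtTwoSupersingularFlatCKPackageOfZetaPackage
import Summits.BirchSwinnertonDyer.BirchSwinnertonDyer.Theorems.ByReductionTypeAtTwoSupersingularFlatCapstoneAlpha
import Literature.NumberTheory.EllipticCurves.Kato2004.EulerSystemBoundFineSelmerTwoContragredient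
import Summits.BirchSwinnertonDyer.BirchSwinnertonDyer.Theorems.ByReductionTypeAtTwoSupersingularBlindPinchBlindZeroOfTwistSelmerCorank
import Literature.NumberTheory.EllipticCurves.TateModuleFreeProofs
import Summits.BirchSwinnertonDyer.BirchSwinnertonDyer.Theorems.ByReductionTypeAtTwoSupersingularH1IwPointsModelFreeOfGreenberg1989
import Summits.BirchSwinnertonDyer.BirchSwinnertonDyer.Theorems.ByReductionTypeAtTwoSupersingularFlatKernelCyclicHondaOfH1IwFree
import Literature.NumberTheory.EllipticCurves.CoatesGreenberg1996.GoodModelKernelH1OfDeeplyRamifiedProofs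
import Summits.BirchSwinnertonDyer.Rank1Residual.F1Sign2.HondaSystemAtTwo
import Summits.BirchSwinnertonDyer.Rank1Residual.Supersingular.BlindControlTwo
import Summits.BirchSwinnertonDyer.Rank1Residual.Supersingular.BlindPointDerivAt
import Summits.BirchSwinnertonDyer.Rank1Residual.P2.EmptyCellsAtTwo
import Literature.NumberTheory.EllipticCurves.PadicFormalLogOrder
import Literature.NumberTheory.EllipticCurves.QuadraticTwist
import Literature.NumberTheory.EllipticCurves.Rank1Residual.Predicates
import Literature.NumberTheory.EllipticCurves.AnalyticRankOrderProofs
import Literature.NumberTheory.EllipticCurves.Rank1Residual.MuLambdaCarriers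
import Literature.NumberTheory.EllipticCurves.Kato2004.DivisibilityInputsZetaLine
import HarnessLib

/-!
**v2.20 → v2.21 (DRAFT by LEAD ss-1 GEN 26, 2026-09-01; director-bsd (1009)(b′)/(1016)(c) «stub 2 ↦ ONE displayed 2-adic conjunct + print moved to stub_pub», D-0182
(1024)(5) «v2.21 only inside this LEAD gen with all four legs»; v2.20 = registry 39efd4f3…, ts 2026-08-31T23:37:11Z).  ONE MOVE (the F3 FOLD BY NAME), ONE REGISTRATION,
count 5 → 5, names unchanged; every declaration not named here is byte-identical to v2.20:**  the hands closed F3 + ZL2 of `FlatZetaPackageAtTwo` in the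
kernel — t42 GEN 51/52 (Z1–Z7, C1–C3: p838449 · p838481 · p838688 …), tower-1 GEN 69/70 (E0–E5, B1a–B1d: ★★★ p838609, ★ p838648 — `0 ≤ v₂(ϖ)` from
Abbes–Ullmo by name), LEAD GEN 26 (p838149 · p838373 · p838710 · ★★★ p838889, capstone ★★★ `SSFlatCap.flatZetaPackage_body_of_pinnedFlatImage`) — MODULO exactly three
PRINT names and ONE research conjunct.  The residue was
fixed by t42's (R∀)/rescaling analysis, pen RC-854/860/861 and tower-1's (D1): neither Kato's constant nor the cusp-brick denominators are invariants of
`W` (the print ∃-shape is closed under `(κ, z, x) ↦ (2κ, 2z, 2x)`), so the invariant content is **(α) «∃ e ∈ 𝐇¹_Γ(T₂W), Col♭(L e) ∉ 2Λ»** — μ-primitivity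
of the ♭ Coleman image of the global Iwasawa cohomology for the LOG-PINNED Sprung–Honda system (implied by IMC-equality at 2 + μ(L♭) = 0; census-proof;
no 2-rescaled instance: `J`, `L` pinned to equality — Sprung Prop. 5.7, ★ p838373 `eq_of_pin` —, the E0b clauses pin `c`).  HENCE: `stub_flatPackage :
FlatColemanImagePrimitiveAtTwo` (NEW def: the habitat/κ/γ/v/g prefix of `FlatZetaPackageAtTwo`, then ∀ over E0b-TYPE DATA — the clause list of
★ p836268 `SSHondaTwo.isHondaSystemAtTwo_sprung_withLog` VERBATIM — and over the pinned `I`, `L`, `J`, body `∃ e : I.H, (J (L e)).2 ∉ Ideal.span {C 2}` = the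
capstone's hypothesis `hα` byte-for-byte); `PublishedInputsAtTwo` gains the conjunct-pair `(Kato2004.exists_eulerSystem_expStar_tatePairing_values_two ∧
ModularForms.abbesUllmo_not_dvd_maninConstant_of_not_dvd_level)` PREPENDED (Kato Thm. 12.5 (1) read on the Tate pairing at `p = 2`; Abbes–Ullmo 1996
Thm. A / ARS 2006 Thm. 2.5 at `p = 2 ∤ N` — K4 stays independent of the Manin audit files; every old accessor re-indexed `hPub.x ↦ hPub.2.2.x`, 8 → 10 print names);
glue `flatZetaPackageAtTwo_of_flatImage (hPub) (h : FlatColemanImagePrimitiveAtTwo) : FlatZetaPackageAtTwo` = ONE `exact` of the capstone; composition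
`uniformFlatHondaDataAtTwo_of_pub hPub (flatCKPackageAtTwo_of_flatZetaPackage (flatZetaPackageAtTwo_of_flatImage hPub stub_flatPackage))`; `FlatZetaPackageAtTwo`
stays as a DERIVED def.  5 stubs = 5 sorries, same names: `stub_pub` [P, 10 print names] · `stub_flatPackage : FlatColemanImagePrimitiveAtTwo` [R@2 = THE MATH-BOUND
of the ss block on the Kato side: ♭-primitivity of the zeta line / μ(Col♭(loc 𝐇¹)) = 0 at 2] · `stub_fineMu` [(A)@2] · `stub_oddFlatValueLaw` [(P₋₂′)] ·
`stub_lowerOffGenericOdd` [lower half off three escapes].  Label: «19097 OPEN on 5 registered stubs (v2.21 = v2.20 + F3/ZL2 folded by name); modulo print, (A)@2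
and the lower half, BSD₂ at good supersingular 2 in rank 0 along this line = ♭-primitivity of Kato's zeta line at (2); nothing booked (D-0054); typed ≠ proved;
BSD proved for no curve».  HIBERNATED under D-0182 after this touch.

**HISTORY v2.19 → v2.20 (2026-08-31, LEAD ss-1 GEN 26 on director (991)(a); CONDENSED in v2.21 for the 200 000-byte cap — VERBATIM in the tree history
(registry v2.20 39efd4f3 :41–69) and in `run/shared/lean/pub/bsd-2adic/ss/gen26/v220/`).**  One paragraph: (B) «(8)∃» — `FlatCKPackageAtTwo` provides its
Honda system (`∀ g, hg → ∃ cneg c, …`; t42 GEN 51 (R∀) + pen RC-835), `uniformFlatHondaDataAtTwo_of_pub (hPub) (hFP : FlatCKPackageAtTwo)`, orphan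
`FlatPackageAtTwo`/`flatPackageAtTwo_of_CK` deleted; F1♭ FOLD — the print ♭ Poitou–Tate exactness left stub 2 through ★★ p837143
`SSFlatFold.flatCKPackage_of_flatZetaPackage` (T-ORTH p833066 · T-LIM p834233 · (δ̄) p831519 · T-δ p833047 · assembly p833046), stub 2 re-typed
`FlatZetaPackageAtTwo` (Honda system + F3 + ZL2 for every pinned I/L/J); REF1 §536 PASS.

**HISTORY v2.18 → v2.19 (2026-08-31, LEAD ss-1 GEN 25, -imc W-92; CONDENSED in v2.21 — VERBATIM in the tree history (registry v2.20 39efd4f3 :71–83, v2.19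
ad3ba3fc :41–53) and in `run/shared/lean/pub/bsd-2adic/ss/gen25/v219/`).**  One paragraph: stub 5/5 `LowerBoundOffGenericOddAtTwo` gained its THIRD escape
«`∀ q, shaAn W = q → 1 ≤ padicValRat 2 q`» (off the Ш_an-UNIT locus, where Miller's lower half is trivial and `hU` alone closes in `SupersingularRankZeroAtTwo_of`).

**HISTORY v2.17 → v2.18 (2026-08-31, LEAD ss-1 GEN 25 on director (905)(b)(ii) «(R1) CONTRAGREDIENT KEYING»; CONDENSED in v2.20 for the 200 000-byte cap — VERBATIM
in the tree history (registry v2.19 ad3ba3fc :54–77, v2.18 3155ffb6 :40–63) and in `run/shared/lean/pub/bsd-2adic/ss/gen25/v218/`).**  One paragraph: the Kummer pairing is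
CONTRAGREDIENT (`(1+X)•ν((1+T)•w) = ν w`, ★ p830536), so in the (8)-carriers EXACTLY the two dual binders were re-keyed — `D : SharpFlatSelmerDualData W κ γ⁻¹ …`,
`Y : W.FineSelmerDualData κ γ⁻¹` (the print modules; `I` stays over `γ`, maps Λ-linear); `PublishedInputsAtTwo`'s Kato 13.4 (2)-at-2 conjunct became the print-exact
`Kato2004.thm13_4_two_lengthAt_fineSelmerDualContra_le_of_isEulerSystemClassTwo` and the redundant `hasEntireLFunction_rat` was dropped (9 → 8 print names); §7 re-keyed by
name (ROAD-CONTRA ★★ p831246 / ★★ p831485: `…_contra` twins of the T-84 road, EC♭, K87-C; `(ξ, L′) := (ι ξ′, ±ι(ξ′·h))`, `constantCoeff_invol`, `evalAt_neg_two_invol`).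

**HISTORY v2.16 → v2.17 (2026-08-31, LEAD ss-1 GEN 25 on director (895); CONDENSED in v2.19 for the 200 000-byte cap — VERBATIM in the tree history
(registry v2.18 3155ffb6 :66–87, v2.17 b90024f4 :39–60) and in `run/shared/lean/pub/bsd-2adic/ss/gen25/v217/`).**  One paragraph: (i) `stub_hondaAtTwo` ((C1))
RETIRED — landed by name ★★★ p829207 ∘ ★★★ p829135; (ii) COUNT♭ dropped by name (`FlatCKPackageAtTwo` = `FlatPackageAtTwo` minus conjunct (7) = ★ p829198,
glue `flatPackageAtTwo_of_CK`); (iii) W-88 twist-point pinch wired: stub 5/5 `LowerBoundOffGenericOddAtTwo` gained its SECOND escape (off the locus «some avatar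
`G` of `ϖ·L♭` has `μ(G) = 0 ∧ λ(G) ≤ 1` and some `W₂ ≅ E^{(2)}` has `corank Sel_{2^∞}(W₂) ≥ 2`), kernel `bsdp_two_of_twistPinch` (K87-C ★★ p827897 + -imc's
★★ p829313 / ★ p830132), composition three-way; 6 → 5 stubs.

# Line `odd_blind_package` v2.16 for crux `SupersingularRankZeroAtTwo` (item stmt-BirchSwinnertonDyer-19097) —
# TYPED BODIES per director-bsd (655): the IMC-lens ♭ package at the BLIND character `ψ₂` (`T = −2`), ported
# BY NAME over the tree's ♭ carriers; PUBLISH-ONLY (cell bsd-f1-sign2, seat `-imc` g27 … g33; no registry verb run by `-imc`).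

**HISTORY v2.14 → v2.16 (2026-08-31, LEAD ss-1 GEN 24 on director (844); CONDENSED in v2.18 for the 200 000-byte cap — the paragraph stands VERBATIM in the tree
history (registry v2.17 b90024f4 :65–98, v2.16 894e1c85 :49–82) and in `run/shared/lean/pub/bsd-2adic/ss/gen24/v216/`).**  One paragraph: stub 2 `stub_allFlatData`
SPLIT into (a) `stub_hondaAtTwo : F1Sign2.HondaSystemAtTwoExists` ((C1); landed ★★★ p829135/p829207, retired in v2.17) and (b) `stub_flatPackage : FlatPackageAtTwo`
(the ♭ package proper for every Honda system: COUNT♭ ∧ CK♭′ with F1♭/F3 verbatim and F4rat REPLACED by the zeta line in local form ZL2 — at each height-one `𝔭 ∌ 2` a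
`𝔭`-unit multiple of the value-pinned `s₀` is a non-zero genuine `2`-adic Euler class, Kato §13.12–13.14); F4rat fed BY NAME from `stub_pub` += Kato 13.4 (2) at 2;
v2.15 folded: `stub_flatKernelCyclic` closed by name modulo print (`flatKernelCyclicHondaAtTwo_of_pub` = ★ p825964 ∘ ★★ p827715, `stub_pub` += Greenberg 1989 §3 Cor. 2);
glue `uniformFlatHondaDataAtTwo_of_pub` rebuilds the v2.14 nine-conjunct package in the kernel; 6 stubs then.

**HISTORY v2.3 → v2.14 (2026-08-31; bytes by seat `-imc` g28–g33 and the LEAD ss-1 lineage GEN 17–24, registrations by the LEAD) — CONDENSED FURTHER in v2.21 for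
the 200 000-byte cap: the two one-line-per-version paragraphs «HISTORY v2.10.1 → v2.14» and «HISTORY v2.3 → v2.10» stand VERBATIM in the tree history of this file
(registry v2.20 39efd4f3 :107–134; v2.16 894e1c85 :84–183 for the originals) and in `run/shared/lean/pub/bsd-2adic/ss/gen24/{v214,v216}/`.  Net content: v2.3–v2.10 =
the K67 package ported by name, Honda-guarded twins (v2.7), CDF±_H/CDF_glob landed by name (v2.8/v2.9), CDC_H (v2.10); v2.11–v2.14 = slot 5 retired by the tree
theorem, `stub_fineMu` (A)@2 replaces μ♭ (v2.12), slot 4 split into (hA) classical + (hC_H) kernel-cyclic (v2.13), slot 4a closed by name (v2.14); registered-stub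
count 7 throughout that span.

**HISTORY v2 PORT-FIDELITY NOTE (director (655) (i)–(iv); CONDENSED in v2.21 — VERBATIM in the tree history, registry v2.20 39efd4f3 :136–164):** supersedes v1
(NOT A LINE: costume `stub_transport`, shredding); (i) every K67 statement ported with its REAL body from `MEMO-imc-data/dimc67g25/Sketch67.v4.lean` over the tree's ♭
carriers; (ii) stubs = named research statements, no `∃ (_ : Prop), True`; (iii) the composition `SupersingularRankZeroAtTwo_of` concludes the crux BY NAME from the stubs
only; (iv) BC7 `#h21_crux_probe` on every stub statement and «sorries = stubs» before publish.

**HISTORY v2 → v2.2 (2026-08-30/31; seat `-imc` g27 bytes, director (669), pen RC-656 (A1) «UN-BUNDLE THE DIVISIBILITY», REF1-AUDIT §389 R389a «PIN THE DATUM»;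
CONDENSED in v2.20 for the 200 000-byte cap — the three paragraphs «v2.1 DELTA», «v2.2 DELTA», «STUBS (7)» stand VERBATIM in the tree history of this file (registry v2.19
ad3ba3fc :157–223 = v2.18 3155ffb6 :143–209) and in `run/shared/lean/pub/bsd-2adic/ss/gen25/v219/`).**  One paragraph: v2.1 un-bundled the divisibility disjunct of the odd
signed datum from the uniform ♭ data; v2.2 RE-TYPED stub 6 (`stub_oddFlatValueLaw`) over stub 2's OWN BINDERS — `(κ, γ)`, `v ∋ 2`, Sprung's `(g, c)` with the Honda₂ clauses,
a ♭ dual datum, the newform `f` with period ratio `ϖ`, the Sprung pair `(L♯, L♭)`, a generator `ξ` of `char X♭` and the INTEGRAL AVATAR `G ∈ Λ` of `ϖ·L♭` (binders, not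
witnesses: REF1's diagonal shadow no longer implies it) — and the composition builds the PINNED datum `(ξ, ±G, c)` in the kernel on the generic odd half, Miller's halves
elsewhere; the door K67-D is typed and derived but not on the path.  `PARTITION 52421 = 17880 + 27650 + 3440 + 3451 unchanged; beyond-print theorem: no; BSD not proved`;
bears_on: stmt-BirchSwinnertonDyer-19097.
-/

set_option autoImplicit false
set_option linter.dupNamespace false
set_option linter.unusedVariables false

noncomputable section

open scoped Classical MatrixGroups ModularForm NumberField
open NumberField IsDedekindDomain CongruenceSubgroup WeierstrassCurve PowerSeries
open Literature.NumberTheory.EllipticCurves Literature.NumberTheory.EllipticCurves.IwasawaDual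
  Literature.NumberTheory.EllipticCurves.Sprung2012 Literature.NumberTheory.EllipticCurves.Sprung2017
  Literature.NumberTheory.EllipticCurves.ModularForms
  Literature.NumberTheory.EllipticCurves.Rank1Residual Literature.NumberTheory.EllipticCurves.Rank1Residual.Typed
  Literature.NumberTheory.EllipticCurves.Kobayashi2003 Literature.NumberTheory.GaloisRepresentations ZpExtension
open Summit.BirchSwinnertonDyer.Rank1Residual Summit.BirchSwinnertonDyer.Rank1Residual.Supersingular
  Summit.BirchSwinnertonDyer.Rank1Residual.Supersingular.BlindLever Summit.BirchSwinnertonDyer.Rank1Residual.X5.O1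

namespace Summit.BirchSwinnertonDyer.BirchSwinnertonDyer.Cruxes.SupersingularRankZeroAtTwo

namespace OddBlindPackage

/-! ## §1 The odd (regulator) package at the blind character — predicates on the rank-0 signed carrier `SignedDatum W 2`
(ported from Sketch67.v4 §1; the two predicates are line-local `def`s, not dot-notation on the tree structure) -/

section OddPackage

variable {W : WeierstrassCurve ℚ}

/-- **(K₋₂′) the signed Euler characteristic at the order-2 character on the ODD-TWIST half, as a predicate on the
datum.**  For `Wd` a globally minimal `ℚ`-model of `W^{(2)}`: if `rank Wd(ℚ) = 1` and `Ш(Wd)[2^∞]` is finite then for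
every non-torsion `P ∈ Wd(ℚ)`, `ξ(−2) ≠ 0` and
`v₂ ξ(−2) = e + v₂ #Ш(Wd)[2^∞] + v₂ Tam(Wd) + 2·(ord₂ log_Ŵd(P) − v₂ [Wd(ℚ) : ℤP])` (blind index `e`; intended
instance `ξ = ξ♭`, `e = 0`).  Unwritten at `p = 2`; a hypothesis predicate, nothing asserted.
[cite: Kobayashi2003, Thm. 9.3 (shape only — control at finite layers, odd p; nothing asserted)]
[cite: PerrinRiou1993Fourier, Prop. 3.4.5–3.4.6 (shape only — transverse local condition in rank 1; nothing asserted)] -/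
def BlindRegulatorCharacteristicAt
    (D : SignedDatum W 2) (Wd : WeierstrassCurve ℚ) [Wd.IsElliptic] [Wd.IsGloballyMinimal] (e : ℕ) : Prop :=
  (∃ C : VariableChange ℚ, C • W.quadraticTwist 2 = Wd) → Wd.mordellWeilRank = 1 →
    Finite (AddCommGroup.primaryComponent Wd.sha 2) →
    ∀ (ι : ℚ →+* ℚ_[2]) (P : (Wd.baseChange ℚ).toAffine.Point), ¬ IsOfFinAddOrder P →
      evalAt (-2 : ℤ_[2]) D.xi ≠ 0 ∧
      ((evalAt (-2 : ℤ_[2]) D.xi).valuation : ℤ) =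
        (e : ℤ) + (padicValNat 2 (Nat.card (AddCommGroup.primaryComponent Wd.sha 2)) : ℤ) +
          (padicValNat 2 Wd.tamagawaProduct : ℤ) +
          2 * (padicLogOrd Wd 2 ι P - (padicValNat 2 (AddSubgroup.zmultiples P).index : ℤ))

/-- **(P₋₂′) the blind VALUE LAW on the odd-twist half, as a predicate on the datum**: same shape for `L(−2)`
(intended instance `L = L♭`, `e = 0`: the `-an` seat's P-an-40B `FlatBlindLogSquareBSDAtChi8`, 453 MATCH + 35
CONSISTENT / 488 rows).  A hypothesis predicate, nothing asserted.
[cite: Sprung2017, Cor. 4.4 and §1.1 (shape only; nothing asserted)] -/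
def BlindRegulatorInterpolation
    (D : SignedDatum W 2) (Wd : WeierstrassCurve ℚ) [Wd.IsElliptic] [Wd.IsGloballyMinimal] (e : ℕ) : Prop :=
  (∃ C : VariableChange ℚ, C • W.quadraticTwist 2 = Wd) → Wd.mordellWeilRank = 1 →
    Finite (AddCommGroup.primaryComponent Wd.sha 2) →
    ∀ (ι : ℚ →+* ℚ_[2]) (P : (Wd.baseChange ℚ).toAffine.Point), ¬ IsOfFinAddOrder P →
      evalAt (-2 : ℤ_[2]) D.L ≠ 0 ∧
      ((evalAt (-2 : ℤ_[2]) D.L).valuation : ℤ) =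
        (e : ℤ) + (padicValNat 2 (Nat.card (AddCommGroup.primaryComponent Wd.sha 2)) : ℤ) +
          (padicValNat 2 Wd.tamagawaProduct : ℤ) +
          2 * (padicLogOrd Wd 2 ι P - (padicValNat 2 (AddSubgroup.zmultiples P).index : ℤ))

/-- Norms on `ℤ₂` from valuations: two non-zero `2`-adic integers with equal valuation have equal norm. [folklore] -/
theorem norm_eq_norm_of_valuation_eq {x y : ℤ_[2]} (hx : x ≠ 0) (hy : y ≠ 0)
    (h : x.valuation = y.valuation) : ‖x‖ = ‖y‖ := by
  rw [PadicInt.norm_eq_zpow_neg_valuation hx, PadicInt.norm_eq_zpow_neg_valuation hy, h]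

/-- **(K₋₂′) ∧ (P₋₂′) with the same index `e`, on a rank-1 twist with finite `Ш[2^∞]` and a non-torsion point ⇒
the blind certificate `L(−2) ≠ 0 ∧ ‖ξ(−2)‖₂ = ‖L(−2)‖₂`.**  Bookkeeping: both valuations equal the same integer.
Nothing asserted. [folklore] -/
theorem blindCertificate_of_oddPackage (D : SignedDatum W 2) {Wd : WeierstrassCurve ℚ} [Wd.IsElliptic]
    [Wd.IsGloballyMinimal] {e : ℕ} (htw : ∃ C : VariableChange ℚ, C • W.quadraticTwist 2 = Wd)
    (hr : Wd.mordellWeilRank = 1) (hsha : Finite (AddCommGroup.primaryComponent Wd.sha 2))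
    (ι : ℚ →+* ℚ_[2]) (P : (Wd.baseChange ℚ).toAffine.Point) (hP : ¬ IsOfFinAddOrder P)
    (hK : BlindRegulatorCharacteristicAt D Wd e) (hI : BlindRegulatorInterpolation D Wd e) :
    evalAt (-2 : ℤ_[2]) D.L ≠ 0 ∧ ‖evalAt (-2 : ℤ_[2]) D.xi‖ = ‖evalAt (-2 : ℤ_[2]) D.L‖ := by
  obtain ⟨hxi0, hxi⟩ := hK htw hr hsha ι P hP
  obtain ⟨hL0, hL⟩ := hI htw hr hsha ι P hP
  refine ⟨hL0, norm_eq_norm_of_valuation_eq hxi0 hL0 ?_⟩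
  exact_mod_cast hxi.trans hL.symm

/-- **ASSEMBLY ON THE ODD-TWIST HALF (`p = 2`, analytic rank `0`).**  For a signed datum `D = (ξ, L, c)` at `(E, 2)`
with the tree's rank-0 readings at the TRIVIAL character ((K), (P), `2 ∤ c`), `E[2]` irreducible, GZK, `L(E,1) ≠ 0`:
ONE divisibility of the signed main conjecture (either side) together with the ODD PACKAGE at the order-2 character —
(K₋₂′) and (P₋₂′) with the same blind index for a globally minimal `ℚ`-model `Wd` of `E^{(2)}` of Mordell–Weil rank `1`
with finite `Ш(Wd)[2^∞]` and a non-torsion point — gives Miller's `BSD(E,2)`.  Composition of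
`blindCertificate_of_oddPackage` with the tree lever `bsdp_two_of_oneDivisibility_of_blindCertificate`; nothing asserted.
[cite: Kobayashi2003, §3 and Thm. 1.2] [cite: Miller2011LMS, Def. 1.1] -/
theorem bsdp_two_of_oneDivisibility_of_oddBlindControl (W : WeierstrassCurve ℚ) [W.IsElliptic]
    [W.IsGloballyMinimal] (hGZK : rank_eq_analyticRank_of_analyticRank_le_one)
    (hirr : W.HasIrreducibleModPGaloisRep 2) (hL1 : W.entireLFunction 1 ≠ 0) (D : SignedDatum W 2)
    (hc : ¬ 2 ∣ D.c) (hK : D.EulerCharacteristic) (hP : D.Interpolation)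
    (hdiv : D.LowerDivisibility ∨ D.UpperDivisibility)
    {Wd : WeierstrassCurve ℚ} [Wd.IsElliptic] [Wd.IsGloballyMinimal] {e : ℕ}
    (htw : ∃ C : VariableChange ℚ, C • W.quadraticTwist 2 = Wd)
    (hr : Wd.mordellWeilRank = 1) (hsha : Finite (AddCommGroup.primaryComponent Wd.sha 2))
    (ι : ℚ →+* ℚ_[2]) (Pt : (Wd.baseChange ℚ).toAffine.Point) (hPt : ¬ IsOfFinAddOrder Pt)
    (hKb : BlindRegulatorCharacteristicAt D Wd e) (hIb : BlindRegulatorInterpolation D Wd e) : BSDp W 2 := by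
  obtain ⟨hcert0, hcert⟩ := blindCertificate_of_oddPackage D htw hr hsha ι Pt hPt hKb hIb
  exact bsdp_two_of_oneDivisibility_of_blindCertificate W hGZK hirr hL1 D hc hK hP hdiv hcert0 hcert

end OddPackage

/-! ## §2 The IMC-lens decomposition typed over Sprung's `X♭(E/ℚ_∞)` at `2` (ported verbatim from Sketch67.v4 §2:
K67-A, K67-EC, K67-NF, K67-CD and the kernel-checked `flatBlindRegulatorCharacteristicAtTwo_of`) -/

/-- **K67-A `FlatBlindRegulatorCharacteristicAtTwo` — THE CANDIDATE OF RECORD (IMC lens, blind character, odd-twist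
half): the BLIND ♭ EULER CHARACTERISTIC = the arithmetic `log²`-BSD₂ quotient of the twist.**
For `E = W/ℚ` non-CM, good supersingular at `2`, on the odd-twist half `w(E)·χ₈(N) = −1`, for the cyclotomic
`ℤ₂`-extension (`κ`, top generator `γ`, cyclotomic variable), Honda–Sprung local data `(g, c)` at the place over `2`
(the four clauses of the tree's uniform ♭ line, verbatim), every ♭ dual Selmer datum `X♭` (finitely generated,
torsion, `char = (f)`), every globally minimal model `W₂` of `E^{(2)}` with `rank W₂(ℚ) = 1` and finite `Ш(W₂)[2^∞]`,
and every non-torsion `P ∈ W₂(ℚ)`:  `f(−2) ≠ 0` and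
`v₂ f(−2) = v₂ #Ш(W₂)[2^∞] + v₂ Tam(W₂) + 2·(ord₂ log_Ŵ₂(P) − v₂ [W₂(ℚ) : ℤP])`  (blind index `0`).
Why it might fail: a nonzero finite Λ-submodule of `X♭` at `2` (`δ > 0`), or a non-transverse ♭-line at `ψ₂`
(`Sel♭_∞[γ+1]` infinite — a₂-UNIFORMLY the ♭ colour is the only candidate: `L♯(−2) = 0` is forced on this half,
`tsum_sharp_neg_two_eq_zero`), shifts the offset; unwritten at `p = 2`.  v2.2 (R390a): stub 2's 2-primitivity clause
(5) is a binder, so the block is a literal prefix of `UniformFlatDataAtTwo`.  Nothing asserted.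
[cite: Kobayashi2003, Thm. 1.2, Thm. 9.3 (shape only, odd p)] [cite: Sprung2012, Def. 1.1, Thm. 2.2 (the ♭ objects at 2)]
[cite: PerrinRiou1993Fourier, §3.4 (shape only)] -/
def FlatBlindRegulatorCharacteristicAtTwo : Prop :=
  ∀ (W : WeierstrassCurve ℚ) [W.IsElliptic] [W.IsGloballyMinimal],
  ¬ W.HasCM → GoodSS W 2 → W.rootNumber * ZMod.χ₈ (W.conductorNorm ℤ : ZMod 8) = -1 →
  ∀ (κ : ZpExtension ℚ 2) (γ : Field.absoluteGaloisGroup ℚ),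
    κ.IsCyclotomic → κ.IsTopGenerator γ → IsCyclotomicVariable 2 γ →
  ∀ (v : HeightOneSpectrum (𝓞 ℚ)), (2 : 𝓞 ℚ) ∈ v.asIdeal →
  ∀ (g : Field.absoluteGaloisGroup (v.adicCompletion ℚ)) (c : ℕ → localPoints W (v.adicCompletion ℚ)),
    κ.IsTopGenerator (resGalOfEmb (closureEmb (K := ℚ) (v.adicCompletion ℚ)) g) →
    (∀ n, c n ∈ localLayerPointsOfEmb κ (closureEmb (K := ℚ) (v.adicCompletion ℚ)) W n) →
    (∀ n, 1 ≤ n → localTraceOfEmb κ (closureEmb (K := ℚ) (v.adicCompletion ℚ)) W n (n + 1)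
      (c (n + 1)) = W.frobeniusTrace 2 • c n - c (n - 1)) →
    (∀ z₀ : localLayerPointsOfEmb κ (closureEmb (K := ℚ) (v.adicCompletion ℚ)) W 0 →+ ℤ_[2],
      evalOn W (localLayerPointsOfEmb κ (closureEmb (K := ℚ) (v.adicCompletion ℚ)) W 0) z₀ (c 0) = 0 →
        z₀ = 0) →
    (∀ a : ℤ_[2],
      (∃ z₀ : localLayerPointsOfEmb κ (closureEmb (K := ℚ) (v.adicCompletion ℚ)) W 0 →+ ℤ_[2],
        evalOn W (localLayerPointsOfEmb κ (closureEmb (K := ℚ) (v.adicCompletion ℚ)) W 0) z₀ (c 0) = 2 * a) →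
      ∃ y : localLayerPointsOfEmb κ (closureEmb (K := ℚ) (v.adicCompletion ℚ)) W 0 →+ ℤ_[2],
        evalOn W (localLayerPointsOfEmb κ (closureEmb (K := ℚ) (v.adicCompletion ℚ)) W 0) y (c 0) = a) →
  ∀ (D : SharpFlatSelmerDualData W κ γ (closureEmb (K := ℚ) (v.adicCompletion ℚ))
      (W.frobeniusTrace 2) g c .flat) [Module.Finite (IwasawaAlgebra 2) D.X],
    Module.IsTorsion (IwasawaAlgebra 2) D.X →
  ∀ f : IwasawaAlgebra 2, D.charIdeal = Ideal.span {f} →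
  ∀ (W₂ : WeierstrassCurve ℚ) [W₂.IsElliptic] [W₂.IsGloballyMinimal],
    (∃ C : WeierstrassCurve.VariableChange ℚ, C • W.quadraticTwist 2 = W₂) →
    W₂.mordellWeilRank = 1 → Finite (AddCommGroup.primaryComponent W₂.sha 2) →
  ∀ (ι : ℚ →+* ℚ_[2]) (P : (W₂.baseChange ℚ).toAffine.Point), ¬ IsOfFinAddOrder P →
    evalAt (-2 : ℤ_[2]) f ≠ 0 ∧
    ((evalAt (-2 : ℤ_[2]) f).valuation : ℤ) =
      (padicValNat 2 (Nat.card (AddCommGroup.primaryComponent W₂.sha 2)) : ℤ) +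
        (padicValNat 2 W₂.tamagawaProduct : ℤ) +
        2 * (padicLogOrd W₂ 2 ι P - (padicValNat 2 (AddSubgroup.zmultiples P).index : ℤ))

/-- **K67-EC `FlatBlindEulerCharAtTwo` (piece 1, Λ-ALGEBRA at the blind character)**: for every ♭ dual Selmer datum
`X♭` at `2` (f.g., torsion, `char = (f)`), if the `ψ₂`-anti-invariants `Sel♭_∞[γ+1]` and the `ψ₂`-coinvariants
`Sel♭_∞/(γ+1)` are finite then `f(−2) ≠ 0` and `v₂ f(−2) = log₂ #Sel♭_∞[γ+1] − log₂ #Sel♭_∞/(γ+1)`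
(the Γ-Euler characteristic of the `ψ₂`-twist; `γ` acts on `X♭` as `1+T`, so `γ + 1 ↔ T + 2`).  In print at the
trivial character for every `p` (Schneider 1985 / CSS 2003 (31); tree `Schneider1985_order_charGenerator_of_eulerChar`);
the twist by the order-2 character is the same algebra.  Why it might fail: only through the `p = 2` bookkeeping of
the twist (`ψ₂` has values in `ℤ₂^×` but `1 − ψ₂(γ) = 2` is a NON-unit: the twisted module `X♭(ψ₂)` and `X♭` have the
same `λ` but the Euler-characteristic formula acquires no unit ambiguity only if stated, as here, with `#ker/#coker`).
Nothing asserted. [cite: CoatesSchneiderSujatha2003, §3 (30)–(31) p. 199] [cite: Schneider1985, §1] -/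
def FlatBlindEulerCharAtTwo : Prop :=
  ∀ (W : WeierstrassCurve ℚ) [W.IsElliptic] [W.IsGloballyMinimal], GoodSS W 2 →
  ∀ (κ : ZpExtension ℚ 2) (γ : Field.absoluteGaloisGroup ℚ),
    κ.IsCyclotomic → κ.IsTopGenerator γ → IsCyclotomicVariable 2 γ →
  ∀ (v : HeightOneSpectrum (𝓞 ℚ)), (2 : 𝓞 ℚ) ∈ v.asIdeal →
  ∀ (g : Field.absoluteGaloisGroup (v.adicCompletion ℚ)) (c : ℕ → localPoints W (v.adicCompletion ℚ)),
    κ.IsTopGenerator (resGalOfEmb (closureEmb (K := ℚ) (v.adicCompletion ℚ)) g) →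
  ∀ (D : SharpFlatSelmerDualData W κ γ (closureEmb (K := ℚ) (v.adicCompletion ℚ))
      (W.frobeniusTrace 2) g c .flat) [Module.Finite (IwasawaAlgebra 2) D.X],
    Module.IsTorsion (IwasawaAlgebra 2) D.X →
  ∀ f : IwasawaAlgebra 2, D.charIdeal = Ideal.span {f} →
    Finite (endInvariants (conjSharpFlatSelmerInfty W κ (closureEmb (K := ℚ) (v.adicCompletion ℚ))
      (W.frobeniusTrace 2) g c .flat γ + 1)) →
    Finite (EndCoinvariants (conjSharpFlatSelmerInfty W κ (closureEmb (K := ℚ) (v.adicCompletion ℚ))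
      (W.frobeniusTrace 2) g c .flat γ + 1)) →
    evalAt (-2 : ℤ_[2]) f ≠ 0 ∧
    ((evalAt (-2 : ℤ_[2]) f).valuation : ℤ) =
      (padicValNat 2 (Nat.card (endInvariants (conjSharpFlatSelmerInfty W κ
          (closureEmb (K := ℚ) (v.adicCompletion ℚ)) (W.frobeniusTrace 2) g c .flat γ + 1))) : ℤ) -
        (padicValNat 2 (Nat.card (EndCoinvariants (conjSharpFlatSelmerInfty W κ
          (closureEmb (K := ℚ) (v.adicCompletion ℚ)) (W.frobeniusTrace 2) g c .flat γ + 1))) : ℤ)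

/-- **v2.4: K67-EC BY NAME.**  The tree theorem `OddBlindEC.flatBlindEulerCharAtTwo` (p797558; Greenberg's Lemma 4.2 for
the `T ↦ T+2`-twisted dual pair of the ♭ datum) states the body of `FlatBlindEulerCharAtTwo` verbatim; `exact` closes the
named `def` by unfolding. [folklore] -/
theorem flatBlindEulerCharAtTwo_holds : FlatBlindEulerCharAtTwo := by
  unfold FlatBlindEulerCharAtTwo
  exact Summit.BirchSwinnertonDyer.BirchSwinnertonDyer.Theorems.OddBlindEC.flatBlindEulerCharAtTwo

/-- **K67-NF `FlatBlindNoCotorsionAtTwo` (piece 2, `δ = 0`)**: for every ♭ dual Selmer datum `X♭` at `2` (f.g.,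
torsion), if `Sel♭_∞[γ+1]` is finite then the `ψ₂`-coinvariants `Sel♭_∞/(γ+1)·Sel♭_∞` are TRIVIAL — equivalently
`X♭[T+2] = 0`, which follows from "no nonzero finite Λ-submodule" (B.D. Kim 2013 for `±` at ODD `p`; Greenberg 1999
Prop. 4.14–4.15 for the ordinary Selmer group) once `(T+2) ∤ char X♭`.  Why it might fail: no Kim-type theorem for
Sprung's `X♭` at `p = 2` is in print; a finite submodule of order `2^δ` would shift the blind index by `−δ`.
Nothing asserted. [cite: Kim2013PlusMinus, Thm. 1.1 (odd p; shape only)] [cite: Greenberg1999LNM1716, Prop. 4.14, 4.15] -/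
def FlatBlindNoCotorsionAtTwo : Prop :=
  ∀ (W : WeierstrassCurve ℚ) [W.IsElliptic] [W.IsGloballyMinimal], GoodSS W 2 →
  ∀ (κ : ZpExtension ℚ 2) (γ : Field.absoluteGaloisGroup ℚ),
    κ.IsCyclotomic → κ.IsTopGenerator γ → IsCyclotomicVariable 2 γ →
  ∀ (v : HeightOneSpectrum (𝓞 ℚ)), (2 : 𝓞 ℚ) ∈ v.asIdeal →
  ∀ (g : Field.absoluteGaloisGroup (v.adicCompletion ℚ)) (c : ℕ → localPoints W (v.adicCompletion ℚ)),
    κ.IsTopGenerator (resGalOfEmb (closureEmb (K := ℚ) (v.adicCompletion ℚ)) g) →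
    (∀ n, c n ∈ localLayerPointsOfEmb κ (closureEmb (K := ℚ) (v.adicCompletion ℚ)) W n) →
    (∀ n, 1 ≤ n → localTraceOfEmb κ (closureEmb (K := ℚ) (v.adicCompletion ℚ)) W n (n + 1)
      (c (n + 1)) = W.frobeniusTrace 2 • c n - c (n - 1)) →
    (∀ z₀ : localLayerPointsOfEmb κ (closureEmb (K := ℚ) (v.adicCompletion ℚ)) W 0 →+ ℤ_[2],
      evalOn W (localLayerPointsOfEmb κ (closureEmb (K := ℚ) (v.adicCompletion ℚ)) W 0) z₀ (c 0) = 0 →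
        z₀ = 0) →
    (∀ a : ℤ_[2],
      (∃ z₀ : localLayerPointsOfEmb κ (closureEmb (K := ℚ) (v.adicCompletion ℚ)) W 0 →+ ℤ_[2],
        evalOn W (localLayerPointsOfEmb κ (closureEmb (K := ℚ) (v.adicCompletion ℚ)) W 0) z₀ (c 0) = 2 * a) →
      ∃ y : localLayerPointsOfEmb κ (closureEmb (K := ℚ) (v.adicCompletion ℚ)) W 0 →+ ℤ_[2],
        evalOn W (localLayerPointsOfEmb κ (closureEmb (K := ℚ) (v.adicCompletion ℚ)) W 0) y (c 0) = a) →
  ∀ (D : SharpFlatSelmerDualData W κ γ (closureEmb (K := ℚ) (v.adicCompletion ℚ))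
      (W.frobeniusTrace 2) g c .flat) [Module.Finite (IwasawaAlgebra 2) D.X],
    Module.IsTorsion (IwasawaAlgebra 2) D.X →
    Finite (endInvariants (conjSharpFlatSelmerInfty W κ (closureEmb (K := ℚ) (v.adicCompletion ℚ))
      (W.frobeniusTrace 2) g c .flat γ + 1)) →
    Subsingleton (EndCoinvariants (conjSharpFlatSelmerInfty W κ (closureEmb (K := ℚ) (v.adicCompletion ℚ))
      (W.frobeniusTrace 2) g c .flat γ + 1))

/-- **NF♭ `FlatNoFiniteSubmoduleAtTwo` (v2.5; the honest research statement behind K67-NF, Kim shape at `2`)**: for every ♭ dual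
Selmer datum at `2` (f.g., torsion), Sprung's `X♭(E/ℚ_∞)` has NO non-zero finite `Λ`-submodule.  Binder block of
`FlatBlindNoCotorsionAtTwo` verbatim through the torsion binder (text = tower-1 GEN 57 `ByName_NF.scratch.lean`).  Why it might
fail: no Kim-type theorem for Sprung's `X♭` at `p = 2` is in print (Kim 2013 / Kitajima–Otsuki 2018 are odd `p`, `a_p = 0`, `±`);
Greenberg's Prop. 4.12 input transfers only for the AMBIENT dual, not for the quotient `X♭`.  Nothing asserted.
[cite: Kim2013PlusMinus, Thm. 1.1, 3.14 (odd p; shape only)] [cite: Greenberg1999LNM1716, Prop. 4.14, 4.15] -/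
def FlatNoFiniteSubmoduleAtTwo : Prop :=
  ∀ (W : WeierstrassCurve ℚ) [W.IsElliptic] [W.IsGloballyMinimal], GoodSS W 2 →
  ∀ (κ : ZpExtension ℚ 2) (γ : Field.absoluteGaloisGroup ℚ),
    κ.IsCyclotomic → κ.IsTopGenerator γ → IsCyclotomicVariable 2 γ →
  ∀ (v : HeightOneSpectrum (𝓞 ℚ)), (2 : 𝓞 ℚ) ∈ v.asIdeal →
  ∀ (g : Field.absoluteGaloisGroup (v.adicCompletion ℚ)) (c : ℕ → localPoints W (v.adicCompletion ℚ)),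
    κ.IsTopGenerator (resGalOfEmb (closureEmb (K := ℚ) (v.adicCompletion ℚ)) g) →
    (∀ n, c n ∈ localLayerPointsOfEmb κ (closureEmb (K := ℚ) (v.adicCompletion ℚ)) W n) →
    (∀ n, 1 ≤ n → localTraceOfEmb κ (closureEmb (K := ℚ) (v.adicCompletion ℚ)) W n (n + 1)
      (c (n + 1)) = W.frobeniusTrace 2 • c n - c (n - 1)) →
    (∀ z₀ : localLayerPointsOfEmb κ (closureEmb (K := ℚ) (v.adicCompletion ℚ)) W 0 →+ ℤ_[2],
      evalOn W (localLayerPointsOfEmb κ (closureEmb (K := ℚ) (v.adicCompletion ℚ)) W 0) z₀ (c 0) = 0 →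
        z₀ = 0) →
    (∀ a : ℤ_[2],
      (∃ z₀ : localLayerPointsOfEmb κ (closureEmb (K := ℚ) (v.adicCompletion ℚ)) W 0 →+ ℤ_[2],
        evalOn W (localLayerPointsOfEmb κ (closureEmb (K := ℚ) (v.adicCompletion ℚ)) W 0) z₀ (c 0) = 2 * a) →
      ∃ y : localLayerPointsOfEmb κ (closureEmb (K := ℚ) (v.adicCompletion ℚ)) W 0 →+ ℤ_[2],
        evalOn W (localLayerPointsOfEmb κ (closureEmb (K := ℚ) (v.adicCompletion ℚ)) W 0) y (c 0) = a) →
  ∀ (D : SharpFlatSelmerDualData W κ γ (closureEmb (K := ℚ) (v.adicCompletion ℚ))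
      (W.frobeniusTrace 2) g c .flat) [Module.Finite (IwasawaAlgebra 2) D.X],
    Module.IsTorsion (IwasawaAlgebra 2) D.X →
    ∀ N : Submodule (IwasawaAlgebra 2) D.X, Finite N → N = ⊥

/-- **v2.5: K67-NF BY NAME from NF♭.**  Slot 4's former statement `FlatBlindNoCotorsionAtTwo` is DERIVED from
`FlatNoFiniteSubmoduleAtTwo` by the tree theorem `OddBlindNF.flatBlindNoCotorsionAtTwo_of_noFiniteSubmodule` (tower-1 GEN 57,
p800727; term = tower-1's `ByName_NF.scratch.lean`). [cite: Greenberg1999LNM1716, Prop. 4.14, 4.15] -/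
theorem flatBlindNoCotorsionAtTwo_of_flatNoFiniteSubmoduleAtTwo (hNF : FlatNoFiniteSubmoduleAtTwo) :
    FlatBlindNoCotorsionAtTwo := by
  intro W _ _ hss κ γ hκ hγ hcyc v hv g c hg hc htr hz hsat D _ htors hfin
  exact Summit.BirchSwinnertonDyer.BirchSwinnertonDyer.Theorems.OddBlindNF.flatBlindNoCotorsionAtTwo_of_noFiniteSubmodule
    W hss κ γ hκ hγ hcyc v hv g c hg hc htr hz hsat D htors (hNF W hss κ γ hκ hγ hcyc v hv g c hg hc htr hz hsat D htors)
    hfin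

/-! ### v2.13 (ζ)+(η): slot 4 HONDA-GUARDED and SPLIT into «classical NF at ss 2» + «♭ kernel cyclic» (director-bsd (822)(B)) -/

/-- **K67-NF_H `FlatBlindNoCotorsionHondaAtTwo`** (v2.13 (ζ); K67-NF VERBATIM with the Honda legality clause inserted after (SAT), exactly as
K67-CD_H / K67-A_H insert it): for Honda–Sprung data that ARE (the `c`-part of) a Honda system at two and every ♭ dual Selmer datum (f.g., torsion),
`Sel♭_∞[γ+1]` finite ⟹ `Sel♭_∞/(γ+1)` trivial.  WEAKER than K67-NF; it is all that `flatBlindRegulatorCharacteristicHondaAtTwo_of` applies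
(its `hNF` is used with `hH` in context).  Nothing asserted. [cite: Kim2013PlusMinus, Thm. 1.1 (odd p; shape only)] [cite: Greenberg1999LNM1716, Prop. 4.14, 4.15] -/
def FlatBlindNoCotorsionHondaAtTwo : Prop :=
  ∀ (W : WeierstrassCurve ℚ) [W.IsElliptic] [W.IsGloballyMinimal], GoodSS W 2 →
  ∀ (κ : ZpExtension ℚ 2) (γ : Field.absoluteGaloisGroup ℚ),
    κ.IsCyclotomic → κ.IsTopGenerator γ → IsCyclotomicVariable 2 γ →
  ∀ (v : HeightOneSpectrum (𝓞 ℚ)), (2 : 𝓞 ℚ) ∈ v.asIdeal →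
  ∀ (g : Field.absoluteGaloisGroup (v.adicCompletion ℚ)) (c : ℕ → localPoints W (v.adicCompletion ℚ)),
    κ.IsTopGenerator (resGalOfEmb (closureEmb (K := ℚ) (v.adicCompletion ℚ)) g) →
    (∀ n, c n ∈ localLayerPointsOfEmb κ (closureEmb (K := ℚ) (v.adicCompletion ℚ)) W n) →
    (∀ n, 1 ≤ n → localTraceOfEmb κ (closureEmb (K := ℚ) (v.adicCompletion ℚ)) W n (n + 1)
      (c (n + 1)) = W.frobeniusTrace 2 • c n - c (n - 1)) →
    (∀ z₀ : localLayerPointsOfEmb κ (closureEmb (K := ℚ) (v.adicCompletion ℚ)) W 0 →+ ℤ_[2],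
      evalOn W (localLayerPointsOfEmb κ (closureEmb (K := ℚ) (v.adicCompletion ℚ)) W 0) z₀ (c 0) = 0 →
        z₀ = 0) →
    (∀ a : ℤ_[2],
      (∃ z₀ : localLayerPointsOfEmb κ (closureEmb (K := ℚ) (v.adicCompletion ℚ)) W 0 →+ ℤ_[2],
        evalOn W (localLayerPointsOfEmb κ (closureEmb (K := ℚ) (v.adicCompletion ℚ)) W 0) z₀ (c 0) = 2 * a) →
      ∃ y : localLayerPointsOfEmb κ (closureEmb (K := ℚ) (v.adicCompletion ℚ)) W 0 →+ ℤ_[2],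
        evalOn W (localLayerPointsOfEmb κ (closureEmb (K := ℚ) (v.adicCompletion ℚ)) W 0) y (c 0) = a) →
    (∃ cneg : localPoints W (v.adicCompletion ℚ),
      Summit.BirchSwinnertonDyer.Rank1Residual.F1Sign2.IsHondaSystemAtTwo κ (closureEmb (K := ℚ) (v.adicCompletion ℚ)) W
        (W.frobeniusTrace 2) g cneg c) →
  ∀ (D : SharpFlatSelmerDualData W κ γ (closureEmb (K := ℚ) (v.adicCompletion ℚ))
      (W.frobeniusTrace 2) g c .flat) [Module.Finite (IwasawaAlgebra 2) D.X],
    Module.IsTorsion (IwasawaAlgebra 2) D.X →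
    Finite (endInvariants (conjSharpFlatSelmerInfty W κ (closureEmb (K := ℚ) (v.adicCompletion ℚ))
      (W.frobeniusTrace 2) g c .flat γ + 1)) →
    Subsingleton (EndCoinvariants (conjSharpFlatSelmerInfty W κ (closureEmb (K := ℚ) (v.adicCompletion ℚ))
      (W.frobeniusTrace 2) g c .flat γ + 1))

/-- **NF♭_H `FlatNoFiniteSubmoduleHondaAtTwo`** (v2.13 (ζ); NF♭ VERBATIM with the Honda legality clause inserted after (SAT)): for Honda-legal
data, Sprung's `X♭(E/ℚ_∞)` at `2` has NO non-zero finite `Λ`-submodule.  WEAKER than the v2.5 `FlatNoFiniteSubmoduleAtTwo` (tree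
`OddBlindNF.flatNoFiniteSubmoduleHondaAtTwo_of_unguarded`, p822887); DERIVED below from the two v2.13 stubs.  Nothing asserted.
[cite: Kim2013PlusMinus, Thm. 1.1, 3.14 (odd p; shape only)] [cite: KitajimaOtsuki2018, Thm. 4.8 (odd p; shape only)] -/
def FlatNoFiniteSubmoduleHondaAtTwo : Prop :=
  ∀ (W : WeierstrassCurve ℚ) [W.IsElliptic] [W.IsGloballyMinimal], GoodSS W 2 →
  ∀ (κ : ZpExtension ℚ 2) (γ : Field.absoluteGaloisGroup ℚ),
    κ.IsCyclotomic → κ.IsTopGenerator γ → IsCyclotomicVariable 2 γ →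
  ∀ (v : HeightOneSpectrum (𝓞 ℚ)), (2 : 𝓞 ℚ) ∈ v.asIdeal →
  ∀ (g : Field.absoluteGaloisGroup (v.adicCompletion ℚ)) (c : ℕ → localPoints W (v.adicCompletion ℚ)),
    κ.IsTopGenerator (resGalOfEmb (closureEmb (K := ℚ) (v.adicCompletion ℚ)) g) →
    (∀ n, c n ∈ localLayerPointsOfEmb κ (closureEmb (K := ℚ) (v.adicCompletion ℚ)) W n) →
    (∀ n, 1 ≤ n → localTraceOfEmb κ (closureEmb (K := ℚ) (v.adicCompletion ℚ)) W n (n + 1)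
      (c (n + 1)) = W.frobeniusTrace 2 • c n - c (n - 1)) →
    (∀ z₀ : localLayerPointsOfEmb κ (closureEmb (K := ℚ) (v.adicCompletion ℚ)) W 0 →+ ℤ_[2],
      evalOn W (localLayerPointsOfEmb κ (closureEmb (K := ℚ) (v.adicCompletion ℚ)) W 0) z₀ (c 0) = 0 →
        z₀ = 0) →
    (∀ a : ℤ_[2],
      (∃ z₀ : localLayerPointsOfEmb κ (closureEmb (K := ℚ) (v.adicCompletion ℚ)) W 0 →+ ℤ_[2],
        evalOn W (localLayerPointsOfEmb κ (closureEmb (K := ℚ) (v.adicCompletion ℚ)) W 0) z₀ (c 0) = 2 * a) →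
      ∃ y : localLayerPointsOfEmb κ (closureEmb (K := ℚ) (v.adicCompletion ℚ)) W 0 →+ ℤ_[2],
        evalOn W (localLayerPointsOfEmb κ (closureEmb (K := ℚ) (v.adicCompletion ℚ)) W 0) y (c 0) = a) →
    (∃ cneg : localPoints W (v.adicCompletion ℚ),
      Summit.BirchSwinnertonDyer.Rank1Residual.F1Sign2.IsHondaSystemAtTwo κ (closureEmb (K := ℚ) (v.adicCompletion ℚ)) W
        (W.frobeniusTrace 2) g cneg c) →
  ∀ (D : SharpFlatSelmerDualData W κ γ (closureEmb (K := ℚ) (v.adicCompletion ℚ))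
      (W.frobeniusTrace 2) g c .flat) [Module.Finite (IwasawaAlgebra 2) D.X],
    Module.IsTorsion (IwasawaAlgebra 2) D.X →
    ∀ N : Submodule (IwasawaAlgebra 2) D.X, Finite N → N = ⊥

/-- **v2.13 (ζ): K67-NF_H BY NAME from NF♭_H** (tower-1 GEN 57's `OddBlindNF.flatBlindNoCotorsionAtTwo_of_noFiniteSubmodule`, p800727, with the
Honda clause threaded to NF♭_H and otherwise unused). [cite: Greenberg1999LNM1716, Prop. 4.14, 4.15] -/
theorem flatBlindNoCotorsionHondaAtTwo_of_flatNoFiniteSubmoduleHondaAtTwo (hNF : FlatNoFiniteSubmoduleHondaAtTwo) :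
    FlatBlindNoCotorsionHondaAtTwo := by
  intro W _ _ hss κ γ hκ hγ hcyc v hv g c hg hc htr hz hsat hH D _ htors hfin
  exact Summit.BirchSwinnertonDyer.BirchSwinnertonDyer.Theorems.OddBlindNF.flatBlindNoCotorsionAtTwo_of_noFiniteSubmodule
    W hss κ γ hκ hγ hcyc v hv g c hg hc htr hz hsat D htors (hNF W hss κ γ hκ hγ hcyc v hv g c hg hc htr hz hsat hH D htors)
    hfin

/-- **h11 = (hA) `ClassicalNoFiniteSubmoduleSSAtTwo`** (v2.13 (η), first child of slot 4): for `E = W/ℚ` elliptic, globally minimal, good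
SUPERSINGULAR at `2`, `κ` cyclotomic with topological generator `γ` carrying the cyclotomic variable, EVERY finitely generated CLASSICAL dual
Selmer datum `X(E/ℚ_∞) = S.X` (`S : W.SelmerDualData κ γ`) has no non-zero finite `Λ`-submodule — Kitajima–Otsuki Thm. 4.5 = Matsuno 2003
Prop. 4.1 at `p = 2` (Hachimori–Matsuno: Cassels–Tate on the layers + stationarity of divisible parts from the bounded `ℤ₂`-corank of
`Sel_{2^∞}(E/ℚ_n)` (Kato 2004 Thm. 14.2 / Cor. 14.3 + Rohrlich) + `E(ℚ)[2] = 0`, automatic at ss `2`).  Signature = binder (hA) of the tree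
compositions `OddBlindNF.flatNoFiniteSubmoduleAtTwo_of_classical[_of_kernelCyclic]` (p822368/p822496) and of the Honda-guarded one (p822887)
VERBATIM (LEAD memo `HAND-TARGETS-NF-1.md` §1; tower-1 GEN 63 p823296 + file 2 give it modulo the two print binders).  Why it might fail:
only through a `p = 2` failure of Matsuno's Prop. 4.1 (Matsuno 2003 Thm. 6.1's finite submodules at `2` live in the ORDINARY torsion case,
from `E(K_∞)[2^∞] ∩ C_{E,v}`, empty at ss `2`).  Nothing asserted. [cite: KitajimaOtsuki2018, Prop. 4.1, Thm. 4.5 (arXiv:1607.03612 p. 18)]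
[cite: HachimoriMatsuno2000, Theorem (p. 2540)] [cite: Kato2004Asterisque, Thm. 14.2, Cor. 14.3 (pp. 235–236)] -/
def ClassicalNoFiniteSubmoduleSSAtTwo : Prop :=
  ∀ (W : WeierstrassCurve ℚ) [W.IsElliptic] [W.IsGloballyMinimal], GoodSS W 2 →
    ∀ (κ : ZpExtension ℚ 2) (γ : Field.absoluteGaloisGroup ℚ),
      κ.IsCyclotomic → κ.IsTopGenerator γ → IsCyclotomicVariable 2 γ →
    ∀ (S : W.SelmerDualData κ γ) [Module.Finite (IwasawaAlgebra 2) S.X],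
      ∀ N : Submodule (IwasawaAlgebra 2) S.X, Finite N → N = ⊥

/-- **h13 = (hC_H) `FlatKernelCyclicHondaAtTwo`** (v2.13 (η), second child of slot 4, HONDA-GUARDED): for Honda-legal data `(g, c)`, every ♭ dual
Selmer datum `D` (f.g., torsion), every classical dual `S : W.SelmerDualData κ γ` (f.g.) and every `Λ`-linear `π : S.X → D.X` over the inclusion
`Sel♭ ≤ Sel` (pinning identity `D.toDual (π x) s = S.toDual x s`), the kernel of `π` is CYCLIC: `ker π = Λ ∙ x₀` — Kitajima–Otsuki's exact sequence
(4.2) `(H¹(k_∞,E[p^∞])/E^•_∞)^∨ ≅ Ker Col^• → X ↠ X^• → 0` with their Prop. 3.32 «`(H¹(k_∞)/E^•_∞)^∨ ≅ Λ^{[k:ℚ_p]}`» for ♭ at `2`, `[ℚ₂:ℚ₂] = 1`.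
In the tree modulo two arithmetic inputs (LEAD memo ADDENDUM 1): h13a «`H¹_Iw(ℚ₂, T₂E) ≅ Λ²` in the functional model + one non-zero ♭ value»
⟹ `Ker Col♭ = Λ ∙ z♭` (`OddBlindNF.exists_colemanKer_flat_eq_span_of_linearEquiv_fin_two`, Col as a Λ-linear map from `hc`+`htr`+`2 ∣ a₂`, the
UFD lemma p822870), h13b «the Kummer pairing `Sel_∞ → (Ker Col♭)^∨` with kernel `Sel♭`» ⟹ `ker π` cyclic (`OddBlindNF.exists_ker_eq_span_singleton_of_pairing`,
p823268).  Signature = binder (hCH) of `OddBlindNF.flatNoFiniteSubmoduleHondaAtTwo_of_classical_of_kernelCyclic` (p822887) VERBATIM (memo §2).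
Why it might fail: only if `Ker Col♭` at `2` is not cyclic for some legal datum (`Col♭ ≡ 0`, excluded by the level-`0` clause) or the ♭ local
condition at the unique place over `2` is not the annihilator of a cyclic module (Sprung Def. 7.9 says it is).  Nothing asserted.
[cite: KitajimaOtsuki2018, (4.2), Prop. 3.29, Prop. 3.32, Prop. 4.6 (arXiv:1607.03612 pp. 16–19)] [cite: Sprung2012, Def. 5.9, Def. 7.9, Def. 7.11] -/
def FlatKernelCyclicHondaAtTwo : Prop :=
  ∀ (W : WeierstrassCurve ℚ) [W.IsElliptic] [W.IsGloballyMinimal], GoodSS W 2 →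
  ∀ (κ : ZpExtension ℚ 2) (γ : Field.absoluteGaloisGroup ℚ),
    κ.IsCyclotomic → κ.IsTopGenerator γ → IsCyclotomicVariable 2 γ →
  ∀ (v : HeightOneSpectrum (𝓞 ℚ)), (2 : 𝓞 ℚ) ∈ v.asIdeal →
  ∀ (g : Field.absoluteGaloisGroup (v.adicCompletion ℚ)) (c : ℕ → localPoints W (v.adicCompletion ℚ)),
    κ.IsTopGenerator (resGalOfEmb (closureEmb (K := ℚ) (v.adicCompletion ℚ)) g) →
    (∀ n, c n ∈ localLayerPointsOfEmb κ (closureEmb (K := ℚ) (v.adicCompletion ℚ)) W n) →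
    (∀ n, 1 ≤ n → localTraceOfEmb κ (closureEmb (K := ℚ) (v.adicCompletion ℚ)) W n (n + 1)
      (c (n + 1)) = W.frobeniusTrace 2 • c n - c (n - 1)) →
    (∀ z₀ : localLayerPointsOfEmb κ (closureEmb (K := ℚ) (v.adicCompletion ℚ)) W 0 →+ ℤ_[2],
      evalOn W (localLayerPointsOfEmb κ (closureEmb (K := ℚ) (v.adicCompletion ℚ)) W 0) z₀ (c 0) = 0 →
        z₀ = 0) →
    (∀ a : ℤ_[2],
      (∃ z₀ : localLayerPointsOfEmb κ (closureEmb (K := ℚ) (v.adicCompletion ℚ)) W 0 →+ ℤ_[2],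
        evalOn W (localLayerPointsOfEmb κ (closureEmb (K := ℚ) (v.adicCompletion ℚ)) W 0) z₀ (c 0) = 2 * a) →
      ∃ y : localLayerPointsOfEmb κ (closureEmb (K := ℚ) (v.adicCompletion ℚ)) W 0 →+ ℤ_[2],
        evalOn W (localLayerPointsOfEmb κ (closureEmb (K := ℚ) (v.adicCompletion ℚ)) W 0) y (c 0) = a) →
    (∃ cneg : localPoints W (v.adicCompletion ℚ),
      Summit.BirchSwinnertonDyer.Rank1Residual.F1Sign2.IsHondaSystemAtTwo κ (closureEmb (K := ℚ) (v.adicCompletion ℚ)) W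
        (W.frobeniusTrace 2) g cneg c) →
  ∀ (D : SharpFlatSelmerDualData W κ γ (closureEmb (K := ℚ) (v.adicCompletion ℚ))
      (W.frobeniusTrace 2) g c .flat) [Module.Finite (IwasawaAlgebra 2) D.X],
    Module.IsTorsion (IwasawaAlgebra 2) D.X →
  ∀ (S : W.SelmerDualData κ γ) [Module.Finite (IwasawaAlgebra 2) S.X]
    (π : S.X →ₗ[IwasawaAlgebra 2] D.X),
    (∀ (x : S.X) (s : sharpFlatSelmerInfty W κ (closureEmb (K := ℚ) (v.adicCompletion ℚ)) (W.frobeniusTrace 2) g c .flat),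
      D.toDual (π x) s = S.toDual x (AddSubgroup.inclusion
        (sharpFlatSelmerInfty_le_selmerInfty W κ (closureEmb (K := ℚ) (v.adicCompletion ℚ)) (W.frobeniusTrace 2) g c .flat) s)) →
    ∃ x₀ : S.X, LinearMap.ker π = Submodule.span (IwasawaAlgebra 2) {x₀}

/-- **v2.13 (η): NF♭_H DERIVED from the two children** — the tree theorem `OddBlindNF.flatNoFiniteSubmoduleHondaAtTwo_of_classical_of_kernelCyclic`
(★★ p822887; Kitajima–Otsuki Prop. 4.6 + 4.7 in rank one with (hB) «`rank_Λ X ≥ 1`» = Greenberg Thm. 1.7 PROVED, p822496), applied to the two stubs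
by `unfold; exact`.  Kernel-checked; no sorry of its own. [cite: KitajimaOtsuki2018, Prop. 4.6, 4.7, Thm. 4.8 (arXiv:1607.03612 p. 19)] [cite: GreenbergLNM1716, Thm. 1.7, pp. 104–105] -/
theorem flatNoFiniteSubmoduleHondaAtTwo_of_classical_of_kernelCyclic (hA : ClassicalNoFiniteSubmoduleSSAtTwo)
    (hC : FlatKernelCyclicHondaAtTwo) : FlatNoFiniteSubmoduleHondaAtTwo := by
  unfold FlatNoFiniteSubmoduleHondaAtTwo
  unfold ClassicalNoFiniteSubmoduleSSAtTwo at hA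
  unfold FlatKernelCyclicHondaAtTwo at hC
  exact Summit.BirchSwinnertonDyer.BirchSwinnertonDyer.Theorems.OddBlindNF.flatNoFiniteSubmoduleHondaAtTwo_of_classical_of_kernelCyclic
    hA hC

/-- **K67-CD `FlatBlindControlDualityAtTwo` (piece 3, CONTROL + POITOU–TATE + TRANSVERSALITY at the blind character, the
load-bearing piece)**: on the odd-twist half, the `ψ₂`-anti-invariants `Sel♭(E/ℚ_∞)[γ+1]` are finite of order
`#Ш(W₂)[2^∞] · 2^{v₂ Tam(W₂)} · 2^{2(ord₂ log_Ŵ₂ P − v₂[W₂(ℚ):ℤP])}` for every globally minimal model `W₂` of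
`E^{(2)}` of rank `1` with finite `Ш[2^∞]` and every non-torsion `P`.  Chain (MEMO §10.106): inf–res
(`E(ℚ_{2,∞})[2] = 0`) identifies `Sel♭_∞[γ+1]` with a Selmer group `Sel_{L♭_ψ}(E^{(2)}/ℚ)` (local kernels at
`ℓ ≠ 2` = `c_ℓ(E^{(2)})^{(2)}`, Greenberg 1999 §3–4; `c₂(E^{(2)}) = 1`, Kodaira II at `2` on 488/488 rows); D-imc-61
Prop. 61.1 + Kramer 1981 Prop. 7 + norm index `2^{J₁} = 2` ⇒ `L♭_ψ ∩` (point line) `= 0` (`t = 0`); Poitou–Tate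
(K67c) ⇒ `#Sel_{L♭_ψ} = #Ш · [E^{(2)}(ℚ₂)^∧ : ℤ₂P]²`; `ord₂ log` of a local generator `= 0` (393/393 rows) turns the
index into `ord₂ log_Ŵ₂ P`.  Why it might fail: the identification of the descended ♭-line uses Prop. 61.1 (Honda
MODEL of `Ê(k_n)`); the transversality conjunct (`FlatBlindControlFiniteAtTwo`) is the open content — the COLOUR is
a₂-uniform and not chosen here (♯ is never transverse on this half: `L♯(−2) = 0` forced, `tsum_sharp_neg_two_eq_zero`;
♭ is the blind colour, `eval_neg_two_flatPoly`; see CDF's docstring).  v2.2: clause (5) of stub 2 is a binder (R390a);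
`stub_CD` is typed as `CDF ∧ CDC` (`flatBlindControlDualityAtTwo_iff_split`).  Nothing asserted.
[cite: Greenberg1999LNM1716, §3, Lemma 3.3, Prop. 4.1 (shape)] [cite: Kramer1981, Prop. 4, Prop. 7]
[cite: PerrinRiou1993Fourier, §3.4 (shape)] -/
def FlatBlindControlDualityAtTwo : Prop :=
  ∀ (W : WeierstrassCurve ℚ) [W.IsElliptic] [W.IsGloballyMinimal],
  ¬ W.HasCM → GoodSS W 2 → W.rootNumber * ZMod.χ₈ (W.conductorNorm ℤ : ZMod 8) = -1 →
  ∀ (κ : ZpExtension ℚ 2) (γ : Field.absoluteGaloisGroup ℚ),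
    κ.IsCyclotomic → κ.IsTopGenerator γ → IsCyclotomicVariable 2 γ →
  ∀ (v : HeightOneSpectrum (𝓞 ℚ)), (2 : 𝓞 ℚ) ∈ v.asIdeal →
  ∀ (g : Field.absoluteGaloisGroup (v.adicCompletion ℚ)) (c : ℕ → localPoints W (v.adicCompletion ℚ)),
    κ.IsTopGenerator (resGalOfEmb (closureEmb (K := ℚ) (v.adicCompletion ℚ)) g) →
    (∀ n, c n ∈ localLayerPointsOfEmb κ (closureEmb (K := ℚ) (v.adicCompletion ℚ)) W n) →
    (∀ n, 1 ≤ n → localTraceOfEmb κ (closureEmb (K := ℚ) (v.adicCompletion ℚ)) W n (n + 1)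
      (c (n + 1)) = W.frobeniusTrace 2 • c n - c (n - 1)) →
    (∀ z₀ : localLayerPointsOfEmb κ (closureEmb (K := ℚ) (v.adicCompletion ℚ)) W 0 →+ ℤ_[2],
      evalOn W (localLayerPointsOfEmb κ (closureEmb (K := ℚ) (v.adicCompletion ℚ)) W 0) z₀ (c 0) = 0 →
        z₀ = 0) →
    (∀ a : ℤ_[2],
      (∃ z₀ : localLayerPointsOfEmb κ (closureEmb (K := ℚ) (v.adicCompletion ℚ)) W 0 →+ ℤ_[2],
        evalOn W (localLayerPointsOfEmb κ (closureEmb (K := ℚ) (v.adicCompletion ℚ)) W 0) z₀ (c 0) = 2 * a) →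
      ∃ y : localLayerPointsOfEmb κ (closureEmb (K := ℚ) (v.adicCompletion ℚ)) W 0 →+ ℤ_[2],
        evalOn W (localLayerPointsOfEmb κ (closureEmb (K := ℚ) (v.adicCompletion ℚ)) W 0) y (c 0) = a) →
  ∀ (W₂ : WeierstrassCurve ℚ) [W₂.IsElliptic] [W₂.IsGloballyMinimal],
    (∃ C : WeierstrassCurve.VariableChange ℚ, C • W.quadraticTwist 2 = W₂) →
    W₂.mordellWeilRank = 1 → Finite (AddCommGroup.primaryComponent W₂.sha 2) →
  ∀ (ι : ℚ →+* ℚ_[2]) (P : (W₂.baseChange ℚ).toAffine.Point), ¬ IsOfFinAddOrder P →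
    Finite (endInvariants (conjSharpFlatSelmerInfty W κ (closureEmb (K := ℚ) (v.adicCompletion ℚ))
      (W.frobeniusTrace 2) g c .flat γ + 1)) ∧
    (padicValNat 2 (Nat.card (endInvariants (conjSharpFlatSelmerInfty W κ
        (closureEmb (K := ℚ) (v.adicCompletion ℚ)) (W.frobeniusTrace 2) g c .flat γ + 1))) : ℤ) =
      (padicValNat 2 (Nat.card (AddCommGroup.primaryComponent W₂.sha 2)) : ℤ) +
        (padicValNat 2 W₂.tamagawaProduct : ℤ) +
        2 * (padicLogOrd W₂ 2 ι P - (padicValNat 2 (AddSubgroup.zmultiples P).index : ℤ))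

/-- **THE SKELETON: K67-EC ∧ K67-NF ∧ K67-CD ⇒ K67-A** (kernel-checked composition; the three pieces are the IMC-lens
decomposition «Euler characteristic · no finite submodule · control-duality-transversality» of the blind ♭ Euler
characteristic).  [folklore] -/
theorem flatBlindRegulatorCharacteristicAtTwo_of (hEC : FlatBlindEulerCharAtTwo) (hNF : FlatBlindNoCotorsionAtTwo)
    (hCD : FlatBlindControlDualityAtTwo) : FlatBlindRegulatorCharacteristicAtTwo := by
  unfold FlatBlindRegulatorCharacteristicAtTwo
  intro W _ _ hCM hss hodd κ γ hκ hγ hcyc v hv g c hg hc htr hz hsat D _ htors f hf W₂ _ _ htw hr hsha ι P hP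
  obtain ⟨hfin, hcard⟩ :=
    hCD W hCM hss hodd κ γ hκ hγ hcyc v hv g c hg hc htr hz hsat W₂ htw hr hsha ι P hP
  haveI := hfin
  have hsub := hNF W hss κ γ hκ hγ hcyc v hv g c hg hc htr hz hsat D htors hfin
  haveI := hsub
  have hfin' : Finite (EndCoinvariants (conjSharpFlatSelmerInfty W κ (closureEmb (K := ℚ) (v.adicCompletion ℚ))
      (W.frobeniusTrace 2) g c .flat γ + 1)) := Finite.of_subsingleton
  obtain ⟨hne, hval⟩ := hEC W hss κ γ hκ hγ hcyc v hv g c hg D htors f hf hfin hfin'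
  refine ⟨hne, ?_⟩
  have h1 : Nat.card (EndCoinvariants (conjSharpFlatSelmerInfty W κ (closureEmb (K := ℚ) (v.adicCompletion ℚ))
      (W.frobeniusTrace 2) g c .flat γ + 1)) = 1 := Nat.card_of_subsingleton 0
  rw [hval, hcard, h1]
  simp


/-! ## §3 [DOCUMENTATION — OFF THE COMPOSITION PATH, INERT; REF1 §397 R397d] The blind DOOR K67-D with its supports
S67-D0 / S67-FIN and the sorry-free reduction `flatBlindDoorAtTwo_of` (ported verbatim from Sketch67.v4 §3; (655) (ii)).
NOT on the path to the rank-0 crux, not a stub, consumes no stub — recorded because the director asked for the typed door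
and because it is the line's rank-`≥ 2` content (falsifier run 3: 0/1455 violations); at registration it may move to a
support file unchanged. -/

/-- `T^m ∣ g` in `ℤ₂⟦T⟧` forces `g(−2) = (−2)^m·u` (evaluation at `−2` is a ring map; verbatim the cross-cell lemma
`LambdaTransportDoorAtTwoValueAtMinusTwo.evalAt_negTwo_eq_of_X_pow_dvd`, re-proved here to keep the sketch's imports
light). [folklore] -/
theorem evalAt_negTwo_eq_of_X_pow_dvd' {g₀ : PowerSeries ℤ_[2]} {m : ℕ}
    (hm : (PowerSeries.X : PowerSeries ℤ_[2]) ^ m ∣ g₀) :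
    ∃ u : ℤ_[2], evalAt (-2 : ℤ_[2]) g₀ = (-2 : ℤ_[2]) ^ m * u := by
  obtain ⟨h, rfl⟩ := hm
  refine ⟨evalAt (-2 : ℤ_[2]) h, ?_⟩
  have h2 : ‖(-2 : ℤ_[2])‖ < 1 := BlindLever.norm_neg_two_lt_one
  rw [evalAt_mul h2, ← evalAtHom_apply h2 (PowerSeries.X ^ m), map_pow, evalAtHom_apply, evalAt_X]

/-- **S67-D0 `FlatControlAtZeroAtTwo`** (support-candidate; Mazur control at the TRIVIAL character for the ♭ Selmer
group): for `E = W` good supersingular at `2`, the cyclotomic tower data and Honda–Sprung local data as in K67-CD, and every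
finitely generated torsion ♭ dual Selmer datum `X♭` with `char = (f)`: **`T^{corank_{ℤ₂} Sel_{2^∞}(E/ℚ)} ∣ f`**.  Chain:
`E(ℚ_∞)[2] = 0` (good supersingular at `2`) ⇒ `Sel_{2^∞}(E/ℚ) → Sel♭(E/ℚ_∞)^Γ` has finite kernel (the ♭ local condition at
layer `0` is all of `E(ℚ₂) ⊗ ℚ₂/ℤ₂`: at `a₂ = ±2` it is `Ê(ℚ₂) ⊗ ℚ₂/ℤ₂`, of ODD index `#Ẽ(𝔽₂) = 3 − a₂ ∈ {1, 5}`), so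
`corank Sel_{2^∞}(E/ℚ) ≤ rank_{ℤ₂} (X♭)_Γ ≤ ord_{T=0} char(X♭)` (structure theorem).  In print for odd `p` / `a_p = 0`
(Kobayashi 2003 Thm. 1.3 shape, B.D. Kim 2013); routine at `2` given the tree's ♭ objects.  Nothing asserted.
[cite: Kobayashi2003, Thm. 1.3 (shape only, odd p)] [cite: Greenberg1999LNM, §1 pp. 54–57] -/
def FlatControlAtZeroAtTwo : Prop :=
  ∀ (W : WeierstrassCurve ℚ) [W.IsElliptic] [W.IsGloballyMinimal], GoodSS W 2 →
  ∀ (κ : ZpExtension ℚ 2) (γ : Field.absoluteGaloisGroup ℚ),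
    κ.IsCyclotomic → κ.IsTopGenerator γ → IsCyclotomicVariable 2 γ →
  ∀ (v : HeightOneSpectrum (𝓞 ℚ)), (2 : 𝓞 ℚ) ∈ v.asIdeal →
  ∀ (g : Field.absoluteGaloisGroup (v.adicCompletion ℚ)) (c : ℕ → localPoints W (v.adicCompletion ℚ)),
    κ.IsTopGenerator (resGalOfEmb (closureEmb (K := ℚ) (v.adicCompletion ℚ)) g) →
    (∀ n, c n ∈ localLayerPointsOfEmb κ (closureEmb (K := ℚ) (v.adicCompletion ℚ)) W n) →
    (∀ n, 1 ≤ n → localTraceOfEmb κ (closureEmb (K := ℚ) (v.adicCompletion ℚ)) W n (n + 1)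
      (c (n + 1)) = W.frobeniusTrace 2 • c n - c (n - 1)) →
    (∀ z₀ : localLayerPointsOfEmb κ (closureEmb (K := ℚ) (v.adicCompletion ℚ)) W 0 →+ ℤ_[2],
      evalOn W (localLayerPointsOfEmb κ (closureEmb (K := ℚ) (v.adicCompletion ℚ)) W 0) z₀ (c 0) = 0 →
        z₀ = 0) →
    (∀ a : ℤ_[2],
      (∃ z₀ : localLayerPointsOfEmb κ (closureEmb (K := ℚ) (v.adicCompletion ℚ)) W 0 →+ ℤ_[2],
        evalOn W (localLayerPointsOfEmb κ (closureEmb (K := ℚ) (v.adicCompletion ℚ)) W 0) z₀ (c 0) = 2 * a) →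
      ∃ y : localLayerPointsOfEmb κ (closureEmb (K := ℚ) (v.adicCompletion ℚ)) W 0 →+ ℤ_[2],
        evalOn W (localLayerPointsOfEmb κ (closureEmb (K := ℚ) (v.adicCompletion ℚ)) W 0) y (c 0) = a) →
  ∀ (D : SharpFlatSelmerDualData W κ γ (closureEmb (K := ℚ) (v.adicCompletion ℚ))
      (W.frobeniusTrace 2) g c .flat) [Module.Finite (IwasawaAlgebra 2) D.X],
    Module.IsTorsion (IwasawaAlgebra 2) D.X →
  ∀ f : IwasawaAlgebra 2, D.charIdeal = Ideal.span {f} →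
    (PowerSeries.X : IwasawaAlgebra 2) ^ (W.selmerCorank 2) ∣ f

/-- **S67-FIN `FlatBlindCoinvariantsFiniteAtTwo`** (support-candidate; structure theory + duality): for a finitely
generated torsion ♭ datum, if the `ψ₂`-anti-invariants `Sel♭(E/ℚ_∞)[γ+1]` are finite then so are the
`ψ₂`-anti-coinvariants `Sel♭(E/ℚ_∞)/(γ+1)`: `(Sel[γ+1])^∨ = X♭/(T+2)X♭` finite ⇔ `(T+2) ∤ char(X♭)` ⇔ `X♭[T+2]`
`= (Sel/(γ+1))^∨` finite.  Nothing asserted. [cite: Greenberg1999LNM, §1 pp. 54–57 (shape)] -/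
def FlatBlindCoinvariantsFiniteAtTwo : Prop :=
  ∀ (W : WeierstrassCurve ℚ) [W.IsElliptic] [W.IsGloballyMinimal], GoodSS W 2 →
  ∀ (κ : ZpExtension ℚ 2) (γ : Field.absoluteGaloisGroup ℚ),
    κ.IsCyclotomic → κ.IsTopGenerator γ → IsCyclotomicVariable 2 γ →
  ∀ (v : HeightOneSpectrum (𝓞 ℚ)), (2 : 𝓞 ℚ) ∈ v.asIdeal →
  ∀ (g : Field.absoluteGaloisGroup (v.adicCompletion ℚ)) (c : ℕ → localPoints W (v.adicCompletion ℚ)),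
    κ.IsTopGenerator (resGalOfEmb (closureEmb (K := ℚ) (v.adicCompletion ℚ)) g) →
  ∀ (D : SharpFlatSelmerDualData W κ γ (closureEmb (K := ℚ) (v.adicCompletion ℚ))
      (W.frobeniusTrace 2) g c .flat) [Module.Finite (IwasawaAlgebra 2) D.X],
    Module.IsTorsion (IwasawaAlgebra 2) D.X →
    Finite (endInvariants (conjSharpFlatSelmerInfty W κ (closureEmb (K := ℚ) (v.adicCompletion ℚ))
      (W.frobeniusTrace 2) g c .flat γ + 1)) →
    Finite (EndCoinvariants (conjSharpFlatSelmerInfty W κ (closureEmb (K := ℚ) (v.adicCompletion ℚ))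
      (W.frobeniusTrace 2) g c .flat γ + 1))

/-- **K67-D `FlatBlindDoorAtTwo` — THE BLIND DOOR (crux-candidate; the IMC lens's rank-`≥ 2` statement).**
For `E = W/ℚ` non-CM, good supersingular at `2`, on the odd-twist half `w(E)·χ₈(N) = −1`, with the cyclotomic tower data
and Honda–Sprung local data of K67-CD, ANY finitely generated torsion ♭ dual Selmer datum with `char = (f)` (its existence
is the only Kato–Sprung-grade input), every globally minimal model `W₂` of `E^{(2)}` with `rank W₂(ℚ) = 1` and finite
`Ш(W₂)[2^∞]`, and every non-torsion `P ∈ W₂(ℚ)`: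
**`rank E(ℚ) + corank_{ℤ₂} Ш(E/ℚ)[2^∞] ≤ v₂#Ш(W₂)[2^∞] + v₂Tam(W₂) + 2·(ord₂ log_Ŵ₂ P − v₂[W₂(ℚ) : ℤP])`.**
The rank of `E` is traded against the `2`-part of the BSD data of its twist and the `2`-adic DEPTH `i_P` of the twist's
generator in `E^{(2)}(ℚ₂) ≅ ℤ₂`.  Reduction: `flatBlindDoorAtTwo_of` below (K67-EC + K67-CD + S67-D0 + S67-FIN ⟹ K67-D,
kernel-checked).  Falsifier run 3: 0/1455 violations (module docstring §3).  Why it might fail: only through K67-CD (the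
transversality `t = 0` / the Tamagawa bookkeeping of the descended ♭-line at `ψ₂`) — S67-D0, S67-FIN, K67-EC are
textbook-shape.  Why novel: a bound for the `2^∞`-Selmer corank of a curve of ANY rank by twist data, with no
`L`-function and no Euler-system input beyond torsion-ness, available only at `(p, n) = (2, 1)` (`|ζ₂ − 1|₂ = |−2|₂ = ½`);
nearest print = Kramer 1981 (2-Selmer parity of `E × E^{(d)}` via local norm indices, mod 2 only, no `i_P`) and the
ordinary-at-2 value door of cell bsd-rank2 (interpolated value `S₈(f)`, needs `L(E^{(2)},1) ≠ 0`, i.e. the EVEN half).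
[cite: Kramer1981, Thm. 1, Prop. 7 (nearest print, mod 2)] [cite: MazurTateTeitelbaum1986Invent, §I.14 (the point T = −2)]
[cite: Kobayashi2003, Thm. 1.2–1.3 (shape only, odd p)] -/
def FlatBlindDoorAtTwo : Prop :=
  ∀ (W : WeierstrassCurve ℚ) [W.IsElliptic] [W.IsGloballyMinimal],
  ¬ W.HasCM → GoodSS W 2 → W.rootNumber * ZMod.χ₈ (W.conductorNorm ℤ : ZMod 8) = -1 →
  ∀ (κ : ZpExtension ℚ 2) (γ : Field.absoluteGaloisGroup ℚ),
    κ.IsCyclotomic → κ.IsTopGenerator γ → IsCyclotomicVariable 2 γ →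
  ∀ (v : HeightOneSpectrum (𝓞 ℚ)), (2 : 𝓞 ℚ) ∈ v.asIdeal →
  ∀ (g : Field.absoluteGaloisGroup (v.adicCompletion ℚ)) (c : ℕ → localPoints W (v.adicCompletion ℚ)),
    κ.IsTopGenerator (resGalOfEmb (closureEmb (K := ℚ) (v.adicCompletion ℚ)) g) →
    (∀ n, c n ∈ localLayerPointsOfEmb κ (closureEmb (K := ℚ) (v.adicCompletion ℚ)) W n) →
    (∀ n, 1 ≤ n → localTraceOfEmb κ (closureEmb (K := ℚ) (v.adicCompletion ℚ)) W n (n + 1)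
      (c (n + 1)) = W.frobeniusTrace 2 • c n - c (n - 1)) →
    (∀ z₀ : localLayerPointsOfEmb κ (closureEmb (K := ℚ) (v.adicCompletion ℚ)) W 0 →+ ℤ_[2],
      evalOn W (localLayerPointsOfEmb κ (closureEmb (K := ℚ) (v.adicCompletion ℚ)) W 0) z₀ (c 0) = 0 →
        z₀ = 0) →
    (∀ a : ℤ_[2],
      (∃ z₀ : localLayerPointsOfEmb κ (closureEmb (K := ℚ) (v.adicCompletion ℚ)) W 0 →+ ℤ_[2],
        evalOn W (localLayerPointsOfEmb κ (closureEmb (K := ℚ) (v.adicCompletion ℚ)) W 0) z₀ (c 0) = 2 * a) →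
      ∃ y : localLayerPointsOfEmb κ (closureEmb (K := ℚ) (v.adicCompletion ℚ)) W 0 →+ ℤ_[2],
        evalOn W (localLayerPointsOfEmb κ (closureEmb (K := ℚ) (v.adicCompletion ℚ)) W 0) y (c 0) = a) →
  ∀ (D : SharpFlatSelmerDualData W κ γ (closureEmb (K := ℚ) (v.adicCompletion ℚ))
      (W.frobeniusTrace 2) g c .flat) [Module.Finite (IwasawaAlgebra 2) D.X],
    Module.IsTorsion (IwasawaAlgebra 2) D.X →
  ∀ f : IwasawaAlgebra 2, D.charIdeal = Ideal.span {f} →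
  ∀ (W₂ : WeierstrassCurve ℚ) [W₂.IsElliptic] [W₂.IsGloballyMinimal],
    (∃ C : WeierstrassCurve.VariableChange ℚ, C • W.quadraticTwist 2 = W₂) →
    W₂.mordellWeilRank = 1 → Finite (AddCommGroup.primaryComponent W₂.sha 2) →
  ∀ (ι : ℚ →+* ℚ_[2]) (P : (W₂.baseChange ℚ).toAffine.Point), ¬ IsOfFinAddOrder P →
    ((W.mordellWeilRank : ℕ) : ℤ) + ((W.shaCorank 2 : ℕ) : ℤ) ≤
      (padicValNat 2 (Nat.card (AddCommGroup.primaryComponent W₂.sha 2)) : ℤ) +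
        (padicValNat 2 W₂.tamagawaProduct : ℤ) +
        2 * (padicLogOrd W₂ 2 ι P - (padicValNat 2 (AddSubgroup.zmultiples P).index : ℤ))

/-- **The door, kernel-checked reduction: K67-EC ∧ K67-CD ∧ S67-D0 ∧ S67-FIN ⟹ K67-D.**
`corank Sel_{2^∞}(E) = rank + corank Ш[2^∞]` (tree theorem `selmerCorank_eq_mordellWeilRank_add_holds`),
`T^{corank} ∣ f` (S67-D0) ⇒ `f(−2) = (−2)^{corank}·u` ⇒ `corank ≤ v₂ f(−2)` (as `f(−2) ≠ 0`, K67-EC)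
`= log₂#inv − log₂#coinv ≤ log₂#inv = v₂#Ш(W₂)[2^∞] + v₂Tam(W₂) + 2·i_P` (K67-CD). [folklore] -/
theorem flatBlindDoorAtTwo_of (hEC : FlatBlindEulerCharAtTwo) (hCD : FlatBlindControlDualityAtTwo)
    (hD0 : FlatControlAtZeroAtTwo) (hFIN : FlatBlindCoinvariantsFiniteAtTwo) : FlatBlindDoorAtTwo := by
  unfold FlatBlindDoorAtTwo
  intro W _ _ hCM hss hodd κ γ hκ hγ hcyc v hv g c hg hc htr hz hsat D _ htors f hf W₂ _ _ htw hr hsha ι P hP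
  obtain ⟨hfin, hcard⟩ :=
    hCD W hCM hss hodd κ γ hκ hγ hcyc v hv g c hg hc htr hz hsat W₂ htw hr hsha ι P hP
  haveI := hfin
  have hfin' := hFIN W hss κ γ hκ hγ hcyc v hv g c hg D htors hfin
  haveI := hfin'
  obtain ⟨hne, hval⟩ := hEC W hss κ γ hκ hγ hcyc v hv g c hg D htors f hf hfin hfin'
  have hdiv := hD0 W hss κ γ hκ hγ hcyc v hv g c hg hc htr hz hsat D htors f hf
  obtain ⟨u, hu⟩ := evalAt_negTwo_eq_of_X_pow_dvd' hdiv
  have key : evalAt (-2 : ℤ_[2]) f =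
      ((2 : ℕ) : ℤ_[2]) ^ (W.selmerCorank 2) * ((-1 : ℤ_[2]) ^ (W.selmerCorank 2) * u) := by
    rw [hu, show (-2 : ℤ_[2]) = (2 : ℤ_[2]) * (-1 : ℤ_[2]) by norm_num, mul_pow]; push_cast; ring
  have hu' : ((-1 : ℤ_[2]) ^ (W.selmerCorank 2) * u) ≠ 0 := by
    intro h0; apply hne; rw [key, h0, mul_zero]
  have hv : (evalAt (-2 : ℤ_[2]) f).valuation =
      W.selmerCorank 2 + ((-1 : ℤ_[2]) ^ (W.selmerCorank 2) * u).valuation := by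
    rw [key]; exact PadicInt.valuation_p_pow_mul _ _ hu'
  have hmle : ((W.selmerCorank 2 : ℕ) : ℤ) ≤ ((evalAt (-2 : ℤ_[2]) f).valuation : ℤ) := by
    have : W.selmerCorank 2 ≤ (evalAt (-2 : ℤ_[2]) f).valuation := by rw [hv]; exact Nat.le_add_right _ _
    exact_mod_cast this
  rw [hval, hcard] at hmle
  have hsel : ((W.selmerCorank 2 : ℕ) : ℤ) = ((W.mordellWeilRank : ℕ) : ℤ) + ((W.shaCorank 2 : ℕ) : ℤ) := by
    exact_mod_cast W.selmerCorank_eq_mordellWeilRank_add_holds 2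
  have hB : (0 : ℤ) ≤ (padicValNat 2 (Nat.card (EndCoinvariants (conjSharpFlatSelmerInfty W κ
      (closureEmb (K := ℚ) (v.adicCompletion ℚ)) (W.frobeniusTrace 2) g c .flat γ + 1))) : ℤ) :=
    Nat.cast_nonneg _
  linarith


/-! ## §4 R373a split of K67-CD (ported verbatim from Sketch67.v4 §4; (655) (i) CDF / CDC) -/

/-- **K67-CDF `FlatBlindControlFiniteAtTwo`** (R373a finiteness half of K67-CD — THE crux-candidate after the split:
the descended ♭-line at `ψ₂` is TRANSVERSE to the Kummer line of the rank-1 twist, `t = 0`, so `Sel♭(E/ℚ_∞)[γ+1]` is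
finite).  Binders verbatim those of K67-CD.  WHICH COLOUR (pen RC-657/RC-659 (A4), answered a₂-UNIFORMLY from the tree):
on the generic odd half `w(E)·χ₈(N) = −1` the ♯ function has a FORCED zero at the blind point, `L♯(−2) = −θ₁(−2) = 0`
for EVERY Sprung pair and EVERY `a₂ ∈ {0, ±2}` (`Rank1Residual.Supersingular.tsum_sharp_neg_two_eq`,
`tsum_sharp_neg_two_eq_zero`: the level-1 clause `θ₁ ≡ −L♯ (mod T(T+2))`, `sharpPoly_one = 1`, `flatPoly_one = 0`, and
the Mazur–Tate functional equation at `T = −2`), so ♯ is NEVER the transverse colour here; `L♭` is invisible at `−2` at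
every finite level (`eval_neg_two_flatPoly`: `v_m(−2) = 0`, `m ≥ 1`) — the BLIND colour — and its own root-number
constraint (`BlindFlat.flatLaw_evalAt_neg_two_of_rootNumber`: `(9 − a₂²)·L♭(−2) + a₂·L♯(−2) = 0`, i.e. `L♭(−2) = 0` at
`a₂ = 0` and `5·L♭(−2) = −a₂·L♯(−2)` at `a₂ = ±2`) lies on the EVEN half `w(E)·χ₈(N) = +1` (the mirror statement
`Theorems.evalAt_neg_two_charGenerator_eq_zero_of_kobayashiLowerDivisibility_two` types the even side).  Hence no
colour selector and no `a₂ ≠ 0` restriction: 0 of the 859 odd classes of census C-imc-76 move to the Miller branch.  The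
algebraic ♭ objects (`conjSharpFlatSelmerInfty … .flat`, Sprung 2012) are paired with the analytic `L♭` not by a
convention of this file but by stub 2's CK♭ clause (`ι G = C(ϖ)·ι L♭` for the ♭-Coleman image of Kato's element, consumed by
the tree's `SSFlatRoad.flatUpper_two_of_flatColemanKato{,_of_mu}`); given that pairing (stubs 2–3 ⇒ `ξ = char X♭ ∣ G`)
this conjunct is IMPLIED by stub 6's `G(−2) ≠ 0` up to the `Λ`-structure step `ξ(−2) ≠ 0 ⇒ X♭/(T+2)X♭` finite
`⇒ Sel♭_∞[γ+1]` finite — it cannot be «false for the wrong colour» while stubs 2, 3, 6 hold.  Why it might fail: the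
`Λ`-structure/duality step at `2` with `T + 2 ∤ 2`… it divides `2`: `(T+2, 2) ≠ Λ`, so pseudo-null error terms at the
prime `(2, T)` need the no-finite-submodule input K67-NF; unwritten at `p = 2`.  Nothing asserted.
[cite: Kramer1981, Prop. 7] [cite: Sprung2012, Def. 1.1] [cite: Sprung2017, Cor. 4.4, §1.1 (level-1 clause)]
[cite: MazurTateTeitelbaum1986Invent, §I.17] -/
def FlatBlindControlFiniteAtTwo : Prop :=
  ∀ (W : WeierstrassCurve ℚ) [W.IsElliptic] [W.IsGloballyMinimal],
  ¬ W.HasCM → GoodSS W 2 → W.rootNumber * ZMod.χ₈ (W.conductorNorm ℤ : ZMod 8) = -1 →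
  ∀ (κ : ZpExtension ℚ 2) (γ : Field.absoluteGaloisGroup ℚ),
    κ.IsCyclotomic → κ.IsTopGenerator γ → IsCyclotomicVariable 2 γ →
  ∀ (v : HeightOneSpectrum (𝓞 ℚ)), (2 : 𝓞 ℚ) ∈ v.asIdeal →
  ∀ (g : Field.absoluteGaloisGroup (v.adicCompletion ℚ)) (c : ℕ → localPoints W (v.adicCompletion ℚ)),
    κ.IsTopGenerator (resGalOfEmb (closureEmb (K := ℚ) (v.adicCompletion ℚ)) g) →
    (∀ n, c n ∈ localLayerPointsOfEmb κ (closureEmb (K := ℚ) (v.adicCompletion ℚ)) W n) →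
    (∀ n, 1 ≤ n → localTraceOfEmb κ (closureEmb (K := ℚ) (v.adicCompletion ℚ)) W n (n + 1)
      (c (n + 1)) = W.frobeniusTrace 2 • c n - c (n - 1)) →
    (∀ z₀ : localLayerPointsOfEmb κ (closureEmb (K := ℚ) (v.adicCompletion ℚ)) W 0 →+ ℤ_[2],
      evalOn W (localLayerPointsOfEmb κ (closureEmb (K := ℚ) (v.adicCompletion ℚ)) W 0) z₀ (c 0) = 0 →
        z₀ = 0) →
    (∀ a : ℤ_[2],
      (∃ z₀ : localLayerPointsOfEmb κ (closureEmb (K := ℚ) (v.adicCompletion ℚ)) W 0 →+ ℤ_[2],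
        evalOn W (localLayerPointsOfEmb κ (closureEmb (K := ℚ) (v.adicCompletion ℚ)) W 0) z₀ (c 0) = 2 * a) →
      ∃ y : localLayerPointsOfEmb κ (closureEmb (K := ℚ) (v.adicCompletion ℚ)) W 0 →+ ℤ_[2],
        evalOn W (localLayerPointsOfEmb κ (closureEmb (K := ℚ) (v.adicCompletion ℚ)) W 0) y (c 0) = a) →
  ∀ (W₂ : WeierstrassCurve ℚ) [W₂.IsElliptic] [W₂.IsGloballyMinimal],
    (∃ C : WeierstrassCurve.VariableChange ℚ, C • W.quadraticTwist 2 = W₂) →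
    W₂.mordellWeilRank = 1 → Finite (AddCommGroup.primaryComponent W₂.sha 2) →
  ∀ (ι : ℚ →+* ℚ_[2]) (P : (W₂.baseChange ℚ).toAffine.Point), ¬ IsOfFinAddOrder P →
    Finite (endInvariants (conjSharpFlatSelmerInfty W κ (closureEmb (K := ℚ) (v.adicCompletion ℚ))
      (W.frobeniusTrace 2) g c .flat γ + 1))

/-- **K67-CDC `FlatBlindControlCardAtTwo`** (R373a cardinality half of K67-CD — Poitou–Tate / Cassels bookkeeping GIVEN
finiteness: `#Sel♭_∞[γ+1] = #Ш(W₂)[2^∞] · 2^{v₂Tam(W₂)} · 2^{2 i_P}`).  Binders verbatim those of K67-CD plus the finiteness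
hypothesis.  Nothing asserted. [cite: Greenberg1999LNM, §3–§4 (shape)] [cite: PerrinRiou1993Fourier, §3.4 (shape)] -/
def FlatBlindControlCardAtTwo : Prop :=
  ∀ (W : WeierstrassCurve ℚ) [W.IsElliptic] [W.IsGloballyMinimal],
  ¬ W.HasCM → GoodSS W 2 → W.rootNumber * ZMod.χ₈ (W.conductorNorm ℤ : ZMod 8) = -1 →
  ∀ (κ : ZpExtension ℚ 2) (γ : Field.absoluteGaloisGroup ℚ),
    κ.IsCyclotomic → κ.IsTopGenerator γ → IsCyclotomicVariable 2 γ →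
  ∀ (v : HeightOneSpectrum (𝓞 ℚ)), (2 : 𝓞 ℚ) ∈ v.asIdeal →
  ∀ (g : Field.absoluteGaloisGroup (v.adicCompletion ℚ)) (c : ℕ → localPoints W (v.adicCompletion ℚ)),
    κ.IsTopGenerator (resGalOfEmb (closureEmb (K := ℚ) (v.adicCompletion ℚ)) g) →
    (∀ n, c n ∈ localLayerPointsOfEmb κ (closureEmb (K := ℚ) (v.adicCompletion ℚ)) W n) →
    (∀ n, 1 ≤ n → localTraceOfEmb κ (closureEmb (K := ℚ) (v.adicCompletion ℚ)) W n (n + 1)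
      (c (n + 1)) = W.frobeniusTrace 2 • c n - c (n - 1)) →
    (∀ z₀ : localLayerPointsOfEmb κ (closureEmb (K := ℚ) (v.adicCompletion ℚ)) W 0 →+ ℤ_[2],
      evalOn W (localLayerPointsOfEmb κ (closureEmb (K := ℚ) (v.adicCompletion ℚ)) W 0) z₀ (c 0) = 0 →
        z₀ = 0) →
    (∀ a : ℤ_[2],
      (∃ z₀ : localLayerPointsOfEmb κ (closureEmb (K := ℚ) (v.adicCompletion ℚ)) W 0 →+ ℤ_[2],
        evalOn W (localLayerPointsOfEmb κ (closureEmb (K := ℚ) (v.adicCompletion ℚ)) W 0) z₀ (c 0) = 2 * a) →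
      ∃ y : localLayerPointsOfEmb κ (closureEmb (K := ℚ) (v.adicCompletion ℚ)) W 0 →+ ℤ_[2],
        evalOn W (localLayerPointsOfEmb κ (closureEmb (K := ℚ) (v.adicCompletion ℚ)) W 0) y (c 0) = a) →
  ∀ (W₂ : WeierstrassCurve ℚ) [W₂.IsElliptic] [W₂.IsGloballyMinimal],
    (∃ C : WeierstrassCurve.VariableChange ℚ, C • W.quadraticTwist 2 = W₂) →
    W₂.mordellWeilRank = 1 → Finite (AddCommGroup.primaryComponent W₂.sha 2) →
  ∀ (ι : ℚ →+* ℚ_[2]) (P : (W₂.baseChange ℚ).toAffine.Point), ¬ IsOfFinAddOrder P →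
    Finite (endInvariants (conjSharpFlatSelmerInfty W κ (closureEmb (K := ℚ) (v.adicCompletion ℚ))
      (W.frobeniusTrace 2) g c .flat γ + 1)) →
    (padicValNat 2 (Nat.card (endInvariants (conjSharpFlatSelmerInfty W κ
        (closureEmb (K := ℚ) (v.adicCompletion ℚ)) (W.frobeniusTrace 2) g c .flat γ + 1))) : ℤ) =
      (padicValNat 2 (Nat.card (AddCommGroup.primaryComponent W₂.sha 2)) : ℤ) +
        (padicValNat 2 W₂.tamagawaProduct : ℤ) +
        2 * (padicLogOrd W₂ 2 ι P - (padicValNat 2 (AddSubgroup.zmultiples P).index : ℤ))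

/-- **K67-CDC_H `FlatBlindControlCardHondaAtTwo`** (v2.10; LEAD ss-1 GEN 20 JUDGEMENT v2.9 (ii)): K67-CDC VERBATIM with the Honda legality clause
`∃ cneg, F1Sign2.IsHondaSystemAtTwo κ ι W a₂ g cneg c` inserted after (SAT), exactly as K67-CD_H / CDF±_H (v2.7).  The Poitou–Tate / Cassels cardinality
GIVEN finiteness, for local data that ARE Honda systems at two (what stub 2 produces; the exotic-multiplier rider (R2♭) stays outside the cone).
Implied by K67-CDC (`flatBlindControlCardHondaAtTwo_of`).  Nothing asserted; hands HT-C1/HT-C2 (LEAD `ss/gen20/HAND-TARGETS-CDC.md`).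
[cite: Greenberg1999LNM, §3–§4 (shape)] [cite: PerrinRiou1993Fourier, §3.4 (shape)] [cite: Sprung2012, Thm. 2.2, Lemma 7.9 (Honda systems)] -/
def FlatBlindControlCardHondaAtTwo : Prop :=
  ∀ (W : WeierstrassCurve ℚ) [W.IsElliptic] [W.IsGloballyMinimal],
  ¬ W.HasCM → GoodSS W 2 → W.rootNumber * ZMod.χ₈ (W.conductorNorm ℤ : ZMod 8) = -1 →
  ∀ (κ : ZpExtension ℚ 2) (γ : Field.absoluteGaloisGroup ℚ),
    κ.IsCyclotomic → κ.IsTopGenerator γ → IsCyclotomicVariable 2 γ →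
  ∀ (v : HeightOneSpectrum (𝓞 ℚ)), (2 : 𝓞 ℚ) ∈ v.asIdeal →
  ∀ (g : Field.absoluteGaloisGroup (v.adicCompletion ℚ)) (c : ℕ → localPoints W (v.adicCompletion ℚ)),
    κ.IsTopGenerator (resGalOfEmb (closureEmb (K := ℚ) (v.adicCompletion ℚ)) g) →
    (∀ n, c n ∈ localLayerPointsOfEmb κ (closureEmb (K := ℚ) (v.adicCompletion ℚ)) W n) →
    (∀ n, 1 ≤ n → localTraceOfEmb κ (closureEmb (K := ℚ) (v.adicCompletion ℚ)) W n (n + 1)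
      (c (n + 1)) = W.frobeniusTrace 2 • c n - c (n - 1)) →
    (∀ z₀ : localLayerPointsOfEmb κ (closureEmb (K := ℚ) (v.adicCompletion ℚ)) W 0 →+ ℤ_[2],
      evalOn W (localLayerPointsOfEmb κ (closureEmb (K := ℚ) (v.adicCompletion ℚ)) W 0) z₀ (c 0) = 0 →
        z₀ = 0) →
    (∀ a : ℤ_[2],
      (∃ z₀ : localLayerPointsOfEmb κ (closureEmb (K := ℚ) (v.adicCompletion ℚ)) W 0 →+ ℤ_[2],
        evalOn W (localLayerPointsOfEmb κ (closureEmb (K := ℚ) (v.adicCompletion ℚ)) W 0) z₀ (c 0) = 2 * a) →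
      ∃ y : localLayerPointsOfEmb κ (closureEmb (K := ℚ) (v.adicCompletion ℚ)) W 0 →+ ℤ_[2],
        evalOn W (localLayerPointsOfEmb κ (closureEmb (K := ℚ) (v.adicCompletion ℚ)) W 0) y (c 0) = a) →
    (∃ cneg : localPoints W (v.adicCompletion ℚ),
      Summit.BirchSwinnertonDyer.Rank1Residual.F1Sign2.IsHondaSystemAtTwo κ (closureEmb (K := ℚ) (v.adicCompletion ℚ)) W
        (W.frobeniusTrace 2) g cneg c) →
  ∀ (W₂ : WeierstrassCurve ℚ) [W₂.IsElliptic] [W₂.IsGloballyMinimal],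
    (∃ C : WeierstrassCurve.VariableChange ℚ, C • W.quadraticTwist 2 = W₂) →
    W₂.mordellWeilRank = 1 → Finite (AddCommGroup.primaryComponent W₂.sha 2) →
  ∀ (ι : ℚ →+* ℚ_[2]) (P : (W₂.baseChange ℚ).toAffine.Point), ¬ IsOfFinAddOrder P →
    Finite (endInvariants (conjSharpFlatSelmerInfty W κ (closureEmb (K := ℚ) (v.adicCompletion ℚ))
      (W.frobeniusTrace 2) g c .flat γ + 1)) →
    (padicValNat 2 (Nat.card (endInvariants (conjSharpFlatSelmerInfty W κ
        (closureEmb (K := ℚ) (v.adicCompletion ℚ)) (W.frobeniusTrace 2) g c .flat γ + 1))) : ℤ) =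
      (padicValNat 2 (Nat.card (AddCommGroup.primaryComponent W₂.sha 2)) : ℤ) +
        (padicValNat 2 W₂.tamagawaProduct : ℤ) +
        2 * (padicLogOrd W₂ 2 ι P - (padicValNat 2 (AddSubgroup.zmultiples P).index : ℤ))

/-- **K67-CDC ⟹ K67-CDC_H** (v2.10 kernel: forget the Honda hypothesis — CDC_H is a WEAKENING of CDC). [folklore] -/
theorem flatBlindControlCardHondaAtTwo_of (h : FlatBlindControlCardAtTwo) : FlatBlindControlCardHondaAtTwo := by
  intro W _ _ hCM hss hodd κ γ hκ hγ hcyc v hv g c hg hc htr hz hsat _hH W₂ _ _ htw hr hsha ι P hP hfin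
  exact h W hCM hss hodd κ γ hκ hγ hcyc v hv g c hg hc htr hz hsat W₂ htw hr hsha ι P hP hfin

/-- **R373a glue (REF1 K373.4 `cd_split` shape): K67-CD ⟺ K67-CDF ∧ K67-CDC.** [folklore] -/
theorem flatBlindControlDualityAtTwo_iff_split :
    FlatBlindControlDualityAtTwo ↔ FlatBlindControlFiniteAtTwo ∧ FlatBlindControlCardAtTwo := by
  constructor
  · intro h
    refine ⟨?_, ?_⟩
    · intro W _ _ hCM hss hodd κ γ hκ hγ hcyc v hv g c hg hc htr hz hsat W₂ _ _ htw hr hsha ι P hP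
      exact (h W hCM hss hodd κ γ hκ hγ hcyc v hv g c hg hc htr hz hsat W₂ htw hr hsha ι P hP).1
    · intro W _ _ hCM hss hodd κ γ hκ hγ hcyc v hv g c hg hc htr hz hsat W₂ _ _ htw hr hsha ι P hP _
      exact (h W hCM hss hodd κ γ hκ hγ hcyc v hv g c hg hc htr hz hsat W₂ htw hr hsha ι P hP).2
  · rintro ⟨hF, hC⟩
    intro W _ _ hCM hss hodd κ γ hκ hγ hcyc v hv g c hg hc htr hz hsat W₂ _ _ htw hr hsha ι P hP
    have hfin := hF W hCM hss hodd κ γ hκ hγ hcyc v hv g c hg hc htr hz hsat W₂ htw hr hsha ι P hP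
    exact ⟨hfin, hC W hCM hss hodd κ γ hκ hγ hcyc v hv g c hg hc htr hz hsat W₂ htw hr hsha ι P hP hfin⟩


/-! ## §4b v2.6 split of CDF along the local/global seam, POINTWISE and BY `a₂` (LEAD ss-1 GEN 18 CDF-ATTACK-GEN18 §1/§4/§7;
pen bsd-2adic GEN 38 RC-681 + PREGRADE-19097-v26-CDFsplit-pointwise.lean @56dc3662d3071f11 — the next four declarations are the
pregrade's texts verbatim): CDF ⟸ CDF± ∧ CDF_glob, the `a₂ = 0` local half fed BY NAME (p801290); CDF±'s Honda rung CDF±_H is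
decided true in the two-generation model (MEMO-imc §10.111 D-imc-72). -/

/-- **CDF_loc± = CDF± `FlatBlindLocalTransversalityOffZeroAtTwo`** (v2.6, OPEN; the `a₂ = ±2` local half of CDF; text = pen
pregrade @56dc3662d3071f11 verbatim): K67-CD binders verbatim through `(hsat)` with `W.frobeniusTrace 2 ≠ 0` added, then local
transversality of the ♭ condition at `ψ₂` for every `ψ₂`-vector `y` of layer 1 (`y ∈ E(ℚ_{1,v}) = E(ℚ₂(√2))`, `g·y = −y`: the
image of a point of the twist `E^{(2)}`) and every non-divisibility exponent `k`: SOME `z ∈ Ker Col♭` (Sprung's ♭ Coleman kernel for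
`(a₂, g, c)`) has `2^{k+1} ∤ z(y)` — the INDEX form.  Read through Def. 7.9
(`E^♭ = Ann(Ker Col♭)`): the ψ₂-part `L♭_ψ = E^♭ ∩ (E(ℚ_{∞,v}) ⊗ ℚ₂/ℤ₂)[γ+1]` meets the Kummer line `ℤ₂·y ⊗ ℚ₂/ℤ₂` trivially —
the transversality `t = 0` of CDF, locally.  Unfolded (`E(ℚ_{1,v})` has no `2`-torsion and `E(ℚ_{1,v})^{g=−1} = ℤ₂·y₀`, so a
ψ₂-vector `y = 2^j·u·y₀` lies outside `2^k·E(ℚ_{1,v})` iff `j < k`): the statement says EXACTLY `∃ z ∈ Ker Col♭, v₂(z(y₀)) ≤ 1`; for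
a system with `(g−1)c₁ = −2u·y₀`, `u ∈ ℤ₂^×` (Honda: `u = 1`), p800827's identity `z((g−1)c₁) = Col♯(z)(−2)` turns this into
`Col♯(Ker Col♭) ⊄ (8, T+2)` (exponent `0`, which Honda systems achieve, is `⊄ (4, T+2)`; note `Col♯(z)(−2) ∈ 2ℤ₂` on `Ker Col♭`
automatically).  The ROBUST typing (CDF-ATTACK-GEN18 v3 §7 / p802455): through an arbitrary ψ₂-vector
`y`, not through `(g−1)c₁` or a Coleman Wronskian (at `a₂ = 0` the clauses leave `c₁` free).  Non-vacuity witness: `11a1`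
(`a₂ = −2`, `w·χ₈(11) = −1`).  At `a₂ = 0` a tree theorem (`flatBlindLocalTransversality_of_frobeniusTrace_eq_zero` below, p801290);
at `a₂ = ±2` OPEN: nothing in print or in the tree places `Ker Col♭` at `ψ₂` — no parity vanishing of `u_n, v_n`, no trace
description of `E^♭` ([Sprung2012] Open Problem 7.22), the `±` pair does not span at `a₂ = ±2` (MEMO-imc §10.100 D-imc-60).  Why it
might fail: the statement quantifies over EVERY (L)(TR)(Z)(SAT)-system `c`; for HONDA systems it is decided true with exponent `0` in
the two-generation model (rung `FlatBlindLocalTransversalityHondaOffZeroAtTwo`, D-imc-72), and for systems whose `Λ`-span has finite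
index `2^m` the model gives exponent `m` only — so CDF± as typed also asserts that no legal system of index `≥ 2` kills
`E(ℚ_{1,v})^{g=−1}` modulo `4`; in the model every `Λ`-multiple of Honda satisfying (Z)(SAT) has index `1`, exotic legal
perturbations exist at finite depth and die (§10.111), and `End_Λ(E(ℚ_{∞,v})) = Λ` — conjecturally no exotic system survives.
Nothing asserted. [cite: Sprung2012, Def. 7.9 (p. 1503), (7.3)–(7.5), Open Problem 7.22] [cite: Kobayashi2003, Prop. 8.12 ii) (shape, odd p)] -/
def FlatBlindLocalTransversalityOffZeroAtTwo : Prop :=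
  ∀ (W : WeierstrassCurve ℚ) [W.IsElliptic] [W.IsGloballyMinimal],
  ¬ W.HasCM → GoodSS W 2 → W.frobeniusTrace 2 ≠ 0 → W.rootNumber * ZMod.χ₈ (W.conductorNorm ℤ : ZMod 8) = -1 →
  ∀ (κ : ZpExtension ℚ 2) (γ : Field.absoluteGaloisGroup ℚ),
    κ.IsCyclotomic → κ.IsTopGenerator γ → IsCyclotomicVariable 2 γ →
  ∀ (v : HeightOneSpectrum (𝓞 ℚ)), (2 : 𝓞 ℚ) ∈ v.asIdeal →
  ∀ (g : Field.absoluteGaloisGroup (v.adicCompletion ℚ)) (c : ℕ → localPoints W (v.adicCompletion ℚ)),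
    κ.IsTopGenerator (resGalOfEmb (closureEmb (K := ℚ) (v.adicCompletion ℚ)) g) →
    (∀ n, c n ∈ localLayerPointsOfEmb κ (closureEmb (K := ℚ) (v.adicCompletion ℚ)) W n) →
    (∀ n, 1 ≤ n → localTraceOfEmb κ (closureEmb (K := ℚ) (v.adicCompletion ℚ)) W n (n + 1)
      (c (n + 1)) = W.frobeniusTrace 2 • c n - c (n - 1)) →
    (∀ z₀ : localLayerPointsOfEmb κ (closureEmb (K := ℚ) (v.adicCompletion ℚ)) W 0 →+ ℤ_[2],
      evalOn W (localLayerPointsOfEmb κ (closureEmb (K := ℚ) (v.adicCompletion ℚ)) W 0) z₀ (c 0) = 0 →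
        z₀ = 0) →
    (∀ a : ℤ_[2],
      (∃ z₀ : localLayerPointsOfEmb κ (closureEmb (K := ℚ) (v.adicCompletion ℚ)) W 0 →+ ℤ_[2],
        evalOn W (localLayerPointsOfEmb κ (closureEmb (K := ℚ) (v.adicCompletion ℚ)) W 0) z₀ (c 0) = 2 * a) →
      ∃ y : localLayerPointsOfEmb κ (closureEmb (K := ℚ) (v.adicCompletion ℚ)) W 0 →+ ℤ_[2],
        evalOn W (localLayerPointsOfEmb κ (closureEmb (K := ℚ) (v.adicCompletion ℚ)) W 0) y (c 0) = a) →
    ∀ (y : localPoints W (v.adicCompletion ℚ))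
      (hy : y ∈ localLayerPointsOfEmb κ (closureEmb (K := ℚ) (v.adicCompletion ℚ)) W 1), g • y = -y →
      ∀ k : ℕ, (∀ w ∈ localLayerPointsOfEmb κ (closureEmb (K := ℚ) (v.adicCompletion ℚ)) W 1, 2 ^ k • w ≠ y) →
        ∃ z ∈ colemanKer κ (closureEmb (K := ℚ) (v.adicCompletion ℚ)) W (W.frobeniusTrace 2) g c .flat,
          ¬ (2 : ℤ_[2]) ^ (k + 1) ∣
            z ⟨y, localLayerPointsOfEmb_le_localTowerPointsOfEmb κ (closureEmb (K := ℚ) (v.adicCompletion ℚ)) W 1 hy⟩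

/-- **CDF_glob `FlatBlindControlOfLocalAtTwo`** (v2.6, OPEN; the GLOBAL content of CDF = the ψ₂-twisted CONTROL theorem; text =
pen pregrade @56dc3662d3071f11 verbatim), POINTWISE: K67-CD binders verbatim through `(hsat)`, THEN the local transversality
conclusion (index form) for these very `(W, κ, v, g, c)` as ONE hypothesis, then the K67-CD tail `(W₂, ι, P)` and the finiteness
conclusion `Finite (Sel♭(E/ℚ_∞)[γ+1])` verbatim.  Intended proof (CDF-ATTACK-GEN18 §6, tree names; seat t42 GEN 37 types DEFS (D1)(D2)
+ brick 1): `Sel♭_∞[γ+1][2^J] ↩ H¹_𝓕(ℚ, E[2^J](ψ₂))` by twisted inflation–restriction (`E(ℚ_∞)[2] = 0`: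
`SignedTransportAtTwo.fixedPoints_kerSubgroup_eq_bot_of_goodSS`; cluster `ZpExtensionGaloisTwist*`, `u = −1` admissible at `p = 2`),
local condition at `v ∋ 2` = pull-back of `L♭_ψ`, Kummer elsewhere; Poitou–Tate (`poitouTate_selmerStructure_duality_holds`) against
the strict-at-`2` Selmer group of `W₂`, finite by `rank W₂ = 1` + `Ш(W₂)[2^∞]` finite + `log P ≠ 0`; the local hypothesis bounds the
defect `L♭_ψ ∩ (Kummer line)` uniformly in `J`.  Research-but-structural; no `p`-adic analysis.  Why it might fail: only through
bookkeeping at `p = 2` (the twist dictionary `W₂(ℚ) ∋ P ↦ y ∈ E(ℚ_{1,v})^{g=−1}` along `ℚ(√2) = ` first cyclotomic layer,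
Tamagawa/torsion constants at `2`), not through any conjecture.  Nothing asserted.
[cite: Greenberg1999LNM, §3–§4 (shape)] [cite: PerrinRiou1993Fourier, §3.4 (shape)] [cite: Kramer1981, Prop. 7] -/
def FlatBlindControlOfLocalAtTwo : Prop :=
  ∀ (W : WeierstrassCurve ℚ) [W.IsElliptic] [W.IsGloballyMinimal],
  ¬ W.HasCM → GoodSS W 2 → W.rootNumber * ZMod.χ₈ (W.conductorNorm ℤ : ZMod 8) = -1 →
  ∀ (κ : ZpExtension ℚ 2) (γ : Field.absoluteGaloisGroup ℚ),
    κ.IsCyclotomic → κ.IsTopGenerator γ → IsCyclotomicVariable 2 γ →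
  ∀ (v : HeightOneSpectrum (𝓞 ℚ)), (2 : 𝓞 ℚ) ∈ v.asIdeal →
  ∀ (g : Field.absoluteGaloisGroup (v.adicCompletion ℚ)) (c : ℕ → localPoints W (v.adicCompletion ℚ)),
    κ.IsTopGenerator (resGalOfEmb (closureEmb (K := ℚ) (v.adicCompletion ℚ)) g) →
    (∀ n, c n ∈ localLayerPointsOfEmb κ (closureEmb (K := ℚ) (v.adicCompletion ℚ)) W n) →
    (∀ n, 1 ≤ n → localTraceOfEmb κ (closureEmb (K := ℚ) (v.adicCompletion ℚ)) W n (n + 1)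
      (c (n + 1)) = W.frobeniusTrace 2 • c n - c (n - 1)) →
    (∀ z₀ : localLayerPointsOfEmb κ (closureEmb (K := ℚ) (v.adicCompletion ℚ)) W 0 →+ ℤ_[2],
      evalOn W (localLayerPointsOfEmb κ (closureEmb (K := ℚ) (v.adicCompletion ℚ)) W 0) z₀ (c 0) = 0 →
        z₀ = 0) →
    (∀ a : ℤ_[2],
      (∃ z₀ : localLayerPointsOfEmb κ (closureEmb (K := ℚ) (v.adicCompletion ℚ)) W 0 →+ ℤ_[2],
        evalOn W (localLayerPointsOfEmb κ (closureEmb (K := ℚ) (v.adicCompletion ℚ)) W 0) z₀ (c 0) = 2 * a) →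
      ∃ y : localLayerPointsOfEmb κ (closureEmb (K := ℚ) (v.adicCompletion ℚ)) W 0 →+ ℤ_[2],
        evalOn W (localLayerPointsOfEmb κ (closureEmb (K := ℚ) (v.adicCompletion ℚ)) W 0) y (c 0) = a) →
    (∀ (y : localPoints W (v.adicCompletion ℚ))
      (hy : y ∈ localLayerPointsOfEmb κ (closureEmb (K := ℚ) (v.adicCompletion ℚ)) W 1), g • y = -y →
      ∀ k : ℕ, (∀ w ∈ localLayerPointsOfEmb κ (closureEmb (K := ℚ) (v.adicCompletion ℚ)) W 1, 2 ^ k • w ≠ y) →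
        ∃ z ∈ colemanKer κ (closureEmb (K := ℚ) (v.adicCompletion ℚ)) W (W.frobeniusTrace 2) g c .flat,
          ¬ (2 : ℤ_[2]) ^ (k + 1) ∣
            z ⟨y, localLayerPointsOfEmb_le_localTowerPointsOfEmb κ (closureEmb (K := ℚ) (v.adicCompletion ℚ)) W 1 hy⟩) →
  ∀ (W₂ : WeierstrassCurve ℚ) [W₂.IsElliptic] [W₂.IsGloballyMinimal],
    (∃ C : WeierstrassCurve.VariableChange ℚ, C • W.quadraticTwist 2 = W₂) →
    W₂.mordellWeilRank = 1 → Finite (AddCommGroup.primaryComponent W₂.sha 2) →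
  ∀ (ι : ℚ →+* ℚ_[2]) (P : (W₂.baseChange ℚ).toAffine.Point), ¬ IsOfFinAddOrder P →
    Finite (endInvariants (conjSharpFlatSelmerInfty W κ (closureEmb (K := ℚ) (v.adicCompletion ℚ))
      (W.frobeniusTrace 2) g c .flat γ + 1))

/-- **CDF_loc at `a₂ = 0`, BY NAME** (v2.6 kernel; text = pen pregrade verbatim): the local hypothesis of
`FlatBlindControlOfLocalAtTwo` at `a₂ = 0`, for the line's binders, from LEAD ss-1 GEN 18's tree theorem
`OddBlindLocal.exists_mem_colemanKer_flat_not_dvd_apply_of_frobeniusTrace_eq_zero` (p801290). [folklore] -/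
theorem flatBlindLocalTransversality_of_frobeniusTrace_eq_zero
    (W : WeierstrassCurve ℚ) [W.IsElliptic] [W.IsGloballyMinimal] (hss : GoodSS W 2) (ha : W.frobeniusTrace 2 = 0)
    {κ : ZpExtension ℚ 2} (hκ : κ.IsCyclotomic) (v : HeightOneSpectrum (𝓞 ℚ)) (hv : (2 : 𝓞 ℚ) ∈ v.asIdeal)
    {g : Field.absoluteGaloisGroup (v.adicCompletion ℚ)}
    (hg : κ.IsTopGenerator (resGalOfEmb (closureEmb (K := ℚ) (v.adicCompletion ℚ)) g))
    {c : ℕ → localPoints W (v.adicCompletion ℚ)}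
    (hc : ∀ n, c n ∈ localLayerPointsOfEmb κ (closureEmb (K := ℚ) (v.adicCompletion ℚ)) W n)
    (htr : ∀ n, 1 ≤ n → localTraceOfEmb κ (closureEmb (K := ℚ) (v.adicCompletion ℚ)) W n (n + 1) (c (n + 1)) = W.frobeniusTrace 2 • c n - c (n - 1)) :
    ∀ (y : localPoints W (v.adicCompletion ℚ))
      (hy : y ∈ localLayerPointsOfEmb κ (closureEmb (K := ℚ) (v.adicCompletion ℚ)) W 1), g • y = -y →
      ∀ k : ℕ, (∀ w ∈ localLayerPointsOfEmb κ (closureEmb (K := ℚ) (v.adicCompletion ℚ)) W 1, 2 ^ k • w ≠ y) →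
        ∃ z ∈ colemanKer κ (closureEmb (K := ℚ) (v.adicCompletion ℚ)) W (W.frobeniusTrace 2) g c .flat,
          ¬ (2 : ℤ_[2]) ^ (k + 1) ∣
            z ⟨y, localLayerPointsOfEmb_le_localTowerPointsOfEmb κ (closureEmb (K := ℚ) (v.adicCompletion ℚ)) W 1 hy⟩ :=
  fun y hy hgy k hndiv ↦
    Theorems.OddBlindLocal.exists_mem_colemanKer_flat_not_dvd_apply_of_frobeniusTrace_eq_zero W hss ha hκ v hv hg hc htr
      hy hgy hndiv

/-- **GLUE: CDF± ∧ CDF_glob ⟹ K67-CDF** (v2.6 kernel; text = pen pregrade verbatim), the `a₂ = 0` local half fed by name. [folklore] -/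
theorem flatBlindControlFiniteAtTwo_of_offZero_of_local
    (hloc : FlatBlindLocalTransversalityOffZeroAtTwo) (hglob : FlatBlindControlOfLocalAtTwo) :
    FlatBlindControlFiniteAtTwo := by
  intro W _ _ hCM hss hodd κ γ hκ hγ hcv v hv g c hg hc htr hz hsat W₂ _ _ htw hr hsha ι P hP
  by_cases ha : W.frobeniusTrace 2 = 0
  · exact hglob W hCM hss hodd κ γ hκ hγ hcv v hv g c hg hc htr hz hsat
      (flatBlindLocalTransversality_of_frobeniusTrace_eq_zero W hss ha hκ v hv hg hc htr) W₂ htw hr hsha ι P hP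
  · exact hglob W hCM hss hodd κ γ hκ hγ hcv v hv g c hg hc htr hz hsat
      (hloc W hCM hss ha hodd κ γ hκ hγ hcv v hv g c hg hc htr hz hsat) W₂ htw hr hsha ι P hP

/-- **CDF±_H `FlatBlindLocalTransversalityHondaOffZeroAtTwo`** (v2.6, seat `-imc`; a NAMED RUNG below CDF±, not in the cone, nothing
asserted): CDF± verbatim with ONE hypothesis added after (SAT) — `c` is the `c`-part of a HONDA SYSTEM AT TWO
(`F1Sign2.IsHondaSystemAtTwo κ ι W a₂ g cneg c`: the computed bottom relations `c 0 = (a²−2a−1)·ε`, `Tr_{1/0} c 1 = a·c 0 + (4−2a)·ε`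
and Sprung's two-generation clauses, dual form, at every layer `n ≥ 1`).  A pure WEAKENING of CDF±
(`flatBlindLocalTransversalityHondaOffZeroAtTwo_of`), and the form slot 5 needs once stub 2 (`UniformFlatDataAtTwo`) exports the Honda
clauses of the system it produces (they come with `F1Sign2.HondaSystemAtTwoExists`, Sprung 2012 Thm. 2.2 at `p = 2`) — the recommended
v2.7 reshape (LEAD ss-1's verb).  DECIDED TRUE IN THE TWO-GENERATION MODEL, both signs `a₂ = ±2`, with exponent `0` (`z(y₀)` a UNIT;
the typed index form only asks for `v₂(z(y₀)) ≤ 1`) (MEMO-imc §10.111 D-imc-72): in Honda coordinates the blind kernel is EXPLICIT — `Ker Col♭ = {w_f : f ∈ TΛ}`, `Col♯(w_f) = f`, `w_f` the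
functional on `E(ℚ_{∞,v})` with character data `2^j·conj((w_f)_j) = −u_j(χ_j)·f(χ_j)` (`u_j` Sprung's ♯ polynomial, `χ_j = ζ_{2^j} − 1`,
`u_j(χ_j) ≠ 0` with `v₂ = [j even] + Σ_{1≤i≤(j−1)/2} 2^{2i−j}`; MEMO-imc §10.101 Lemma 61.A (iii)/(iv), Thm. 61.2) — so `z := w_T`
(Coleman pair `(T, 0)`) has `Col♭(z) = 0`, `z((g−1)c₁) = T(−2) = −2` (p800827's identity) and `z(y₀) = 1` on the generator `y₀` of
`E(ℚ_{1,v})^{g=−1}` (`(g−1)c₁ = −2·y₀`); since `E(ℚ_{1,v})[2] = 0`, a ψ₂-vector `y = 2^j·u·y₀` lies outside `2^k·E(ℚ_{1,v})` iff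
`j < k`, and then `2^{k+1} ∤ z(y) = 2^j·u`.  Checked in exact arithmetic to depth `N = 5` (`32`-dimensional layers): Coleman
relations of `w_T` at all `m ≤ N`, integrality of `w_T` on `Ê(𝔪_N)`, `w_T(y₀) = 1`, `w_T((g−1)c₁) = −2`, for `a₂ = 2` and `a₂ = −2`
(engine + tables MEMO-imc-data/dimc72).  Why it might fail: only through a normalisation mismatch between the tree's
`IsColemanPair`/`colemanKer` (built on `pairingSum`) and Sprung's (7.3)–(7.5) used by the model — the sign/level-`0` conventions were
cross-checked on p800827 (`z((g−1)c₁) = L♯(z)(−2)`) and p801290.  Nothing asserted.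
[cite: Sprung2012, (7.3)–(7.5), Def. 7.9 (p. 1503), Open Problem 7.22] [cite: Sprung2017, Cor. 4.4 (u_n, v_n)] -/
def FlatBlindLocalTransversalityHondaOffZeroAtTwo : Prop :=
  ∀ (W : WeierstrassCurve ℚ) [W.IsElliptic] [W.IsGloballyMinimal],
  ¬ W.HasCM → GoodSS W 2 → W.frobeniusTrace 2 ≠ 0 → W.rootNumber * ZMod.χ₈ (W.conductorNorm ℤ : ZMod 8) = -1 →
  ∀ (κ : ZpExtension ℚ 2) (γ : Field.absoluteGaloisGroup ℚ),
    κ.IsCyclotomic → κ.IsTopGenerator γ → IsCyclotomicVariable 2 γ →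
  ∀ (v : HeightOneSpectrum (𝓞 ℚ)), (2 : 𝓞 ℚ) ∈ v.asIdeal →
  ∀ (g : Field.absoluteGaloisGroup (v.adicCompletion ℚ)) (c : ℕ → localPoints W (v.adicCompletion ℚ)),
    κ.IsTopGenerator (resGalOfEmb (closureEmb (K := ℚ) (v.adicCompletion ℚ)) g) →
    (∀ n, c n ∈ localLayerPointsOfEmb κ (closureEmb (K := ℚ) (v.adicCompletion ℚ)) W n) →
    (∀ n, 1 ≤ n → localTraceOfEmb κ (closureEmb (K := ℚ) (v.adicCompletion ℚ)) W n (n + 1)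
      (c (n + 1)) = W.frobeniusTrace 2 • c n - c (n - 1)) →
    (∀ z₀ : localLayerPointsOfEmb κ (closureEmb (K := ℚ) (v.adicCompletion ℚ)) W 0 →+ ℤ_[2],
      evalOn W (localLayerPointsOfEmb κ (closureEmb (K := ℚ) (v.adicCompletion ℚ)) W 0) z₀ (c 0) = 0 →
        z₀ = 0) →
    (∀ a : ℤ_[2],
      (∃ z₀ : localLayerPointsOfEmb κ (closureEmb (K := ℚ) (v.adicCompletion ℚ)) W 0 →+ ℤ_[2],
        evalOn W (localLayerPointsOfEmb κ (closureEmb (K := ℚ) (v.adicCompletion ℚ)) W 0) z₀ (c 0) = 2 * a) →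
      ∃ y : localLayerPointsOfEmb κ (closureEmb (K := ℚ) (v.adicCompletion ℚ)) W 0 →+ ℤ_[2],
        evalOn W (localLayerPointsOfEmb κ (closureEmb (K := ℚ) (v.adicCompletion ℚ)) W 0) y (c 0) = a) →
    (∃ cneg : localPoints W (v.adicCompletion ℚ),
      Summit.BirchSwinnertonDyer.Rank1Residual.F1Sign2.IsHondaSystemAtTwo κ (closureEmb (K := ℚ) (v.adicCompletion ℚ)) W
        (W.frobeniusTrace 2) g cneg c) →
    ∀ (y : localPoints W (v.adicCompletion ℚ))
      (hy : y ∈ localLayerPointsOfEmb κ (closureEmb (K := ℚ) (v.adicCompletion ℚ)) W 1), g • y = -y →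
      ∀ k : ℕ, (∀ w ∈ localLayerPointsOfEmb κ (closureEmb (K := ℚ) (v.adicCompletion ℚ)) W 1, 2 ^ k • w ≠ y) →
        ∃ z ∈ colemanKer κ (closureEmb (K := ℚ) (v.adicCompletion ℚ)) W (W.frobeniusTrace 2) g c .flat,
          ¬ (2 : ℤ_[2]) ^ (k + 1) ∣
            z ⟨y, localLayerPointsOfEmb_le_localTowerPointsOfEmb κ (closureEmb (K := ℚ) (v.adicCompletion ℚ)) W 1 hy⟩

/-- **CDF± ⟹ CDF±_H** (v2.6 kernel: forget the Honda hypothesis). [folklore] -/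
theorem flatBlindLocalTransversalityHondaOffZeroAtTwo_of (h : FlatBlindLocalTransversalityOffZeroAtTwo) :
    FlatBlindLocalTransversalityHondaOffZeroAtTwo := by
  intro W _ _ hCM hss ha hodd κ γ hκ hγ hcv v hv g c hg hc htr hz hsat _hH y hy hgy k hnd
  exact h W hCM hss ha hodd κ γ hκ hγ hcv v hv g c hg hc htr hz hsat y hy hgy k hnd

/-- **v2.6 re-assembly of slot 5 for the kernel: CDF± ∧ CDF_glob ∧ CDC ⟹ CDF ∧ CDC** (so `bsdp_two_of_genericOdd` is untouched).
[folklore] -/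
theorem flatBlindControl_pair_of_split3
    (h : FlatBlindLocalTransversalityOffZeroAtTwo ∧ FlatBlindControlOfLocalAtTwo ∧ FlatBlindControlCardAtTwo) :
    FlatBlindControlFiniteAtTwo ∧ FlatBlindControlCardAtTwo :=
  ⟨flatBlindControlFiniteAtTwo_of_offZero_of_local h.1 h.2.1, h.2.2⟩


/-! ## §4c v2.7 HONDA THREAD (seat `-imc` g29, bytes; LEAD ss-1 GEN 19 (L1b) «v2.7 = y», pen RC-705/706): the Honda hypothesis of the
rung CDF±_H carried through CDF → K67-CD → K67-A by pure additions (the v2.6 statements are untouched and imply their Honda twins);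
slot 5's local conjunct := CDF±_H; stub 2 exports the Honda legality clause (§5). -/

/-- **CDF_H `FlatBlindControlFiniteHondaAtTwo`** (v2.7; K67-CDF = `FlatBlindControlFiniteAtTwo` VERBATIM with ONE hypothesis inserted
after (SAT): `c` is the `c`-part of a Honda system at two, `∃ cneg, F1Sign2.IsHondaSystemAtTwo κ ι W a₂ g cneg c`).  The cone's
finiteness statement once slot 5's local conjunct is the Honda rung CDF±_H; implied by K67-CDF (`flatBlindControlFiniteHondaAtTwo_of`)
and glued from CDF±_H ∧ CDF_glob (`flatBlindControlFiniteHondaAtTwo_of_hondaOffZero_of_local`).  Nothing asserted.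
[cite: Greenberg1999LNM, §3–§4 (shape)] [cite: Sprung2012, Thm. 2.2, Lemma 7.9 (Honda systems at 2)] -/
def FlatBlindControlFiniteHondaAtTwo : Prop :=
  ∀ (W : WeierstrassCurve ℚ) [W.IsElliptic] [W.IsGloballyMinimal],
  ¬ W.HasCM → GoodSS W 2 → W.rootNumber * ZMod.χ₈ (W.conductorNorm ℤ : ZMod 8) = -1 →
  ∀ (κ : ZpExtension ℚ 2) (γ : Field.absoluteGaloisGroup ℚ),
    κ.IsCyclotomic → κ.IsTopGenerator γ → IsCyclotomicVariable 2 γ →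
  ∀ (v : HeightOneSpectrum (𝓞 ℚ)), (2 : 𝓞 ℚ) ∈ v.asIdeal →
  ∀ (g : Field.absoluteGaloisGroup (v.adicCompletion ℚ)) (c : ℕ → localPoints W (v.adicCompletion ℚ)),
    κ.IsTopGenerator (resGalOfEmb (closureEmb (K := ℚ) (v.adicCompletion ℚ)) g) →
    (∀ n, c n ∈ localLayerPointsOfEmb κ (closureEmb (K := ℚ) (v.adicCompletion ℚ)) W n) →
    (∀ n, 1 ≤ n → localTraceOfEmb κ (closureEmb (K := ℚ) (v.adicCompletion ℚ)) W n (n + 1)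
      (c (n + 1)) = W.frobeniusTrace 2 • c n - c (n - 1)) →
    (∀ z₀ : localLayerPointsOfEmb κ (closureEmb (K := ℚ) (v.adicCompletion ℚ)) W 0 →+ ℤ_[2],
      evalOn W (localLayerPointsOfEmb κ (closureEmb (K := ℚ) (v.adicCompletion ℚ)) W 0) z₀ (c 0) = 0 →
        z₀ = 0) →
    (∀ a : ℤ_[2],
      (∃ z₀ : localLayerPointsOfEmb κ (closureEmb (K := ℚ) (v.adicCompletion ℚ)) W 0 →+ ℤ_[2],
        evalOn W (localLayerPointsOfEmb κ (closureEmb (K := ℚ) (v.adicCompletion ℚ)) W 0) z₀ (c 0) = 2 * a) →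
      ∃ y : localLayerPointsOfEmb κ (closureEmb (K := ℚ) (v.adicCompletion ℚ)) W 0 →+ ℤ_[2],
        evalOn W (localLayerPointsOfEmb κ (closureEmb (K := ℚ) (v.adicCompletion ℚ)) W 0) y (c 0) = a) →
    (∃ cneg : localPoints W (v.adicCompletion ℚ),
      Summit.BirchSwinnertonDyer.Rank1Residual.F1Sign2.IsHondaSystemAtTwo κ (closureEmb (K := ℚ) (v.adicCompletion ℚ)) W
        (W.frobeniusTrace 2) g cneg c) →
  ∀ (W₂ : WeierstrassCurve ℚ) [W₂.IsElliptic] [W₂.IsGloballyMinimal],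
    (∃ C : WeierstrassCurve.VariableChange ℚ, C • W.quadraticTwist 2 = W₂) →
    W₂.mordellWeilRank = 1 → Finite (AddCommGroup.primaryComponent W₂.sha 2) →
  ∀ (ι : ℚ →+* ℚ_[2]) (P : (W₂.baseChange ℚ).toAffine.Point), ¬ IsOfFinAddOrder P →
    Finite (endInvariants (conjSharpFlatSelmerInfty W κ (closureEmb (K := ℚ) (v.adicCompletion ℚ))
      (W.frobeniusTrace 2) g c .flat γ + 1))

/-- **K67-CDF ⟹ CDF_H** (v2.7 kernel: forget the Honda hypothesis). [folklore] -/
theorem flatBlindControlFiniteHondaAtTwo_of (h : FlatBlindControlFiniteAtTwo) : FlatBlindControlFiniteHondaAtTwo := by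
  intro W _ _ hCM hss hodd κ γ hκ hγ hcv v hv g c hg hc htr hz hsat _hH W₂ _ _ htw hr hsha ι P hP
  exact h W hCM hss hodd κ γ hκ hγ hcv v hv g c hg hc htr hz hsat W₂ htw hr hsha ι P hP

/-- **v2.7 GLUE: CDF±_H ∧ CDF_glob ⟹ CDF_H** (the `a₂ = 0` local half fed by name from p801290, the `a₂ = ±2` half by the Honda
rung at the Honda clause the binders now carry). [folklore] -/
theorem flatBlindControlFiniteHondaAtTwo_of_hondaOffZero_of_local
    (hloc : FlatBlindLocalTransversalityHondaOffZeroAtTwo) (hglob : FlatBlindControlOfLocalAtTwo) :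
    FlatBlindControlFiniteHondaAtTwo := by
  intro W _ _ hCM hss hodd κ γ hκ hγ hcv v hv g c hg hc htr hz hsat hH W₂ _ _ htw hr hsha ι P hP
  by_cases ha : W.frobeniusTrace 2 = 0
  · exact hglob W hCM hss hodd κ γ hκ hγ hcv v hv g c hg hc htr hz hsat
      (flatBlindLocalTransversality_of_frobeniusTrace_eq_zero W hss ha hκ v hv hg hc htr) W₂ htw hr hsha ι P hP
  · exact hglob W hCM hss hodd κ γ hκ hγ hcv v hv g c hg hc htr hz hsat
      (hloc W hCM hss ha hodd κ γ hκ hγ hcv v hv g c hg hc htr hz hsat hH) W₂ htw hr hsha ι P hP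

/-- **K67-CD_H `FlatBlindControlDualityHondaAtTwo`** (v2.7; K67-CD VERBATIM with the Honda hypothesis inserted after (SAT)).  Implied by
K67-CD (`flatBlindControlDualityHondaAtTwo_of`); assembled from CDF_H ∧ CDC (`flatBlindControlDualityHondaAtTwo_of_split`).  Nothing
asserted. [cite: Greenberg1999LNM1716, §3, Lemma 3.3, Prop. 4.1 (shape)] [cite: Kramer1981, Prop. 4, Prop. 7] -/
def FlatBlindControlDualityHondaAtTwo : Prop :=
  ∀ (W : WeierstrassCurve ℚ) [W.IsElliptic] [W.IsGloballyMinimal],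
  ¬ W.HasCM → GoodSS W 2 → W.rootNumber * ZMod.χ₈ (W.conductorNorm ℤ : ZMod 8) = -1 →
  ∀ (κ : ZpExtension ℚ 2) (γ : Field.absoluteGaloisGroup ℚ),
    κ.IsCyclotomic → κ.IsTopGenerator γ → IsCyclotomicVariable 2 γ →
  ∀ (v : HeightOneSpectrum (𝓞 ℚ)), (2 : 𝓞 ℚ) ∈ v.asIdeal →
  ∀ (g : Field.absoluteGaloisGroup (v.adicCompletion ℚ)) (c : ℕ → localPoints W (v.adicCompletion ℚ)),
    κ.IsTopGenerator (resGalOfEmb (closureEmb (K := ℚ) (v.adicCompletion ℚ)) g) →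
    (∀ n, c n ∈ localLayerPointsOfEmb κ (closureEmb (K := ℚ) (v.adicCompletion ℚ)) W n) →
    (∀ n, 1 ≤ n → localTraceOfEmb κ (closureEmb (K := ℚ) (v.adicCompletion ℚ)) W n (n + 1)
      (c (n + 1)) = W.frobeniusTrace 2 • c n - c (n - 1)) →
    (∀ z₀ : localLayerPointsOfEmb κ (closureEmb (K := ℚ) (v.adicCompletion ℚ)) W 0 →+ ℤ_[2],
      evalOn W (localLayerPointsOfEmb κ (closureEmb (K := ℚ) (v.adicCompletion ℚ)) W 0) z₀ (c 0) = 0 →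
        z₀ = 0) →
    (∀ a : ℤ_[2],
      (∃ z₀ : localLayerPointsOfEmb κ (closureEmb (K := ℚ) (v.adicCompletion ℚ)) W 0 →+ ℤ_[2],
        evalOn W (localLayerPointsOfEmb κ (closureEmb (K := ℚ) (v.adicCompletion ℚ)) W 0) z₀ (c 0) = 2 * a) →
      ∃ y : localLayerPointsOfEmb κ (closureEmb (K := ℚ) (v.adicCompletion ℚ)) W 0 →+ ℤ_[2],
        evalOn W (localLayerPointsOfEmb κ (closureEmb (K := ℚ) (v.adicCompletion ℚ)) W 0) y (c 0) = a) →
    (∃ cneg : localPoints W (v.adicCompletion ℚ),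
      Summit.BirchSwinnertonDyer.Rank1Residual.F1Sign2.IsHondaSystemAtTwo κ (closureEmb (K := ℚ) (v.adicCompletion ℚ)) W
        (W.frobeniusTrace 2) g cneg c) →
  ∀ (W₂ : WeierstrassCurve ℚ) [W₂.IsElliptic] [W₂.IsGloballyMinimal],
    (∃ C : WeierstrassCurve.VariableChange ℚ, C • W.quadraticTwist 2 = W₂) →
    W₂.mordellWeilRank = 1 → Finite (AddCommGroup.primaryComponent W₂.sha 2) →
  ∀ (ι : ℚ →+* ℚ_[2]) (P : (W₂.baseChange ℚ).toAffine.Point), ¬ IsOfFinAddOrder P →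
    Finite (endInvariants (conjSharpFlatSelmerInfty W κ (closureEmb (K := ℚ) (v.adicCompletion ℚ))
      (W.frobeniusTrace 2) g c .flat γ + 1)) ∧
    (padicValNat 2 (Nat.card (endInvariants (conjSharpFlatSelmerInfty W κ
        (closureEmb (K := ℚ) (v.adicCompletion ℚ)) (W.frobeniusTrace 2) g c .flat γ + 1))) : ℤ) =
      (padicValNat 2 (Nat.card (AddCommGroup.primaryComponent W₂.sha 2)) : ℤ) +
        (padicValNat 2 W₂.tamagawaProduct : ℤ) +
        2 * (padicLogOrd W₂ 2 ι P - (padicValNat 2 (AddSubgroup.zmultiples P).index : ℤ))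

/-- **K67-CD ⟹ K67-CD_H** (v2.7 kernel: forget the Honda hypothesis). [folklore] -/
theorem flatBlindControlDualityHondaAtTwo_of (h : FlatBlindControlDualityAtTwo) : FlatBlindControlDualityHondaAtTwo := by
  intro W _ _ hCM hss hodd κ γ hκ hγ hcyc v hv g c hg hc htr hz hsat _hH W₂ _ _ htw hr hsha ι P hP
  exact h W hCM hss hodd κ γ hκ hγ hcyc v hv g c hg hc htr hz hsat W₂ htw hr hsha ι P hP

/-- **v2.7 GLUE (R373a shape): CDF_H ∧ CDC ⟹ K67-CD_H.** [folklore] -/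
theorem flatBlindControlDualityHondaAtTwo_of_split (hF : FlatBlindControlFiniteHondaAtTwo) (hC : FlatBlindControlCardAtTwo) :
    FlatBlindControlDualityHondaAtTwo := by
  intro W _ _ hCM hss hodd κ γ hκ hγ hcyc v hv g c hg hc htr hz hsat hH W₂ _ _ htw hr hsha ι P hP
  have hfin := hF W hCM hss hodd κ γ hκ hγ hcyc v hv g c hg hc htr hz hsat hH W₂ htw hr hsha ι P hP
  exact ⟨hfin, hC W hCM hss hodd κ γ hκ hγ hcyc v hv g c hg hc htr hz hsat W₂ htw hr hsha ι P hP hfin⟩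

/-- **v2.10 GLUE (R373a shape, Honda on both sides): CDF_H ∧ CDC_H ⟹ K67-CD_H.** [folklore] -/
theorem flatBlindControlDualityHondaAtTwo_of_splitHonda (hF : FlatBlindControlFiniteHondaAtTwo) (hC : FlatBlindControlCardHondaAtTwo) :
    FlatBlindControlDualityHondaAtTwo := by
  intro W _ _ hCM hss hodd κ γ hκ hγ hcyc v hv g c hg hc htr hz hsat hH W₂ _ _ htw hr hsha ι P hP
  have hfin := hF W hCM hss hodd κ γ hκ hγ hcyc v hv g c hg hc htr hz hsat hH W₂ htw hr hsha ι P hP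
  exact ⟨hfin, hC W hCM hss hodd κ γ hκ hγ hcyc v hv g c hg hc htr hz hsat hH W₂ htw hr hsha ι P hP hfin⟩

/-- **K67-A_H `FlatBlindRegulatorCharacteristicHondaAtTwo`** (v2.7; K67-A VERBATIM with the Honda hypothesis inserted after (SAT)) — the
blind ♭ Euler characteristic = the arithmetic `log²`-BSD₂ quotient of the twist, for Honda–Sprung local data that ARE Honda systems at
two (which is what stub 2 produces).  Implied by K67-A (`flatBlindRegulatorCharacteristicHondaAtTwo_of_v26`); proved from K67-EC ∧ K67-NF ∧
K67-CD_H (`flatBlindRegulatorCharacteristicHondaAtTwo_of`, the v2.2 skeleton proof with the Honda hypothesis threaded); consumed by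
`bsdp_two_of_genericOdd` at stub 2's system.  Nothing asserted. [cite: Kobayashi2003, Thm. 1.2, Thm. 9.3 (shape only, odd p)]
[cite: Sprung2012, Def. 1.1, Thm. 2.2 (the ♭ objects at 2)] -/
def FlatBlindRegulatorCharacteristicHondaAtTwo : Prop :=
  ∀ (W : WeierstrassCurve ℚ) [W.IsElliptic] [W.IsGloballyMinimal],
  ¬ W.HasCM → GoodSS W 2 → W.rootNumber * ZMod.χ₈ (W.conductorNorm ℤ : ZMod 8) = -1 →
  ∀ (κ : ZpExtension ℚ 2) (γ : Field.absoluteGaloisGroup ℚ),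
    κ.IsCyclotomic → κ.IsTopGenerator γ → IsCyclotomicVariable 2 γ →
  ∀ (v : HeightOneSpectrum (𝓞 ℚ)), (2 : 𝓞 ℚ) ∈ v.asIdeal →
  ∀ (g : Field.absoluteGaloisGroup (v.adicCompletion ℚ)) (c : ℕ → localPoints W (v.adicCompletion ℚ)),
    κ.IsTopGenerator (resGalOfEmb (closureEmb (K := ℚ) (v.adicCompletion ℚ)) g) →
    (∀ n, c n ∈ localLayerPointsOfEmb κ (closureEmb (K := ℚ) (v.adicCompletion ℚ)) W n) →
    (∀ n, 1 ≤ n → localTraceOfEmb κ (closureEmb (K := ℚ) (v.adicCompletion ℚ)) W n (n + 1)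
      (c (n + 1)) = W.frobeniusTrace 2 • c n - c (n - 1)) →
    (∀ z₀ : localLayerPointsOfEmb κ (closureEmb (K := ℚ) (v.adicCompletion ℚ)) W 0 →+ ℤ_[2],
      evalOn W (localLayerPointsOfEmb κ (closureEmb (K := ℚ) (v.adicCompletion ℚ)) W 0) z₀ (c 0) = 0 →
        z₀ = 0) →
    (∀ a : ℤ_[2],
      (∃ z₀ : localLayerPointsOfEmb κ (closureEmb (K := ℚ) (v.adicCompletion ℚ)) W 0 →+ ℤ_[2],
        evalOn W (localLayerPointsOfEmb κ (closureEmb (K := ℚ) (v.adicCompletion ℚ)) W 0) z₀ (c 0) = 2 * a) →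
      ∃ y : localLayerPointsOfEmb κ (closureEmb (K := ℚ) (v.adicCompletion ℚ)) W 0 →+ ℤ_[2],
        evalOn W (localLayerPointsOfEmb κ (closureEmb (K := ℚ) (v.adicCompletion ℚ)) W 0) y (c 0) = a) →
    (∃ cneg : localPoints W (v.adicCompletion ℚ),
      Summit.BirchSwinnertonDyer.Rank1Residual.F1Sign2.IsHondaSystemAtTwo κ (closureEmb (K := ℚ) (v.adicCompletion ℚ)) W
        (W.frobeniusTrace 2) g cneg c) →
  ∀ (D : SharpFlatSelmerDualData W κ γ (closureEmb (K := ℚ) (v.adicCompletion ℚ))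
      (W.frobeniusTrace 2) g c .flat) [Module.Finite (IwasawaAlgebra 2) D.X],
    Module.IsTorsion (IwasawaAlgebra 2) D.X →
  ∀ f : IwasawaAlgebra 2, D.charIdeal = Ideal.span {f} →
  ∀ (W₂ : WeierstrassCurve ℚ) [W₂.IsElliptic] [W₂.IsGloballyMinimal],
    (∃ C : WeierstrassCurve.VariableChange ℚ, C • W.quadraticTwist 2 = W₂) →
    W₂.mordellWeilRank = 1 → Finite (AddCommGroup.primaryComponent W₂.sha 2) →
  ∀ (ι : ℚ →+* ℚ_[2]) (P : (W₂.baseChange ℚ).toAffine.Point), ¬ IsOfFinAddOrder P →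
    evalAt (-2 : ℤ_[2]) f ≠ 0 ∧
    ((evalAt (-2 : ℤ_[2]) f).valuation : ℤ) =
      (padicValNat 2 (Nat.card (AddCommGroup.primaryComponent W₂.sha 2)) : ℤ) +
        (padicValNat 2 W₂.tamagawaProduct : ℤ) +
        2 * (padicLogOrd W₂ 2 ι P - (padicValNat 2 (AddSubgroup.zmultiples P).index : ℤ))

/-- **K67-A ⟹ K67-A_H** (v2.7 kernel: forget the Honda hypothesis). [folklore] -/
theorem flatBlindRegulatorCharacteristicHondaAtTwo_of_v26 (h : FlatBlindRegulatorCharacteristicAtTwo) :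
    FlatBlindRegulatorCharacteristicHondaAtTwo := by
  intro W _ _ hCM hss hodd κ γ hκ hγ hcyc v hv g c hg hc htr hz hsat _hH D _ htors f hf W₂ _ _ htw hr hsha ι P hP
  exact h W hCM hss hodd κ γ hκ hγ hcyc v hv g c hg hc htr hz hsat D htors f hf W₂ htw hr hsha ι P hP

/-- **THE v2.7 SKELETON, v2.13 (ζ) form: K67-EC ∧ K67-NF_H ∧ K67-CD_H ⇒ K67-A_H** (the v2.2 composition `flatBlindRegulatorCharacteristicAtTwo_of` with
the Honda hypothesis threaded; from v2.13 `hNF` is the Honda-guarded K67-NF_H, applied with `hH` — one token more than v2.12). [folklore] -/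
theorem flatBlindRegulatorCharacteristicHondaAtTwo_of (hEC : FlatBlindEulerCharAtTwo) (hNF : FlatBlindNoCotorsionHondaAtTwo)
    (hCD : FlatBlindControlDualityHondaAtTwo) : FlatBlindRegulatorCharacteristicHondaAtTwo := by
  unfold FlatBlindRegulatorCharacteristicHondaAtTwo
  intro W _ _ hCM hss hodd κ γ hκ hγ hcyc v hv g c hg hc htr hz hsat hH D _ htors f hf W₂ _ _ htw hr hsha ι P hP
  obtain ⟨hfin, hcard⟩ :=
    hCD W hCM hss hodd κ γ hκ hγ hcyc v hv g c hg hc htr hz hsat hH W₂ htw hr hsha ι P hP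
  haveI := hfin
  have hsub := hNF W hss κ γ hκ hγ hcyc v hv g c hg hc htr hz hsat hH D htors hfin
  haveI := hsub
  have hfin' : Finite (EndCoinvariants (conjSharpFlatSelmerInfty W κ (closureEmb (K := ℚ) (v.adicCompletion ℚ))
      (W.frobeniusTrace 2) g c .flat γ + 1)) := Finite.of_subsingleton
  obtain ⟨hne, hval⟩ := hEC W hss κ γ hκ hγ hcyc v hv g c hg D htors f hf hfin hfin'
  refine ⟨hne, ?_⟩
  have h1 : Nat.card (EndCoinvariants (conjSharpFlatSelmerInfty W κ (closureEmb (K := ℚ) (v.adicCompletion ℚ))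
      (W.frobeniusTrace 2) g c .flat γ + 1)) = 1 := Nat.card_of_subsingleton 0
  rw [hval, hcard, h1]
  simp

/-- **v2.7 re-assembly of slot 5 for the kernel: CDF±_H ∧ CDF_glob ∧ CDC ⟹ CDF_H ∧ CDC.** [folklore] -/
theorem flatBlindControlHonda_pair_of_split3
    (h : FlatBlindLocalTransversalityHondaOffZeroAtTwo ∧ FlatBlindControlOfLocalAtTwo ∧ FlatBlindControlCardAtTwo) :
    FlatBlindControlFiniteHondaAtTwo ∧ FlatBlindControlCardAtTwo :=
  ⟨flatBlindControlFiniteHondaAtTwo_of_hondaOffZero_of_local h.1 h.2.1, h.2.2⟩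

/-- **CDF±_H BY NAME (v2.8): the Honda rung is the tree theorem `OddBlindLocal.flatBlindLocalTransversalityHondaOffZeroAtTwo`** (LEAD ss-1 GEN 19,
p811371 `Theorems/ByReductionTypeAtTwoSupersingularFlatBlindHondaRung.lean`, with p810801/p810939/p811031/p811115/p811294: Silverman VII.6.3 at layer 1 ⟹
non-degenerate pair ⟹ (IND₁) ⟹ odd Wronskian slope (D₁) ⟹ (K₈) ⟹ the rung; type = the rung body verbatim).  NOT in print ([Sprung2012] §7 is odd `p`,
Open Problem 7.22).  [cite: Sprung2012, Thm. 2.2, Def. 7.9, Open Problem 7.22] [cite: SilvermanAEC2009, VII Prop. 6.3, IV Thm. 6.4 (b)] -/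
theorem flatBlindLocalTransversalityHondaOffZeroAtTwo_holds : FlatBlindLocalTransversalityHondaOffZeroAtTwo :=
  Summit.BirchSwinnertonDyer.BirchSwinnertonDyer.Theorems.OddBlindLocal.flatBlindLocalTransversalityHondaOffZeroAtTwo

/-- **v2.8 re-assembly of slot 5 for the kernel: CDF_glob ∧ CDC ⟹ CDF_H ∧ CDC**, the Honda rung CDF±_H fed BY NAME. [folklore] -/
theorem flatBlindControlHonda_pair_of_glob_card (h : FlatBlindControlOfLocalAtTwo ∧ FlatBlindControlCardAtTwo) :
    FlatBlindControlFiniteHondaAtTwo ∧ FlatBlindControlCardAtTwo :=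
  ⟨flatBlindControlFiniteHondaAtTwo_of_hondaOffZero_of_local flatBlindLocalTransversalityHondaOffZeroAtTwo_holds h.1, h.2⟩

/-- **CDF_glob BY NAME (v2.9): the ψ₂-twisted control theorem is the tree theorem `OddBlindLocal.flatBlindControlOfLocalAtTwo`** (LEAD ss-1 GEN 20,
p812310 `Theorems/ByReductionTypeAtTwoSupersingularFlatBlindControlOfLocal.lean`, with p811982/p812030 (HT-1: local Kummer congruence + local count, `C₂ = 4`),
tower-1 p811978 (HT-2 twist side), t42 p811173 (HT-3), p807657 (count), p806693 (defs): the glue `flatBlindControlOfLocalAtTwo_of_HT2` instantiated at HT-2;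
type = the body of `FlatBlindControlOfLocalAtTwo` verbatim).  NOT in print at `2` (ψ₂-twisted ♭ control; [Kobayashi2003] Thm. 9.3 / [Kim2013] shape at odd `p`).
[cite: Kobayashi2003, Thm. 9.3 (shape, odd p)] [cite: Sprung2012, Prop. 7.13 (shape)] -/
theorem flatBlindControlOfLocalAtTwo_holds : FlatBlindControlOfLocalAtTwo :=
  Summit.BirchSwinnertonDyer.BirchSwinnertonDyer.Theorems.OddBlindLocal.flatBlindControlOfLocalAtTwo

/-- **v2.9 re-assembly of slot 5 for the kernel: CDC ⟹ CDF_H ∧ CDC**, the Honda rung CDF±_H and CDF_glob fed BY NAME. [folklore] -/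
theorem flatBlindControlHonda_pair_of_card (h : FlatBlindControlCardAtTwo) :
    FlatBlindControlFiniteHondaAtTwo ∧ FlatBlindControlCardAtTwo :=
  flatBlindControlHonda_pair_of_glob_card ⟨flatBlindControlOfLocalAtTwo_holds, h⟩

/-- **CDF_H holds outright (v2.10): CDF±_H (p811371) and CDF_glob (p812310) by name, the `a₂ = 0` half (p801290) by name.** [folklore] -/
theorem flatBlindControlFiniteHondaAtTwo_holds : FlatBlindControlFiniteHondaAtTwo :=
  flatBlindControlFiniteHondaAtTwo_of_hondaOffZero_of_local flatBlindLocalTransversalityHondaOffZeroAtTwo_holds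
    flatBlindControlOfLocalAtTwo_holds

/-- **v2.10 re-assembly of slot 5 for the kernel: CDC_H ⟹ CDF_H ∧ CDC_H.** [folklore] -/
theorem flatBlindControlHonda_pairHonda_of_cardHonda (h : FlatBlindControlCardHondaAtTwo) :
    FlatBlindControlFiniteHondaAtTwo ∧ FlatBlindControlCardHondaAtTwo :=
  ⟨flatBlindControlFiniteHondaAtTwo_holds, h⟩


/-! ## §5 The statements of the stubs (seven through v2.10.1, six from v2.11), as named `Prop`s (so that BC7 probes them by name) -/

/-- Statement of `stub_pub`: the PUBLISHED inputs, by the tree's fact names — modularity (Wiles–BCDT), GZK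
(`rank = r_an ∧ Ш finite` for `r_an ≤ 1`), Kato's two accepted facts (Astérisque 295 Thm. 12.4), entire continuation of
`L(E,s)` over `ℚ` (v2.12 = the v2.10.1 body again: the v2.11 conjunct hPT — Poitou–Tate duality for finite Selmer structures over `ℚ`
with the real places — is the TREE THEOREM `OddBlindLocal.poitouTateReal_rat` (p822193 ← p626891) and is no longer carried); v2.14 (director
(830)(iii)): PLUS the two print inputs of slot 4a — the Cassels–Tate pairing on the layers `Sel_{p^∞}(E/K_n)` of a `ℤ_p`-tower (alternating,
kernel the divisible elements, Galois-equivariant, restriction adjoint to corestriction; Cassels 1962 / Milne ADT I.6.13 / Hachimori–Matsuno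
2000 p. 2540) and Kato's Cor. 14.3 (1) in the layer form (`L(E,χ,1) ≠ 0 ⟹ Sel(E/ℚ_n)^{(χ)}` finite, every `p` including `2`, Astérisque 295 p. 235).
[cite: BCDTJAMS2001, Theorem A] [cite: Kato2004Asterisque, Thm. 12.4] [cite: Kolyvagin1990, Thm. A] [cite: HachimoriMatsuno2000, Theorem (p. 2540)]
[cite: Kato2004Asterisque, Thm. 14.2 (2) and Cor. 14.3 (1) (p. 235)] v2.16 (director (844)): PLUS Kato's Thm. 13.4 (2) AT `p = 2` — the Euler-system bound
`ℓ_𝔭(X₀(E/ℚ_∞)) ≤ ℓ_𝔭(𝐇¹_Γ(T₂E)/Λs)` at the height-one primes `𝔭 ∌ 2` for a non-zero genuine `2`-adic Euler-system class `s` (the set of primes at which Kato states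
Conj. 12.10 for `p = 2`), the F4rat conjunct of the old ♭ package, now by fact name; AND (folding v2.15) Greenberg 1989 §3 Cor. 2 (for a `ℤ_p`-extension
`K_∞/K` of a `p`-adic field and `A = E[p^∞]` with `A(K_∞) = 0`, the Pontryagin dual of `H¹(K_∞, A)` is `Λ`-free of rank `2[K:ℚ_p]`), the one print input of K86
(`H¹_Iw(ℚ₂, T₂E)` free of rank `2` in the points model; Coates–Greenberg 1996 Cor. 3.2 is the tree THEOREM `CoatesGreenberg1996.H1_goodModelKernel_trivial_holds`).
v2.18 (R1, director (905)(b)(ii)): Kato's Thm. 13.4 (2) at `2` is carried PRINT-EXACT — `…fineSelmerDualContra…`: `I` covariant (key `γ`), `X₀` contragredient (key `γ⁻¹`),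
both lengths at the same `𝔭` (no `ι`); and the entire continuation of `L(E,s)` is no longer a separate input (it follows from the modularity conjunct by name:
`Rank1Residual.entireLFunction_one_ne_zero_of_analyticRank_eq_zero`).
[cite: Kato2004Asterisque, Thm. 13.4 (2) (p. 226), Conj. 12.10 (p. 224)] [cite: Greenberg1989, §3 Corollary 2 (Adv. Stud. Pure Math. 17, p. 112)] 
v2.21 (F3 fold): PREPENDED pair — Kato's (KZ) Tate-pairing value law at `p = 2` (`Kato2004.exists_eulerSystem_expStar_tatePairing_values_two`, Thm. 12.5 (1) read on the
layer Tate pairing; K3's `stub_katoTatePairingFactTwo`) and Abbes–Ullmo 1996 Thm. A (`ModularForms.abbesUllmo_not_dvd_maninConstant_of_not_dvd_level`, «p ∣ c_E ⇒ p ∣ N»,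
ARS 2006 Thm. 2.5 — at `p = 2 ∤ N`; a named fact, K4 independent of the Manin audit); accessors `hPub.x ↦ hPub.2.x`.
[cite: Kato2004Asterisque, Thm. 12.5 (1) (pp. 221–222)] [cite: AgasheRibetStein2006, Thm. 2.5] -/
def PublishedInputsAtTwo : Prop :=
  (Kato2004.exists_eulerSystem_expStar_tatePairing_values_two ∧
    Literature.NumberTheory.EllipticCurves.ModularForms.abbesUllmo_not_dvd_maninConstant_of_not_dvd_level) ∧
  (nonempty_modularParametrizationData ∧ rank_eq_analyticRank_of_analyticRank_le_one) ∧
    (Kato2004.thm12_4 ∧ Kato2004_fineSelmerDual_isTorsion) ∧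
    (HachimoriMatsuno2000.casselsTate_layerPairing.{0} ∧
      (Literature.NumberTheory.EllipticCurves.kato_finite_chiPart_selmerLayer_of_twistedLValue_ne_zero ∧
        (Literature.NumberTheory.EllipticCurves.Kato2004.thm13_4_two_lengthAt_fineSelmerDualContra_le_of_isEulerSystemClassTwo ∧
          Literature.NumberTheory.EllipticCurves.Greenberg1989.localH1Dual_free_of_towerTorsion_trivial)))

/-- Statement of `stub_allFlatData` — VERBATIM the line of record `flat_uniform_two.lean` stub (2): for EVERY curve of
the crux, Sprung's ♭ local Coleman data at `v ∋ 2` with the Honda₂ clauses ∧ COUNT♭@2 ∧ CK♭@2 (the Kato-side package; v2.12 (δ):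
its guarded last conjunct `TwoAdicSurjective W →` F4@(2) — the IMAGE-HYPOTHESIS clause — is DROPPED, T-84 feeding the `(2)`-prime by
statement (A) instead; the package ends at the image-free `(𝔭 ∌ 2)`-clause).  BEYOND PRINT AT 2 (audits K11 / flatPkg of seat
bsd-2adic-ss-1).  [cite: Sprung2012, Thm. 2.2, 7.14, 7.16] [cite: Sprung2024, Lemmas 5.5–5.9] [cite: Kato2004Asterisque, Thm. 12.5] -/
def UniformFlatDataAtTwo : Prop :=
      ∀ (W : WeierstrassCurve ℚ) [W.IsElliptic] [W.IsGloballyMinimal],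
      ¬ W.HasCM → W.analyticRank = 0 → GoodSS W 2 →
      ∀ (κ : ZpExtension ℚ 2) (γ : Field.absoluteGaloisGroup ℚ),
        κ.IsCyclotomic → κ.IsTopGenerator γ → IsCyclotomicVariable 2 γ →
      ∀ (v : HeightOneSpectrum (𝓞 ℚ)), (2 : 𝓞 ℚ) ∈ v.asIdeal →
      ∃ (g : Field.absoluteGaloisGroup (v.adicCompletion ℚ)) (c : ℕ → localPoints W (v.adicCompletion ℚ)),
        κ.IsTopGenerator (resGalOfEmb (closureEmb (K := ℚ) (v.adicCompletion ℚ)) g) ∧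
        (∀ n, c n ∈ localLayerPointsOfEmb κ (closureEmb (K := ℚ) (v.adicCompletion ℚ)) W n) ∧
        (∀ n, 1 ≤ n → localTraceOfEmb κ (closureEmb (K := ℚ) (v.adicCompletion ℚ)) W n (n + 1)
          (c (n + 1)) = W.frobeniusTrace 2 • c n - c (n - 1)) ∧
        (∀ z₀ : localLayerPointsOfEmb κ (closureEmb (K := ℚ) (v.adicCompletion ℚ)) W 0 →+ ℤ_[2],
          evalOn W (localLayerPointsOfEmb κ (closureEmb (K := ℚ) (v.adicCompletion ℚ)) W 0) z₀ (c 0) = 0 →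
            z₀ = 0) ∧
        (∀ a : ℤ_[2],
          (∃ z₀ : localLayerPointsOfEmb κ (closureEmb (K := ℚ) (v.adicCompletion ℚ)) W 0 →+ ℤ_[2],
            evalOn W (localLayerPointsOfEmb κ (closureEmb (K := ℚ) (v.adicCompletion ℚ)) W 0) z₀ (c 0) =
              2 * a) →
          ∃ y : localLayerPointsOfEmb κ (closureEmb (K := ℚ) (v.adicCompletion ℚ)) W 0 →+ ℤ_[2],
            evalOn W (localLayerPointsOfEmb κ (closureEmb (K := ℚ) (v.adicCompletion ℚ)) W 0) y (c 0) = a) ∧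
        (Finite (W.selmerGroupPInfty 2) →
          Finite (EndCoinvariants (conjSharpFlatSelmerInfty W κ (closureEmb (K := ℚ) (v.adicCompletion ℚ))
            (W.frobeniusTrace 2) g c .flat γ - 1)) →
          Nat.card (↥((sharpFlatSelmerInfty W κ (closureEmb (K := ℚ) (v.adicCompletion ℚ))
                (W.frobeniusTrace 2) g c .flat).comap (W.layerToInfty κ 0)) ⧸
              (W.selmerLayer κ 0).addSubgroupOf
                ((sharpFlatSelmerInfty W κ (closureEmb (K := ℚ) (v.adicCompletion ℚ))
                  (W.frobeniusTrace 2) g c .flat).comap (W.layerToInfty κ 0))) *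
            Nat.card (MulAction.fixedPoints (Field.absoluteGaloisGroup ℚ) (W.geomPrimaryTorsion 2)) =
          2 ^ (padicValNat 2 W.tamagawaProduct) *
            Nat.card (EndCoinvariants (conjSharpFlatSelmerInfty W κ
              (closureEmb (K := ℚ) (v.adicCompletion ℚ)) (W.frobeniusTrace 2) g c .flat γ - 1))) ∧
        (∀ [NeZero (W.conductorNorm ℤ)] (f : CuspForm (Gamma0 (W.conductorNorm ℤ)) 2),
            IsNewformOf W f → ∀ (ϖ : ℚ), (ϖ : ℝ) * W.realPeriodRat = plusPeriod f →
          ∀ (Ls Lf : IwasawaAlgebra 2), IsSprungPair f 2 (W.frobeniusTrace 2) Ls Lf →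
          ∀ (D : SharpFlatSelmerDualData W κ γ⁻¹ (closureEmb (K := ℚ) (v.adicCompletion ℚ))
              (W.frobeniusTrace 2) g c .flat) [ContinuousSMul ℤ_[2] (W.tateModule 2)],
            ∃ (I : Kato2004.IwasawaH1Data W 2 κ γ) (Y : W.FineSelmerDualData κ γ⁻¹)
              (P : Submodule (IwasawaAlgebra 2) (IwasawaAlgebra 2))
              (loc : I.H →ₗ[IwasawaAlgebra 2] P) (toX : P →ₗ[IwasawaAlgebra 2] D.X)
              (δ : D.X →ₗ[IwasawaAlgebra 2] Y.X) (Z : Submodule (IwasawaAlgebra 2) I.H)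
              (G : IwasawaAlgebra 2),
              Function.Exact loc toX ∧ Function.Exact toX δ ∧
              G ∈ Submodule.map (P.subtype ∘ₗ loc) Z ∧
              iwasawaToPowerSeries 2 G = PowerSeries.C (ϖ : ℚ_[2]) * iwasawaToPowerSeries 2 Lf ∧
              (∀ 𝔭 : PrimeSpectrum (IwasawaAlgebra 2), 𝔭.asIdeal.height = 1 →
                PowerSeries.C (2 : ℤ_[2]) ∉ 𝔭.asIdeal →
                Literature.NumberTheory.EllipticCurves.Module.lengthAt (IwasawaAlgebra 2) Y.X 𝔭 ≤
                  Literature.NumberTheory.EllipticCurves.Module.lengthAt (IwasawaAlgebra 2) (I.H ⧸ Z) 𝔭))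

/-- Statement of `stub_allFlatData` (v2.7) — `UniformFlatDataAtTwo` (the line of record `flat_uniform_two.lean` stub (2), kept
VERBATIM above) WITH THE HONDA LEGALITY CLAUSE EXPORTED: after (SAT), `∃ cneg, F1Sign2.IsHondaSystemAtTwo κ ι W (W.frobeniusTrace 2) g cneg c`
— the produced `c` is the `c`-part of a Honda system at two (computed bottom relations `c 0 = (a²−2a−1)·c₋`, `Tr_{1/0} c 1 = a·c 0 + (4−2a)·c₋`,
Sprung's two-generation clauses in dual form at every layer).  Zero content cost (LEAD ss-1 GEN 19 (L1b), pen RC-705): the intended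
witness IS Sprung's Honda system (`F1Sign2.HondaSystemAtTwoExists` = (C1), [Sprung2012] Thm. 2.2 / Lemma 7.9 at `p = 2`), whose Coleman
maps carry COUNT♭ / CK♭; `uniformFlatDataAtTwo_of_honda` recovers the guard-free v2.6 statement for the T-84 consumer.  v2.12 (δ): the guarded
`(2)`-conjunct is DROPPED here too (same edit as in `UniformFlatDataAtTwo`).  BEYOND PRINT AT 2 as before.  [cite: Sprung2012, Thm. 2.2, Lemma 7.9, 7.14, 7.16] [cite: Sprung2024, Lemmas 5.5–5.9] [cite: Kato2004Asterisque, Thm. 12.5] -/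
def UniformFlatHondaDataAtTwo : Prop :=
      ∀ (W : WeierstrassCurve ℚ) [W.IsElliptic] [W.IsGloballyMinimal],
      ¬ W.HasCM → W.analyticRank = 0 → GoodSS W 2 →
      ∀ (κ : ZpExtension ℚ 2) (γ : Field.absoluteGaloisGroup ℚ),
        κ.IsCyclotomic → κ.IsTopGenerator γ → IsCyclotomicVariable 2 γ →
      ∀ (v : HeightOneSpectrum (𝓞 ℚ)), (2 : 𝓞 ℚ) ∈ v.asIdeal →
      ∃ (g : Field.absoluteGaloisGroup (v.adicCompletion ℚ)) (c : ℕ → localPoints W (v.adicCompletion ℚ)),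
        κ.IsTopGenerator (resGalOfEmb (closureEmb (K := ℚ) (v.adicCompletion ℚ)) g) ∧
        (∀ n, c n ∈ localLayerPointsOfEmb κ (closureEmb (K := ℚ) (v.adicCompletion ℚ)) W n) ∧
        (∀ n, 1 ≤ n → localTraceOfEmb κ (closureEmb (K := ℚ) (v.adicCompletion ℚ)) W n (n + 1)
          (c (n + 1)) = W.frobeniusTrace 2 • c n - c (n - 1)) ∧
        (∀ z₀ : localLayerPointsOfEmb κ (closureEmb (K := ℚ) (v.adicCompletion ℚ)) W 0 →+ ℤ_[2],
          evalOn W (localLayerPointsOfEmb κ (closureEmb (K := ℚ) (v.adicCompletion ℚ)) W 0) z₀ (c 0) = 0 →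
            z₀ = 0) ∧
        (∀ a : ℤ_[2],
          (∃ z₀ : localLayerPointsOfEmb κ (closureEmb (K := ℚ) (v.adicCompletion ℚ)) W 0 →+ ℤ_[2],
            evalOn W (localLayerPointsOfEmb κ (closureEmb (K := ℚ) (v.adicCompletion ℚ)) W 0) z₀ (c 0) =
              2 * a) →
          ∃ y : localLayerPointsOfEmb κ (closureEmb (K := ℚ) (v.adicCompletion ℚ)) W 0 →+ ℤ_[2],
            evalOn W (localLayerPointsOfEmb κ (closureEmb (K := ℚ) (v.adicCompletion ℚ)) W 0) y (c 0) = a) ∧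
        (∃ cneg : localPoints W (v.adicCompletion ℚ),
          Summit.BirchSwinnertonDyer.Rank1Residual.F1Sign2.IsHondaSystemAtTwo κ
            (closureEmb (K := ℚ) (v.adicCompletion ℚ)) W (W.frobeniusTrace 2) g cneg c) ∧
        (Finite (W.selmerGroupPInfty 2) →
          Finite (EndCoinvariants (conjSharpFlatSelmerInfty W κ (closureEmb (K := ℚ) (v.adicCompletion ℚ))
            (W.frobeniusTrace 2) g c .flat γ - 1)) →
          Nat.card (↥((sharpFlatSelmerInfty W κ (closureEmb (K := ℚ) (v.adicCompletion ℚ))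
                (W.frobeniusTrace 2) g c .flat).comap (W.layerToInfty κ 0)) ⧸
              (W.selmerLayer κ 0).addSubgroupOf
                ((sharpFlatSelmerInfty W κ (closureEmb (K := ℚ) (v.adicCompletion ℚ))
                  (W.frobeniusTrace 2) g c .flat).comap (W.layerToInfty κ 0))) *
            Nat.card (MulAction.fixedPoints (Field.absoluteGaloisGroup ℚ) (W.geomPrimaryTorsion 2)) =
          2 ^ (padicValNat 2 W.tamagawaProduct) *
            Nat.card (EndCoinvariants (conjSharpFlatSelmerInfty W κ
              (closureEmb (K := ℚ) (v.adicCompletion ℚ)) (W.frobeniusTrace 2) g c .flat γ - 1))) ∧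
        (∀ [NeZero (W.conductorNorm ℤ)] (f : CuspForm (Gamma0 (W.conductorNorm ℤ)) 2),
            IsNewformOf W f → ∀ (ϖ : ℚ), (ϖ : ℝ) * W.realPeriodRat = plusPeriod f →
          ∀ (Ls Lf : IwasawaAlgebra 2), IsSprungPair f 2 (W.frobeniusTrace 2) Ls Lf →
          ∀ (D : SharpFlatSelmerDualData W κ γ⁻¹ (closureEmb (K := ℚ) (v.adicCompletion ℚ))
              (W.frobeniusTrace 2) g c .flat) [ContinuousSMul ℤ_[2] (W.tateModule 2)],
            ∃ (I : Kato2004.IwasawaH1Data W 2 κ γ) (Y : W.FineSelmerDualData κ γ⁻¹)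
              (P : Submodule (IwasawaAlgebra 2) (IwasawaAlgebra 2))
              (loc : I.H →ₗ[IwasawaAlgebra 2] P) (toX : P →ₗ[IwasawaAlgebra 2] D.X)
              (δ : D.X →ₗ[IwasawaAlgebra 2] Y.X) (Z : Submodule (IwasawaAlgebra 2) I.H)
              (G : IwasawaAlgebra 2),
              Function.Exact loc toX ∧ Function.Exact toX δ ∧
              G ∈ Submodule.map (P.subtype ∘ₗ loc) Z ∧
              iwasawaToPowerSeries 2 G = PowerSeries.C (ϖ : ℚ_[2]) * iwasawaToPowerSeries 2 Lf ∧
              (∀ 𝔭 : PrimeSpectrum (IwasawaAlgebra 2), 𝔭.asIdeal.height = 1 →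
                PowerSeries.C (2 : ℤ_[2]) ∉ 𝔭.asIdeal →
                Literature.NumberTheory.EllipticCurves.Module.lengthAt (IwasawaAlgebra 2) Y.X 𝔭 ≤
                  Literature.NumberTheory.EllipticCurves.Module.lengthAt (IwasawaAlgebra 2) (I.H ⧸ Z) 𝔭))

/-- **v2.7 ⟹ v2.6 for stub 2** (forget the Honda clause; feeds the tree's `SSFlatRoad.missingUpperBoundAt_two_of_uniformFlat`). [folklore] -/
theorem uniformFlatDataAtTwo_of_honda (h : UniformFlatHondaDataAtTwo) : UniformFlatDataAtTwo := by
  intro W _ _ hCM hr hss κ γ hκ hγ hγ' v hv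
  obtain ⟨g, c, hg, hc, hTr, hinj, hsat, _hH, hcount, hCK⟩ := h W hCM hr hss κ γ hκ hγ hγ' v hv
  exact ⟨g, c, hg, hc, hTr, hinj, hsat, hcount, hCK⟩

/-- Statement of `stub_flatPackage` (v2.17): **the ♭ CK-PACKAGE at `2`** = `FlatPackageAtTwo` with its COUNT♭ conjunct DROPPED — COUNT♭ at `2`
is the unconditional tree theorem `SSFlatRoad.flatCount_two_of_isHondaSystemAtTwo` (t42 GEN 47 ★ p829198, keyed on exactly this hypothesis prefix).
What is left: CK♭′ = F1♭ (the ♭ Poitou–Tate exact sequence `𝐇¹_Γ →loc→ P → X♭ → X₀`) ∧ F3 (`G ∈ loc(Z)`, `ι G = C(ϖ)·ι L♭`) ∧ ZL2 (the zeta line in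
local form).  v2.18 (R1): `X♭ = D.X` and `X₀ = Y.X` are the CONTRAGREDIENT (print) duals — key `γ⁻¹`, `1+T ↦ x ∘ conj_{γ⁻¹}` — while `𝐇¹ = I.H` stays covariant over `γ`; the
three maps are Λ-linear (Sprung (3) p. 1486 / Prop. 7.19 verbatim).  v2.20 (B) «(8)∃» (t42 GEN 51 (R∀) + pen RC-835, director (991)(a)): the Honda system `(cneg, c)` is
PROVIDED by the package (`∀ g, hg → ∃ cneg c, IsHondaSystemAtTwo … ∧ …`), not quantified over — the nine clauses are not rigid; no longer a stub: DERIVED from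
`FlatZetaPackageAtTwo` by `flatCKPackageAtTwo_of_flatZetaPackage` (F1♭ folded by name), consumed by `uniformFlatHondaDataAtTwo_of_pub`; `FlatPackageAtTwo` (v2.16, = this +
COUNT♭) deleted as orphan (its text = conjuncts (6)–(9) of `UniformFlatHondaDataAtTwo`). [cite: Sprung2012, Props. 6.3–6.5, Prop. 7.19, Thm. 7.14, 7.16] [cite: Kato2004Asterisque, §13.12–13.14] -/
def FlatCKPackageAtTwo : Prop :=
      ∀ (W : WeierstrassCurve ℚ) [W.IsElliptic] [W.IsGloballyMinimal],
      ¬ W.HasCM → W.analyticRank = 0 → GoodSS W 2 →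
      ∀ (κ : ZpExtension ℚ 2) (γ : Field.absoluteGaloisGroup ℚ) (hκ : κ.IsCyclotomic),
        κ.IsTopGenerator γ → IsCyclotomicVariable 2 γ →
      ∀ (v : HeightOneSpectrum (𝓞 ℚ)), (2 : 𝓞 ℚ) ∈ v.asIdeal →
      ∀ (g : Field.absoluteGaloisGroup (v.adicCompletion ℚ)),
        κ.IsTopGenerator (resGalOfEmb (closureEmb (K := ℚ) (v.adicCompletion ℚ)) g) →
        ∃ (cneg : localPoints W (v.adicCompletion ℚ)) (c : ℕ → localPoints W (v.adicCompletion ℚ)),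
        Summit.BirchSwinnertonDyer.Rank1Residual.F1Sign2.IsHondaSystemAtTwo κ
          (closureEmb (K := ℚ) (v.adicCompletion ℚ)) W (W.frobeniusTrace 2) g cneg c ∧
        (∀ [NeZero (W.conductorNorm ℤ)] (f : CuspForm (Gamma0 (W.conductorNorm ℤ)) 2),
            IsNewformOf W f → ∀ (ϖ : ℚ), (ϖ : ℝ) * W.realPeriodRat = plusPeriod f →
          ∀ (Ls Lf : IwasawaAlgebra 2), IsSprungPair f 2 (W.frobeniusTrace 2) Ls Lf →
          ∀ (D : SharpFlatSelmerDualData W κ γ⁻¹ (closureEmb (K := ℚ) (v.adicCompletion ℚ))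
              (W.frobeniusTrace 2) g c .flat) [ContinuousSMul ℤ_[2] (W.tateModule 2)]
              [Module.Free ℤ_[2] (W.tateModule 2)] [Module.Finite ℤ_[2] (W.tateModule 2)],
            ∃ (I : Kato2004.IwasawaH1Data W 2 κ γ) (Y : W.FineSelmerDualData κ γ⁻¹)
              (P : Submodule (IwasawaAlgebra 2) (IwasawaAlgebra 2))
              (loc : I.H →ₗ[IwasawaAlgebra 2] P) (toX : P →ₗ[IwasawaAlgebra 2] D.X)
              (δ : D.X →ₗ[IwasawaAlgebra 2] Y.X) (Z : Submodule (IwasawaAlgebra 2) I.H)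
              (G : IwasawaAlgebra 2),
              Function.Exact loc toX ∧ Function.Exact toX δ ∧
              G ∈ Submodule.map (P.subtype ∘ₗ loc) Z ∧
              iwasawaToPowerSeries 2 G = PowerSeries.C (ϖ : ℚ_[2]) * iwasawaToPowerSeries 2 Lf ∧
              (∃ s₀ : I.H, Z = Submodule.span (IwasawaAlgebra 2) {s₀} ∧
                ∀ 𝔭 : PrimeSpectrum (IwasawaAlgebra 2), 𝔭.asIdeal.height = 1 →
                  PowerSeries.C (2 : ℤ_[2]) ∉ 𝔭.asIdeal →
                  ∃ (M : IwasawaAlgebra 2) (s : I.H), M ∉ 𝔭.asIdeal ∧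
                    Literature.NumberTheory.EllipticCurves.Kato2004.IsEulerSystemClassTwo W hκ I s ∧ s ≠ 0 ∧
                    M • s₀ = s))

/-- Statement of `stub_flatPackage` (v2.20, LEAD ss-1 GEN 26 on director (991)(a)) — **the ♭ ZETA PACKAGE at `2`** = the (B)-form of (8) with its F1♭ block
FOLDED BY NAME: for every curve of the crux, the cyclotomic `(κ, γ)` (`hκ` named), the place `v ∋ 2` and every local lift `g` of `γ` (`hg` named: the `Λ`-structure
`moduleOfGenerator κ ι W hg` on the functionals `E(ℚ_∞·ℚ_v) →+ ℤ₂` = the tree's model of `H¹_Iw(ℚ_v, T₂W)` is displayed in the binder types), THERE IS a Honda system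
`(cneg, c)` at two ((B): chosen, not arbitrary — the nine clauses are not rigid, t42 GEN 51 (R∀)) such that for every newform `f` of `E`, period ratio `ϖ`, Sprung pair
`(L♯, L♭)`, the `T₂W` structure instances (tree theorems, displayed), EVERY pin `I : 𝐇¹_Γ(T₂W)` (`Kato2004.IwasawaH1Data W 2 κ γ`, covariant key `γ`), EVERY `Λ`-linear
localisation `L : I.H →ₗ (E(ℚ_∞·ℚ_v) →+ ℤ₂)` PINNED by the Tate-pairing residues of `pairFun` (`toZModPow k (L x Q) = tatePairingPk n k (proj_n x) Q` — ★ p830262; T-LIM's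
`hL` 1:1) and EVERY `Λ`-linear joint Coleman family `J` PINNED by the Coleman values of `c` (`IsColemanPair … c w (J w).1 (J w).2` — `OddBlindNF.exists_linearMap_isColemanPair_of_traces`;
unique by Sprung Prop. 5.7): `∃ Z ≤ I.H, ∃ G`, F3a `G ∈ Col♭(L Z)` (`∃ z ∈ Z, (J (L z)).2 = G`) ∧ F3b `ι G = C(ϖ)·ι L♭` ∧ ZL2 (the zeta line in local form, VERBATIM:
`Z = Λ∙s₀` and at each height-one `𝔭 ∌ 2` a `𝔭`-unit multiple of `s₀` is a non-zero genuine `2`-adic Euler class).  RETIRED FROM THE STUB (tree theorems, consumed by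
`flatCKPackageAtTwo_of_flatZetaPackage`): the ♭ Poitou–Tate exactness `Function.Exact loc toX ∧ Function.Exact toX δ` with its carriers `D`, `Y`, `P`, `loc`, `toX`, `δ`
(T-ORTH ★★ p833066 · T-LIM ★★ p834233 · (δ̄) ★ p831519 · T-δ ★★ p833047 · assembly ★ p833046).  BEYOND PRINT AT 2: F3 = the ♭ explicit reciprocity law at `2` for Kato's
zeta element against Sprung's Honda system (hands hF3-ZETA ★★★ p836273 / hF3-ERL reduce it to levelwise Mazur–Tate congruences + the (B1) constant) and ZL2 (Kato §13.12–13.14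
at `p = 2`).  v2.21: no longer a stub — DERIVED from (α) `FlatColemanImagePrimitiveAtTwo` + `stub_pub` by `flatZetaPackageAtTwo_of_flatImage` (the F3 fold).
[cite: Sprung2012, Thm. 2.2, Lemma 7.9, Def. 7.1 (p. 1500), Thm. 7.14, 7.16] [cite: Kato2004Asterisque, Thm. 12.5 (4), §13.9, §13.12–13.14 (pp. 230–234), §17.13]
[cite: Kobayashi2003, Thm. 6.3, (8.23)] -/
def FlatZetaPackageAtTwo : Prop :=
      ∀ (W : WeierstrassCurve ℚ) [W.IsElliptic] [W.IsGloballyMinimal],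
      ¬ W.HasCM → W.analyticRank = 0 → GoodSS W 2 →
      ∀ (κ : ZpExtension ℚ 2) (γ : Field.absoluteGaloisGroup ℚ) (hκ : κ.IsCyclotomic),
        κ.IsTopGenerator γ → IsCyclotomicVariable 2 γ →
      ∀ (v : HeightOneSpectrum (𝓞 ℚ)), (2 : 𝓞 ℚ) ∈ v.asIdeal →
      ∀ (g : Field.absoluteGaloisGroup (v.adicCompletion ℚ))
        (hg : κ.IsTopGenerator (resGalOfEmb (closureEmb (K := ℚ) (v.adicCompletion ℚ)) g)),
        ∃ (cneg : localPoints W (v.adicCompletion ℚ)) (c : ℕ → localPoints W (v.adicCompletion ℚ)),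
        Summit.BirchSwinnertonDyer.Rank1Residual.F1Sign2.IsHondaSystemAtTwo κ
          (closureEmb (K := ℚ) (v.adicCompletion ℚ)) W (W.frobeniusTrace 2) g cneg c ∧
        (∀ [NeZero (W.conductorNorm ℤ)] (f : CuspForm (Gamma0 (W.conductorNorm ℤ)) 2),
            IsNewformOf W f → ∀ (ϖ : ℚ), (ϖ : ℝ) * W.realPeriodRat = plusPeriod f →
          ∀ (Ls Lf : IwasawaAlgebra 2), IsSprungPair f 2 (W.frobeniusTrace 2) Ls Lf →
          ∀ [ContinuousSMul ℤ_[2] (W.tateModule 2)] [Module.Free ℤ_[2] (W.tateModule 2)]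
            [Module.Finite ℤ_[2] (W.tateModule 2)] (I : Kato2004.IwasawaH1Data W 2 κ γ)
            (L : letI := moduleOfGenerator κ (closureEmb (K := ℚ) (v.adicCompletion ℚ)) W hg
              I.H →ₗ[IwasawaAlgebra 2] (localTowerPointsOfEmb κ (closureEmb (K := ℚ) (v.adicCompletion ℚ)) W →+ ℤ_[2])),
            (∀ (x : I.H) (n k : ℕ) (Q : localPoints W (v.adicCompletion ℚ))
                (hQ : Q ∈ localLayerPointsOfEmb κ (closureEmb (K := ℚ) (v.adicCompletion ℚ)) W n),
                PadicInt.toZModPow k (L x ⟨Q, localLayerPointsOfEmb_le_localTowerPointsOfEmb κ _ W n hQ⟩) =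
                  CyclotomicLayer.tatePairingPk W κ v n k (I.proj n x) ⟨Q, hQ⟩) →
          ∀ (J : letI := moduleOfGenerator κ (closureEmb (K := ℚ) (v.adicCompletion ℚ)) W hg
              (localTowerPointsOfEmb κ (closureEmb (K := ℚ) (v.adicCompletion ℚ)) W →+ ℤ_[2]) →ₗ[IwasawaAlgebra 2]
                IwasawaAlgebra 2 × IwasawaAlgebra 2),
            (∀ w, IsColemanPair κ (closureEmb (K := ℚ) (v.adicCompletion ℚ)) W (W.frobeniusTrace 2) g c w (J w).1 (J w).2) →
            ∃ (Z : Submodule (IwasawaAlgebra 2) I.H) (G : IwasawaAlgebra 2),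
              (∃ z ∈ Z, (J (L z)).2 = G) ∧
              iwasawaToPowerSeries 2 G = PowerSeries.C (ϖ : ℚ_[2]) * iwasawaToPowerSeries 2 Lf ∧
              (∃ s₀ : I.H, Z = Submodule.span (IwasawaAlgebra 2) {s₀} ∧
                ∀ 𝔭 : PrimeSpectrum (IwasawaAlgebra 2), 𝔭.asIdeal.height = 1 →
                  PowerSeries.C (2 : ℤ_[2]) ∉ 𝔭.asIdeal →
                  ∃ (M : IwasawaAlgebra 2) (s : I.H), M ∉ 𝔭.asIdeal ∧
                    Literature.NumberTheory.EllipticCurves.Kato2004.IsEulerSystemClassTwo W hκ I s ∧ s ≠ 0 ∧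
                    M • s₀ = s))

/-- **v2.20 glue — THE F1♭ FOLD: the ♭ zeta package gives the (B)-form (8)-block `FlatCKPackageAtTwo`**, ONE `exact` of the landed helper ★★
`SSFlatFold.flatCKPackage_of_flatZetaPackage` (LEAD ss-1 GEN 26; its hypothesis text = `FlatZetaPackageAtTwo` and its conclusion text = `FlatCKPackageAtTwo`, both VERBATIM):
the pin `I` (`Kato2004.nonempty_iwasawaH1Data_holds`), `L := pairFun` (★ p830262), the joint Coleman family `J` (`OddBlindNF.exists_linearMap_isColemanPair_of_traces`), `Col♭` onto
(`SSFlatEC.flat_surjective_rat`), the contract `toX` (★ p831519), the key-`γ⁻¹` fine datum `Y` (`Kato2004.fineSelmerDualData_exists_involTwist`) and the transpose `δ`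
(`SharpFlatSelmerDualData.exists_linearMap_toFineDual'`) are tree constructions; the four inclusions are T-ORTH ★★ p833066 · T-LIM ★★ p834233 via ★ p833046 · (δ̄) · T-δ ★★ p833047,
packaged on `P := ⊤` by `SSFlatPT.exists_exact_and_exact_of_inclusions` (★ p833046), which also transports F3a.  No sorry of its own.
[cite: Sprung2012, Def. 7.9, Def. 7.11 (p. 1503), Prop. 7.19 (p. 1505)] [cite: Kobayashi2003, (7.17)–(7.21) (p. 12)] [cite: Kato2004Asterisque, §12.2 (p. 220), §17.13 (p. 279)] -/
theorem flatCKPackageAtTwo_of_flatZetaPackage (h : FlatZetaPackageAtTwo) : FlatCKPackageAtTwo :=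
  Summit.BirchSwinnertonDyer.BirchSwinnertonDyer.Theorems.SSFlatFold.flatCKPackage_of_flatZetaPackage h

open Field Literature.NumberTheory.EllipticCurves.Module Literature.NumberTheory.EllipticCurves.Kato2004
  Literature.NumberTheory.EllipticCurves.Kato2004.EulerSystemValues Literature.NumberTheory.EllipticCurves.FormalGroupChart
  Summit.BirchSwinnertonDyer.Rank1Residual.Additive Summit.BirchSwinnertonDyer.Rank1Residual.Additive.PadicCyclotomicTower
  Summit.BirchSwinnertonDyer.Rank1Residual.Additive.BallEval Summit.BirchSwinnertonDyer.Rank1Residual.F1Sign2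
  Summit.BirchSwinnertonDyer.BirchSwinnertonDyer.Theorems.SignedKatoOffTwo.LocalTwo
  Summit.BirchSwinnertonDyer.BirchSwinnertonDyer.Theorems.SignedKatoOffTwo
  Summit.BirchSwinnertonDyer.BirchSwinnertonDyer.Theorems.SignedKatoOffTwo.KatoBK
  Summit.BirchSwinnertonDyer.BirchSwinnertonDyer.Theorems.SSFlatERL in
/-- Statement of `stub_flatPackage` (v2.21, LEAD ss-1 GEN 26 on director (1009)(b′)/(1016)(c); D-0182 (1024)(5)) — **(α) THE ♭ COLEMAN IMAGE OF THE GLOBAL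
IWASAWA COHOMOLOGY IS μ-PRIMITIVE AT `2`**: for every curve of the crux, the cyclotomic `(κ, γ)`, the place `v ∋ 2`, every local lift `g` of `γ`, and every
E0b-TYPE DATUM — Sprung's `2`-adic model Honda system with its logarithms and its transport to `ℚ_v`: the binder list and the clause conjunction of
★ p836268 `SSHondaTwo.isHondaSystemAtTwo_sprung_withLog` VERBATIM (they LOG-PIN `(cneg, c)`: no off-diagonal instance, t42 GEN 51 (R∀)) —, for every pin `I`,
every localisation `L` pinned by the Tate-pairing residues and every joint Coleman family `J` pinned by the Coleman values of `c` (pinned to EQUALITY: ★ p838373,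
Sprung Prop. 5.7): **`∃ e : I.H, (J (L e)).2 ∉ Ideal.span {C 2}`**,
i.e. `μ(Col♭_c(loc 𝐇¹(T₂E))) = 0`.  This is the MATH-BOUND of the supersingular block on the Kato side (director (1016)(c)): modulo print, (A)@2 and the lower half,
BSD₂ at good supersingular 2 in rank 0 along this line = ♭-primitivity of Kato's zeta line at (2); implied by IMC-equality at 2 with μ(L♭) = 0; decided by no census.
The rest of the former (8) (Honda system, F3, ZL2, `0 ≤ v₂(ϖ)`) is kernel modulo `stub_pub` (capstone ★★★ `SSFlatCap.flatZetaPackage_body_of_pinnedFlatImage`); the def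
body = the capstone's `hα` byte-for-byte. [cite: Kato2004Asterisque, Thm. 12.4, 12.5, §13.12–13.14] [cite: Sprung2012, Thm. 2.2, Prop. 5.7, Thm. 7.14] -/
def FlatColemanImagePrimitiveAtTwo : Prop :=
      ∀ (W : WeierstrassCurve ℚ) [W.IsElliptic] [W.IsGloballyMinimal],
      ¬ W.HasCM → W.analyticRank = 0 → GoodSS W 2 →
      ∀ (κ : ZpExtension ℚ 2) (γ : Field.absoluteGaloisGroup ℚ) (hκ : κ.IsCyclotomic),
        κ.IsTopGenerator γ → IsCyclotomicVariable 2 γ →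
      ∀ (v : HeightOneSpectrum (𝓞 ℚ)), (2 : 𝓞 ℚ) ∈ v.asIdeal →
      ∀ (g : Field.absoluteGaloisGroup (v.adicCompletion ℚ))
        (hg : κ.IsTopGenerator (resGalOfEmb (closureEmb (K := ℚ) (v.adicCompletion ℚ)) g)),
      ∀ (Φ : AlgebraicClosure ℚ_[2] ≃ₐ[ℚ] AlgebraicClosure (v.adicCompletion ℚ)) (φ : ℚ_[2] ≃+* v.adicCompletion ℚ)
      (_ : ∀ t : ℚ_[2], Φ (algebraMap ℚ_[2] (AlgebraicClosure ℚ_[2]) t) =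
        algebraMap (v.adicCompletion ℚ) (AlgebraicClosure (v.adicCompletion ℚ)) (φ t))
      (ι : AlgebraicClosure ℚ →ₐ[ℚ] AlgebraicClosure ℚ_[2])
      (_ : ∀ z, closureEmb (K := ℚ) (v.adicCompletion ℚ) z = Φ (ι z))
      (x : ℕ → ℚ_[2]) (y : ℕ → localPoints W ℚ_[2]) (σ : ℕ → absoluteGaloisGroup ℚ_[2]) (N : ℕ)
      (d₀ : ℕ → localPoints W ℚ_[2]) (cneg : localPoints W (v.adicCompletion ℚ)) (c : ℕ → localPoints W (v.adicCompletion ℚ)),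

      (x 0 = 1 ∧ (2 : ℚ_[2]) * x 1 = W.frobeniusTrace 2 ∧ ∀ k, (2 : ℚ_[2]) * x (k + 2) = W.frobeniusTrace 2 * x (k + 1) - x k) ∧
      (haveI := isIntegral_genFib_baseChange 2 ((integralModelInt W).map (Int.castRingHom ℤ_[2]))
        ∀ m, (toLoc ((genFibΩ_eq_baseChange ((integralModelInt W).map (Int.castRingHom ℤ_[2]))).trans
              (baseChange_twoAdicModel W))).symm (y m) ∈
            subfieldPoints (genFibΩ 2 ((integralModelInt W).map (Int.castRingHom ℤ_[2]))) (layer 2 m).toSubfield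
              coeffs_mem_layer ∧
          (toLoc ((genFibΩ_eq_baseChange ((integralModelInt W).map (Int.castRingHom ℤ_[2]))).trans
              (baseChange_twoAdicModel W))).symm (y m) ∈
            kernel (Valued.v (R := PadicAlgCl 2)) (genFibΩ 2 ((integralModelInt W).map (Int.castRingHom ℤ_[2]))) ∧
          ptLogΩ 2 ((integralModelInt W).map (Int.castRingHom ℤ_[2]))
            ((toLoc ((genFibΩ_eq_baseChange ((integralModelInt W).map (Int.castRingHom ℤ_[2]))).trans
              (baseChange_twoAdicModel W))).symm (y m)) =
            ∑ k ∈ Finset.range m, algebraMap ℚ_[2] (PadicAlgCl 2) (x k) * (zeta 2 (m - k) - 1)) ∧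
      (∀ m, ∀ τ ∈ stab 2 m, τ • y m = y m) ∧
      (∀ m, 1 ≤ m → σ m • zeta 2 m = (zeta 2 m)⁻¹) ∧
      ((N : ℤ) = 3 - W.frobeniusTrace 2 ∧ Odd N) ∧
      (∀ n, d₀ n = N • (y (n + 2) + σ (n + 2) • y (n + 2)) - 2 • y 1) ∧
      (∀ m, d₀ m ∈ localLayerPointsOfEmb κ ι W m) ∧
      cneg = WeierstrassCurve.Affine.Point.map (W' := W)
        (Φ : AlgebraicClosure ℚ_[2] →ₐ[ℚ] AlgebraicClosure (v.adicCompletion ℚ))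
        (show (W.baseChange (AlgebraicClosure ℚ_[2])).toAffine.Point from (-y 1)) ∧
      (∀ m, c m = WeierstrassCurve.Affine.Point.map (W' := W)
        (Φ : AlgebraicClosure ℚ_[2] →ₐ[ℚ] AlgebraicClosure (v.adicCompletion ℚ))
        (show (W.baseChange (AlgebraicClosure ℚ_[2])).toAffine.Point from d₀ m)) ∧
      IsHondaSystemAtTwo κ (closureEmb (K := ℚ) (v.adicCompletion ℚ)) W (W.frobeniusTrace 2) g cneg c  →
      ∀ [ContinuousSMul ℤ_[2] (W.tateModule 2)] (I : Kato2004.IwasawaH1Data W 2 κ γ)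
        (L : letI := moduleOfGenerator κ (closureEmb (K := ℚ) (v.adicCompletion ℚ)) W hg
          I.H →ₗ[IwasawaAlgebra 2] (localTowerPointsOfEmb κ (closureEmb (K := ℚ) (v.adicCompletion ℚ)) W →+ ℤ_[2])),
        (∀ (x : I.H) (n k : ℕ) (Q : localPoints W (v.adicCompletion ℚ))
            (hQ : Q ∈ localLayerPointsOfEmb κ (closureEmb (K := ℚ) (v.adicCompletion ℚ)) W n),
            PadicInt.toZModPow k (L x ⟨Q, localLayerPointsOfEmb_le_localTowerPointsOfEmb κ _ W n hQ⟩) =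
              CyclotomicLayer.tatePairingPk W κ v n k (I.proj n x) ⟨Q, hQ⟩) →
      ∀ (J : letI := moduleOfGenerator κ (closureEmb (K := ℚ) (v.adicCompletion ℚ)) W hg
          (localTowerPointsOfEmb κ (closureEmb (K := ℚ) (v.adicCompletion ℚ)) W →+ ℤ_[2]) →ₗ[IwasawaAlgebra 2]
            IwasawaAlgebra 2 × IwasawaAlgebra 2),
        (∀ w, IsColemanPair κ (closureEmb (K := ℚ) (v.adicCompletion ℚ)) W (W.frobeniusTrace 2) g c w (J w).1 (J w).2) →
        ∃ e : I.H, (J (L e)).2 ∉ Ideal.span {(PowerSeries.C (2 : ℤ_[2]) : IwasawaAlgebra 2)}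

/-- **v2.21 glue — THE F3 FOLD: (α) + `stub_pub` give the ♭ zeta package `FlatZetaPackageAtTwo`**, ONE `exact` of the capstone ★★★
`SSFlatCap.flatZetaPackage_body_of_pinnedFlatImage` (LEAD ss-1 GEN 26 over t42 GEN 52 C1/C2/C3a and tower-1 GEN 70 B1c/B1d): print inputs `hPub.1.1` (Kato (KZ) at 2),
`hPub.2.2.1.1` (Kato 12.4), `hPub.1.2` (Abbes–Ullmo); research input `h` = (α).  No sorry of its own.
[cite: Kato2004Asterisque, Thm. 12.4 (2), Thm. 12.5 (1)(4), §13.12–13.14] [cite: AgasheRibetStein2006, Thm. 2.5] -/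
theorem flatZetaPackageAtTwo_of_flatImage (hPub : PublishedInputsAtTwo) (h : FlatColemanImagePrimitiveAtTwo) : FlatZetaPackageAtTwo := by
  intro W _ _ hCM hr hss κ γ hκ hγ hγ' v hv g hg
  exact Summit.BirchSwinnertonDyer.BirchSwinnertonDyer.Theorems.SSFlatCap.flatZetaPackage_body_of_pinnedFlatImage hPub.1.1 hPub.2.2.1.1 hPub.1.2
    W hr hss κ γ hκ hγ hγ' v hv g hg (h W hCM hr hss κ γ hκ hγ hγ' v hv g hg)

/-- Statement of `stub_fineMu` (v2.12, T-84 / D-imc-84) — Coates–Sujatha statement (A) at `(E,2)` on every curve of the habitat: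
`μ(X₀(E/ℚ_∞)) = 0` for the `2`-primary FINE Selmer dual (`Rank1Residual.FineMuZeroAt W 2`: every pinned `FineSelmerDualData` that is
Λ-f.g. and torsion has `muInvariant 2 _ = 0`).  CONJECTURE class-wide; COROLLARY-OF-PRINT per certified row (odd class number of the cubic /
sextic field inside `ℚ(E[4])`: `Lim2017.thm35_at_two_fineSelmerDual_moduleFinite_of_classicalMuVanishes_of_le_divisionField_four` + Iwasawa 1956).
REPLACES v2.11's `MuFlatOfNonSurjAtTwo` (μ♭ = 0 on the non-surjective classes). [cite: CoatesSujatha2005, §3 statement (A)]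
[cite: Lim2017, Thm. 3.5] [cite: Wuthrich2006MRL, Lemma 1 and Thm. 2 (p. 715; odd p shape)] -/
def FineMuZeroOnHabitatAtTwo : Prop :=
      ∀ (W : WeierstrassCurve ℚ) [W.IsElliptic] [W.IsGloballyMinimal],
      ¬ W.HasCM → W.analyticRank = 0 → GoodSS W 2 →
        Literature.NumberTheory.EllipticCurves.Rank1Residual.FineMuZeroAt W 2

/-- Statement of `stub_oddFlatValueLaw` — v2.3 = v2.2 (REF1-AUDIT §389 R389a PIN) + LEAD ss-1 g17 R17a / REF1-AUDIT
§397 R397a (no existence conjunct; the twist's rank-`1` data are BINDERS): the odd blind VALUE LAW (P₋₂′) for the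
NAMED ♭ `2`-adic `L`-function, on the GENERIC ODD half.  GIVEN AS BINDERS (nothing existential): the crux curve `E = W`
(non-CM, `r_an = 0`, good supersingular at `2`, `w(E)·χ₈(N) = −1`); the newform `f` of `W` and its period ratio `ϖ`
(`ϖ·Ω_W = Ω⁺_f`); Sprung's pair `(L♯, L♭)` at `2` (`IsSprungPair`); the INTEGRAL AVATAR `G ∈ Λ = ℤ₂⟦T⟧` of `ϖ·L♭`
(`ι G = C(ϖ)·ι L♭` — the element `ξ·h` the tree's Kato half `SSFlatRoad.flatUpper_two_of_flatColemanKato{,_of_mu}` produces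
from stubs 2–3, with `ξ = char X♭ ∣ G`); a globally minimal `W₂ ≅ E^{(2)}` with `r_an(W₂) = 1`, TOGETHER WITH
(v2.3) `rank W₂(ℚ) = 1` and `#Ш(W₂)[2^∞] < ∞` as HYPOTHESES — the Gross–Zagier–Kolyvagin half, which the KERNEL discharges
from stub 1's published inputs (`nonTorsionPoint_of_GZK`, `hPub.2.1.2`); v2.2's conjunct «a non-torsion `P ∈ W₂(ℚ)` exists»
was a PUBLISHED theorem typed inside a beyond-print stub (LEAD ss-1 g17 F17.1 / R17a; REF1 §397 R397a) and is GONE, so a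
single future fact (P₋₂′) closes this stub as typed; the `Finite` binder makes `Nat.card #Ш(W₂)[2^∞]` below an honest
cardinality (R17c).  ASSERTED, for EVERY `ι` and every non-torsion `P ∈ W₂(ℚ)`:
`G(−2) ≠ 0 ∧ v₂ G(−2) = v₂ #Ш(W₂)[2^∞] + v₂ Tam(W₂) + 2·(ord₂ log_Ŵ₂(P) − v₂ [W₂(ℚ) : ℤP])` — the valuation shadow of the
`-an` laws 40B / 44A⁺ for `ϖ·L♭` at the blind character `ψ₂` (`T = −2`), BEYOND PRINT AT 2 (censuses 954/954 and C-imc-77: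
845/845 on census46, `v₂(m₂₁) = 1` on 1718/1718; REF1 §388/§397: the period normalisation `q` has `v₂(q) = 0` inside a
good-supersingular-at-2 isogeny class, so the class-invariance defect that killed 43A does not touch this valuation form;
`(ι, P)`-invariance: `ord₂ log − v₂ index` is scaling-invariant at rank `1`, torsion of `W₂(ℚ)` odd).  NOT asserted here — DERIVED in the kernel `bsdp_two_of_genericOdd` instead: the Kato-side
divisibility `ξ ∣ G` (stubs 2–3, tree Kato half), (K) for `ξ` (stub 2, tree EC♭), (K₋₂′) for `ξ` (K67-A), (P) at the trivial
character with the SIGN and the odd constant `c ∈ {1, 7}` (`L♭(0) = (−a₂²+2a₂+1)·[0]⁺_f`,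
`constantCoeff_flat_two_of_isSprungPair_of_isNewformOf`), `rank W₂ = 1 ∧ #Ш(W₂) < ∞` (GZK).  No `∃` over `ξ` or `L`:
REF1's diagonal witness `ξ = L` (K389.1–5) is unavailable.  Why it might fail: (P₋₂′) is unproved at `2` (its uniform
proof factors through a blind `2`-adic Gross–Zagier formula for `L♭` and the `2`-part of rank-1 BSD for the
additive-at-2 twist `W₂` — a TRANSFER, MEMO-imc §10.109-add2 (c)).  [cite: Sprung2017, Cor. 4.4, §1.1 (shape)]
[cite: Kobayashi2003, Thm. 1.2 (shape, odd p)] [cite: PerrinRiou1993Fourier, §3.4 (shape only)] -/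
def OddFlatBlindValueLawAtTwo : Prop :=
  ∀ (W : WeierstrassCurve ℚ) [W.IsElliptic] [W.IsGloballyMinimal],
    ¬ W.HasCM → W.analyticRank = 0 → GoodSS W 2 → W.rootNumber * ZMod.χ₈ (W.conductorNorm ℤ : ZMod 8) = -1 →
  ∀ [NeZero (W.conductorNorm ℤ)] (f : CuspForm (Gamma0 (W.conductorNorm ℤ)) 2), IsNewformOf W f →
  ∀ (ϖ : ℚ), (ϖ : ℝ) * W.realPeriodRat = plusPeriod f →
  ∀ (Ls Lf : IwasawaAlgebra 2), IsSprungPair f 2 (W.frobeniusTrace 2) Ls Lf →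
  ∀ (G : IwasawaAlgebra 2), iwasawaToPowerSeries 2 G = PowerSeries.C (ϖ : ℚ_[2]) * iwasawaToPowerSeries 2 Lf →
  ∀ (W₂ : WeierstrassCurve ℚ) [W₂.IsElliptic] [W₂.IsGloballyMinimal],
    (∃ C : WeierstrassCurve.VariableChange ℚ, C • W.quadraticTwist 2 = W₂) → W₂.analyticRank = 1 →
    W₂.mordellWeilRank = 1 → Finite (AddCommGroup.primaryComponent W₂.sha 2) →
    ∀ (ι : ℚ →+* ℚ_[2]) (P : (W₂.baseChange ℚ).toAffine.Point), ¬ IsOfFinAddOrder P →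
      evalAt (-2 : ℤ_[2]) G ≠ 0 ∧
      ((evalAt (-2 : ℤ_[2]) G).valuation : ℤ) =
        (padicValNat 2 (Nat.card (AddCommGroup.primaryComponent W₂.sha 2)) : ℤ) +
          (padicValNat 2 W₂.tamagawaProduct : ℤ) +
          2 * (padicLogOrd W₂ 2 ι P - (padicValNat 2 (AddSubgroup.zmultiples P).index : ℤ))

/-- Statement of `stub_lowerOffGenericOdd` — Miller's LOWER half `ord₂ #Ш_an ≤ ord₂ #Ш` OFF the generic odd locus:
the EVEN half `w(E)·χ₈(N) ≠ −1` (= `+1` for odd `N`; the intended tool is the tree's rank-0 blind control at `ψ₂`,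
`Supersingular.BlindControlTwo.bsdp_two_of_oneDivisibility_of_blindControl` with `BlindDescentCertificate`, whose inputs
— Sel♭ control + the EVEN blind value law (P₋₂) — are NOT claimed here, and which exists ONLY where `r_an(E^{(2)}) = 0`:
census C-imc-76, N < 7813: 301 classes; on the 117 classes with `r_an(E^{(2)}) = 2` there is NO blind certificate of
either package — named residual R-imc-76), together with the thin DEEP-ODD set
(`w·χ₈(N) = −1` but no globally minimal model of `E^{(2)}` has `r_an = 1`, i.e. `r_an(E^{(2)}) ≥ 3`; no tool known: the
blind character is then a zero of `char X♭`, S67-VAN; EMPTY for N < 7813 by C-imc-76).  Named separately per (655) (iii); why it might fail: it is the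
whole lower half on half the crux.  v2.17 (W-88, director (851)/(884)(b)): AND OFF THE TWIST-PINCH LOCUS — a second escape clause, the curried
negation of «some avatar `G ∈ Λ` of `ϖ·L♭` (binders: the newform `f`, `ϖ` with `ϖ·Ω_W = Ω⁺_f`, a Sprung pair `(L♯, L♭)` at `2`, `ι G = C(ϖ)·ι L♭`) has
the TABLE BITS `μ(G) = 0 ∧ λ(G) ≤ 1` and some `ℚ`-model `W₂ ≅ E^{(2)}` has `corank_{ℤ₂} Sel_{2^∞}(W₂/ℚ) ≥ 2»: on that locus the KERNEL closes `BSDp W 2`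
from stubs 1–3 alone (`bsdp_two_of_twistPinch`: K87-C ★★ p827897 gives the blind zero `(T+2) ∣ char X♭`, -imc's pinch ★★ p829313 / ★ p830132
concludes; census R-imc-76: the `λ♭ = 1` rows of the even half with `r_an(E^{(2)}) = 2`).  A WEAKENING of v2.16's statement (one more hypothesis).
v2.19 (W-92, -imc D-imc-91, director (935)(c)): AND OFF THE UNIT LOCUS — a third escape clause «`#Ш_an` is a rational of 2-adic valuation `≥ 1`»: when
`v₂ #Ш_an ≤ 0` Miller's lower half is trivial and the kernel closes `BSDp W 2` from the UPPER half (stubs 1–3) alone (census: vacuous on X5@2-ss, 757 = 757;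
but 838/859 · 285/301 · 117/117 of the generic-odd / even / R-imc-76 classes below 7813 are unit rows, and the pinch locus lies inside the unit locus).
[cite: Miller2011LMS, §1 and Def. 1.1] [cite: Sprung2017, Cor. 4.11] -/
def LowerBoundOffGenericOddAtTwo : Prop :=
  ∀ (W : WeierstrassCurve ℚ) [W.IsElliptic] [W.IsGloballyMinimal],
    ¬ W.HasCM → W.analyticRank = 0 → GoodSS W 2 →
    (W.rootNumber * ZMod.χ₈ (W.conductorNorm ℤ : ZMod 8) = -1 →
      ∀ (W₂ : WeierstrassCurve ℚ) [W₂.IsElliptic] [W₂.IsGloballyMinimal],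
        (∃ C : WeierstrassCurve.VariableChange ℚ, C • W.quadraticTwist 2 = W₂) → W₂.analyticRank ≠ 1) →
    (∀ [NeZero (W.conductorNorm ℤ)] (f : CuspForm (Gamma0 (W.conductorNorm ℤ)) 2), IsNewformOf W f →
      ∀ (ϖ : ℚ), (ϖ : ℝ) * W.realPeriodRat = plusPeriod f →
      ∀ (Ls Lf : IwasawaAlgebra 2), IsSprungPair f 2 (W.frobeniusTrace 2) Ls Lf →
      ∀ (G : IwasawaAlgebra 2), iwasawaToPowerSeries 2 G = PowerSeries.C (ϖ : ℚ_[2]) * iwasawaToPowerSeries 2 Lf →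
        Summit.BirchSwinnertonDyer.Rank1Residual.X1.MuLambda.mu G = 0 →
        Summit.BirchSwinnertonDyer.Rank1Residual.X1.MuLambda.lam G ≤ 1 →
      ∀ (W₂ : WeierstrassCurve ℚ) [W₂.IsElliptic],
        (∃ C : WeierstrassCurve.VariableChange ℚ, C • W.quadraticTwist 2 = W₂) → W₂.selmerCorank 2 ≤ 1) →
    (∀ q : ℚ, shaAn W = (q : ℂ) → 1 ≤ padicValRat 2 q) →
    MissingLowerBoundAt W 2

/-! ## §6 The five stubs (the ONLY `sorry`s of this file; slot 5 retired in v2.11; slot 4 split in v2.13; slot 4a closed by name in v2.14; v2.16: stub 2 split AND slot 4b closed by name; v2.17: (C1) landed by name, COUNT♭ by name, W-88 pinch wired; v2.20: (8)∃ + F1♭ folded by name; v2.21: F3 + ZL2 folded by name — stub 2 = (α)) -/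

/-- stub 1/5 — PUBLISHED inputs by fact name (closed by citation; v2.14: + CT layer pairing + Kato 14.3 (1) layer form; v2.16: + Kato 13.4 (2) at 2 + Greenberg 1989 §3 Cor. 2; v2.21: + Kato (KZ) at 2 + Abbes–Ullmo 1996 Thm. A). -/
theorem stub_pub : PublishedInputsAtTwo := by
  sorry

/- stub `stub_hondaAtTwo : Summit.BirchSwinnertonDyer.Rank1Residual.F1Sign2.HondaSystemAtTwoExists` (v2.16, (C1)) RETIRED in v2.17: LANDED BY NAME —
★★★ p829207 `OddBlindStubs.stub_hondaAtTwo := SSHondaTwo.hondaSystemAtTwoExists` (tower-1 GEN 66 ★★★ p829135: Sprung 2012 Thm. 2.2 at `p = 2`, all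
`a₂ ∈ {0, ±2}`, unconditional); the registry row flipped `gate:landed` 2026-08-31T17:05:56Z.  v2.20 (B): no longer consumed — (8) provides its own Honda system. -/

/-- stub 2/5 (v2.21: (α) — THE F3 FOLD BY NAME; v2.20 ♭ zeta package; v2.18 (R1); v2.17) — μ-primitivity of the ♭ Coleman image of `𝐇¹_Γ(T₂W)` for the log-pinned
Sprung–Honda system: `∃ e : I.H, Col♭(L e) ∉ 2Λ`; beyond print at 2 and THE research conjunct of the Kato side (everything else of the former (8) is kernel modulo
`stub_pub`: capstone ★★★ `SSFlatCap.flatZetaPackage_body_of_pinnedFlatImage`, doors ★★★ p838889 / ★★★ p838609, core ★★ p838688, F1♭ ★★ p837143). -/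
theorem stub_flatPackage : FlatColemanImagePrimitiveAtTwo := by
  sorry

/- stub 2 of v2.7–v2.14 (`stub_allFlatData : UniformFlatHondaDataAtTwo`) RETIRED in v2.16 (director (844)): SPLIT into `stub_hondaAtTwo` + `stub_flatPackage`, with
Kato's Euler-system bound at the primes `∌ 2` fed BY NAME from `stub_pub`; the nine-conjunct package is REBUILT in the kernel by `uniformFlatHondaDataAtTwo_of_pub` (§7). -/

/-- stub 3/5 (4/6 in v2.16; v2.12) — statement (A) at `(E,2)` on the habitat (`μ(X₀(E/ℚ_∞)) = 0`; conjecture class-wide, certified per row). -/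
theorem stub_fineMu : FineMuZeroOnHabitatAtTwo := by
  sorry

/- stub 4a of v2.13 (`stub_classicalNF : ClassicalNoFiniteSubmoduleSSAtTwo`, h11) RETIRED in v2.14 (director (830)(iii)): CLOSED BY NAME modulo print
by `classicalNoFiniteSubmoduleSSAtTwo_of_pub` (§7) = ★★ p823354 fed by the two new `stub_pub` conjuncts (CT layer pairing, Kato 14.3 (1)) and the G4 assembly. -/

/- stub 4/6 of v2.14 (`stub_flatKernelCyclic : FlatKernelCyclicHondaAtTwo`, h13) RETIRED in v2.16 (folding v2.15, director (839)/(844)(c)): CLOSED BY NAME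
modulo print by `flatKernelCyclicHondaAtTwo_of_pub` (§7) = t42 GEN 45 ★ p825964 `OddBlindNF.flatKernelCyclic_honda_two_of_h1IwFree` ∘ tower-1 GEN 65 ★★ p827715
`OddBlindNF.h1IwPointsModelFree_two_of_greenberg1989` (K86 from Greenberg 1989 §3 Cor. 2 = `stub_pub`'s new conjunct + Coates–Greenberg 1996 Cor. 3.2 = the tree THEOREM
`CoatesGreenberg1996.H1_goodModelKernel_trivial_holds`). -/

/- slot 4 of v2.5–v2.12 (`stub_NFflat : FlatNoFiniteSubmoduleAtTwo`) RETIRED in v2.13: replaced by its Honda-guarded form NF♭_H, DERIVED from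
`stub_classicalNF` + `stub_flatKernelCyclic` by `flatNoFiniteSubmoduleHondaAtTwo_of_classical_of_kernelCyclic` and fed to the composition as
`flatBlindNoCotorsionHondaAtTwo_of_flatNoFiniteSubmoduleHondaAtTwo (…)` (K67-NF_H). -/

/- slot 5 (`stub_CD : FlatBlindControlCardHondaAtTwo`, v2.2–v2.10.1) RETIRED in v2.11; from v2.12 fed BY NAME by the UNCONDITIONAL tree theorem
`OddBlindLocal.flatBlindControlCardHondaAtTwo_holds` (p822193; v2.11 used `…_of_PT hPub.2.2.2.2`) in `SupersingularRankZeroAtTwo_of` — CDC_H CLOSED IN KERNEL. -/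

/-- stub 4/5 (5/6 in v2.16) — v2.2 PIN (REF1 §389 R389a): the odd blind VALUE LAW (P₋₂′) for the NAMED integral ♭ `2`-adic `L`-function
`G = ϖ·L♭ ∈ Λ` on the generic odd half (+ a non-torsion point of the twist); lower-of-door transport, beyond print at 2. -/
theorem stub_oddFlatValueLaw : OddFlatBlindValueLawAtTwo := by
  sorry

/-- stub 5/5 (6/6 in v2.16) — Miller's lower half off the generic odd locus (even half + deep-odd set), off the twist-pinch locus (v2.17, W-88) and off the Ш_an-unit locus (v2.19, W-92). -/
theorem stub_lowerOffGenericOdd : LowerBoundOffGenericOddAtTwo := by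
  sorry

/-! ## §7 Kernel glue and the composition concluding the crux BY NAME -/

/-- **v2.14: slot 4a (h11, classical NF at good supersingular `2`) BY NAME, modulo print.** Tower-1's ★★ p823354
`OddBlindNF.classicalNoFiniteSubmodule_goodSS_two_of_casselsTateLayerPairing_of_corankBounded` (Hachimori–Matsuno / Matsuno 2003 Prop. 4.1 /
Kitajima–Otsuki Thm. 4.5 shape with BOUNDED corank in place of `Λ`-torsion) fed by `stub_pub`'s (hCT) Cassels–Tate layer pairing and by the
bounded-corank theorem `Summit.BirchSwinnertonDyer.BirchSwinnertonDyer.Theorems.TowerHaMa.selmerCorank_cyclotomicLayers_bounded_of_goodSS_two` (tower-1 GEN 64: Rohrlich + Kato Cor. 14.3 (1) (hKato, `stub_pub`) +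
the LEAD's ★★ p825069/p825270 tower-corank glue) and modularity (`hPub.2.1.1`).  `unfold; exact`; no sorry of its own.
[cite: HachimoriMatsuno2000, Theorem (p. 2540)] [cite: Kato2004Asterisque, Cor. 14.3 (1) (p. 235)] [cite: KitajimaOtsuki2018, Thm. 4.5] -/
theorem classicalNoFiniteSubmoduleSSAtTwo_of_pub (hPub : PublishedInputsAtTwo) : ClassicalNoFiniteSubmoduleSSAtTwo := by
  unfold ClassicalNoFiniteSubmoduleSSAtTwo
  exact Summit.BirchSwinnertonDyer.BirchSwinnertonDyer.Theorems.OddBlindNF.classicalNoFiniteSubmodule_goodSS_two_of_casselsTateLayerPairing_of_corankBounded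
    hPub.2.2.2.1 (Summit.BirchSwinnertonDyer.BirchSwinnertonDyer.Theorems.TowerHaMa.selmerCorank_cyclotomicLayers_bounded_of_goodSS_two hPub.2.2.2.2.1 hPub.2.1.1)

/-- (v2.16-imc) If `s = M • s₀` then `M·(Λ s₀) ⊆ Λ s`. [folklore] -/
theorem smul_mem_span_of_smul_eq {R : Type*} [CommRing R] {H : Type*} [AddCommGroup H] [Module R H]
    {M : R} {s₀ s : H} (hMs : M • s₀ = s) :
    ∀ x ∈ Submodule.span R {s₀}, M • x ∈ Submodule.span R {s} := by
  intro x hx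
  obtain ⟨a, rfl⟩ := Submodule.mem_span_singleton.mp hx
  exact Submodule.mem_span_singleton.mpr ⟨a, by rw [← hMs, smul_smul, smul_smul, mul_comm]⟩

/-- (v2.16-imc) If `s = M • s₀` then `M·(Λ s) ⊆ Λ s₀`. [folklore] -/
theorem smul_mem_span_of_eq_smul {R : Type*} [CommRing R] {H : Type*} [AddCommGroup H] [Module R H]
    {M : R} {s₀ s : H} (hMs : M • s₀ = s) :
    ∀ x ∈ Submodule.span R {s}, M • x ∈ Submodule.span R {s₀} := by
  intro x hx
  obtain ⟨b, rfl⟩ := Submodule.mem_span_singleton.mp hx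
  exact Submodule.mem_span_singleton.mpr ⟨M * b * M, by rw [← hMs, smul_smul, smul_smul, mul_assoc]⟩

/-- (v2.16-imc) **Local lengths along the zeta line**: if `M ∉ 𝔭` and `M • s₀ = s` then `ℓ_𝔭(H/Λ s) = ℓ_𝔭(H/Λ s₀)` — Kato's
multiplier is invisible at the primes it avoids (§13.12–13.14; tree `Kato2004.lengthAt_quotient_eq_of_localized_eq_submodule`).
[cite: Kato2004Asterisque, §13.12–13.14 (pp. 231–234)] -/
theorem lengthAt_quotient_span_eq_of_smul_eq {H : Type*} [AddCommGroup H] [Module (IwasawaAlgebra 2) H]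
    {M : IwasawaAlgebra 2} {s₀ s : H} (𝔭 : PrimeSpectrum (IwasawaAlgebra 2)) (hM : M ∉ 𝔭.asIdeal)
    (hMs : M • s₀ = s) :
    Literature.NumberTheory.EllipticCurves.Module.lengthAt (IwasawaAlgebra 2) (H ⧸ Submodule.span (IwasawaAlgebra 2) {s}) 𝔭 =
      Literature.NumberTheory.EllipticCurves.Module.lengthAt (IwasawaAlgebra 2)
        (H ⧸ Submodule.span (IwasawaAlgebra 2) {s₀}) 𝔭 :=
  Literature.NumberTheory.EllipticCurves.Kato2004.lengthAt_quotient_eq_of_localized_eq_submodule 𝔭 hM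
    (smul_mem_span_of_smul_eq hMs) (smul_mem_span_of_eq_smul hMs)

/-- **v2.20 ((B), pen RC-835 hunk 3): the old stub 2 `UniformFlatHondaDataAtTwo` REBUILT in the kernel from `stub_pub` + the (B)-form CK-package** (v2.16 director (844) shape):
`g` from `hκ.exists_isTopGenerator_resGalOfEmb_adicCompletion`, the Honda system `(cneg, c)` PROVIDED by (8), conjuncts (2)–(5) from its clauses by ★ p827135's public lemmas
(`SSFlatLocalData.not_two_dvd_sq_sub` / `inj_of_inj_zsmul` / `sat_of_sat_zsmul` + `frobeniusTrace_two_eq_zero_or`), COUNT♭ by ★ p829198 `SSFlatRoad.flatCount_two_of_isHondaSystemAtTwo`,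
F1♭, F3 and ZL2 from the package; Kato's bound F4rat at each height-one `𝔭 ∌ 2` BY NAME from `stub_pub`'s Kato 13.4 (2)-at-2 conjunct at the local Euler class `s = M • s₀`,
`M ∉ 𝔭` (`lengthAt_quotient_span_eq_of_smul_eq`); the `T₂W` structure instances are the tree theorems `module_free_tateModule_holds` / `module_finite_tateModule_holds`.  The (C1)
door ★★★ p829207 is no longer consumed.  No sorry of its own. [cite: Kato2004Asterisque, Thm. 13.4 (2) (p. 226)] [cite: Sprung2012, Thm. 2.2, Lemma 7.9] -/
theorem uniformFlatHondaDataAtTwo_of_pub (hPub : PublishedInputsAtTwo) (hFP : FlatCKPackageAtTwo) :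
    UniformFlatHondaDataAtTwo := by
  intro W _ _ hCM hr hss κ γ hκ hγ hγ' v hv
  obtain ⟨g, hg⟩ := hκ.exists_isTopGenerator_resGalOfEmb_adicCompletion v hv
  obtain ⟨cneg, c, hHonda, hCK'⟩ := hFP W hCM hr hss κ γ hκ hγ hγ' v hv g hg
  obtain ⟨hcneg, hc, hc0, _h01, hTr, hinj, hsat, _hgen⟩ := id hHonda
  have hodd : ¬ (2 : ℤ) ∣ W.frobeniusTrace 2 ^ 2 - 2 * W.frobeniusTrace 2 - 1 :=
    Summit.BirchSwinnertonDyer.BirchSwinnertonDyer.Theorems.SSFlatLocalData.not_two_dvd_sq_sub _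
      (Summit.BirchSwinnertonDyer.Rank1Residual.Supersingular.frobeniusTrace_two_eq_zero_or W hss.1 hss.2)
  refine ⟨g, c, hg, hc, hTr,
    Summit.BirchSwinnertonDyer.BirchSwinnertonDyer.Theorems.SSFlatLocalData.inj_of_inj_zsmul W _ hcneg hodd hc0 hinj,
    Summit.BirchSwinnertonDyer.BirchSwinnertonDyer.Theorems.SSFlatLocalData.sat_of_sat_zsmul W _ hcneg hodd hc0 hsat,
    ⟨cneg, hHonda⟩,
    Summit.BirchSwinnertonDyer.BirchSwinnertonDyer.Theorems.SSFlatRoad.flatCount_two_of_isHondaSystemAtTwo W hss κ hγ hv hg hHonda, ?_⟩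
  intro _ f hf ϖ hϖ Ls Lf hSP D _
  haveI : Module.Free ℤ_[2] (W.tateModule 2) := module_free_tateModule_holds W 2
  haveI : Module.Finite ℤ_[2] (W.tateModule 2) := module_finite_tateModule_holds W 2
  obtain ⟨I, Y, P, loc, toX, δ, Z, G, h1, h2, h3, h4, s₀, hZ, hloc⟩ := hCK' f hf ϖ hϖ Ls Lf hSP D
  refine ⟨I, Y, P, loc, toX, δ, Z, G, h1, h2, h3, h4, fun 𝔭 h𝔭 h2𝔭 ↦ ?_⟩
  obtain ⟨M, s, hM, hs, hs0, hMs⟩ := hloc 𝔭 h𝔭 h2𝔭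
  rw [hZ, ← lengthAt_quotient_span_eq_of_smul_eq 𝔭 hM hMs]
  exact hPub.2.2.2.2.2.1 W hCM κ γ hκ hγ I Y s hs hs0 𝔭 h𝔭 h2𝔭

/-- **v2.16 (folding v2.15): slot 4b (h13, the kernel of `X ↠ X♭` is CYCLIC for Honda-legal data) BY NAME, modulo print** (director (839)/(844)(c)).
t42 GEN 45's ★ p825964 `OddBlindNF.flatKernelCyclic_honda_two_of_h1IwFree` (the Kummer injection `Sel_∞ ⧸ Sel♭ ↪ Λ^∨` + Pontryagin biduality + `Ker Col♭ = Λ∙z♭`)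
takes K86 `H1IwPointsModelFreeAtTwo` (Sprung's points model of `H¹_Iw(ℚ₂, T₂E)` is `Λ`-free of rank `2`) as its ONE displayed input; tower-1 GEN 65's ★★ p827715
`OddBlindNF.h1IwPointsModelFree_two_of_greenberg1989 (hGr) (hCG)` proves K86 from Greenberg 1989 §3 Cor. 2 (`hGr`, `stub_pub`'s new conjunct) and
Coates–Greenberg 1996 Cor. 3.2 (`hCG`, the tree THEOREM `CoatesGreenberg1996.H1_goodModelKernel_trivial_holds` — cited as a theorem, not added to `stub_pub`).
`unfold; exact`; no sorry of its own. [cite: Greenberg1989, §3 Corollary 2 (p. 112)] [cite: CoatesGreenberg1996, Cor. 3.2] [cite: KitajimaOtsuki2018, (4.2) and Prop. 3.32] -/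
theorem flatKernelCyclicHondaAtTwo_of_pub (hPub : PublishedInputsAtTwo) : FlatKernelCyclicHondaAtTwo := by
  unfold FlatKernelCyclicHondaAtTwo
  exact Summit.BirchSwinnertonDyer.BirchSwinnertonDyer.Theorems.OddBlindNF.flatKernelCyclic_honda_two_of_h1IwFree
    (Summit.BirchSwinnertonDyer.BirchSwinnertonDyer.Theorems.OddBlindNF.h1IwPointsModelFree_two_of_greenberg1989 hPub.2.2.2.2.2.2
      Literature.NumberTheory.EllipticCurves.CoatesGreenberg1996.H1_goodModelKernel_trivial_holds)

/-- Valuations on `ℤ₂` from norms (converse of `norm_eq_norm_of_valuation_eq`). [folklore] -/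
theorem valuation_eq_of_norm_eq {x y : ℤ_[2]} (hx : x ≠ 0) (hy : y ≠ 0) (h : ‖x‖ = ‖y‖) :
    x.valuation = y.valuation := by
  rw [PadicInt.norm_eq_zpow_neg_valuation hx, PadicInt.norm_eq_zpow_neg_valuation hy] at h
  have h2 := zpow_right_injective₀ (by norm_num : (0 : ℝ) < ((2 : ℕ) : ℝ)) (by norm_num : ((2 : ℕ) : ℝ) ≠ 1) h
  have h3 : (x.valuation : ℤ) = (y.valuation : ℤ) := by
    have := neg_inj.mp h2
    exact_mod_cast this
  exact_mod_cast h3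

/-- `v₂(−x) = v₂(x)` on `ℤ₂`. [folklore] -/
theorem valuation_neg_eq (x : ℤ_[2]) : (-x).valuation = x.valuation := by
  by_cases hx : x = 0
  · simp [hx]
  · exact valuation_eq_of_norm_eq (neg_ne_zero.mpr hx) hx (norm_neg x)

/-- **v2.3 (LEAD ss-1 g17 R17a; REF1-AUDIT §397 K397.4a — REF1's proof verbatim): the Gross–Zagier EXISTENCE half** — a
non-torsion point of the rank-`1` twist, with an embedding `ι : ℚ →+* ℚ_[2]` — from stub 1's published inputs ALONE
(GZK: `r_an(W₂) = 1 ⟹ rank W₂(ℚ) = 1`, then `exists_not_isOfFinAddOrder_of_one_le_finrank` and `W₂.baseChange ℚ = W₂`).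
This is why stub 6 carries no `∃`-conjunct: a published theorem is never typed inside a beyond-print stub. [folklore] -/
theorem nonTorsionPoint_of_GZK (hPub : PublishedInputsAtTwo) (W₂ : WeierstrassCurve ℚ) [W₂.IsElliptic]
    [W₂.IsGloballyMinimal] (han : W₂.analyticRank = 1) :
    ∃ (ι : ℚ →+* ℚ_[2]) (P : (W₂.baseChange ℚ).toAffine.Point), ¬ IsOfFinAddOrder P := by
  have hG2 := hPub.2.1.2 W₂ han.le
  have hr₂ : W₂.mordellWeilRank = 1 := hG2.1.trans han
  have hbc : W₂.baseChange ℚ = W₂ := by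
    show W₂.map (algebraMap ℚ ℚ) = W₂
    rw [Subsingleton.elim (algebraMap ℚ ℚ) (RingHom.id ℚ), WeierstrassCurve.map_id]
  rw [hbc]
  have hr' : 1 ≤ Module.finrank ℤ W₂.toAffine.Point := by
    have h1 : 1 ≤ W₂.mordellWeilRank := hr₂.ge
    unfold WeierstrassCurve.mordellWeilRank at h1
    convert h1
  obtain ⟨P, hP⟩ := exists_not_isOfFinAddOrder_of_one_le_finrank hr'
  exact ⟨algebraMap ℚ ℚ_[2], P, hP⟩

/-- **KERNEL of the generic odd half (v2.3, sorry-free): the PINNED ♭ datum `(ξ, ±G, c)` and Miller's `BSD(E,2)`.**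
From `stub_pub`: the newform `f` of `W` and the rational period ratio `ϖ > 0` (modularity datum), GZK for `W₂`
(`rank W₂ = 1`, `Ш(W₂)` finite).  From stub 2 (`UniformFlatDataAtTwo`) at the cyclotomic `(κ, γ)` and `v ∋ 2`: Sprung's
local ♭ data `(g, c)`, COUNT♭ and CK♭; a ♭ dual datum `D♭` (`nonempty_sharpFlatSelmerDualData`, f.g. by `moduleFinite`);
Sprung's pair at `2` (`exists_isSprungPair_two`).  The tree's Kato half `SSFlatRoad.flatUpper_two_of_flatColemanKato`
(v2.12: ONE branch, `SSFlatRoad.flatUpper_two_of_flatColemanKato_of_fineMu`, fed by statement (A) at `(E,2)` = stub 3) gives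
`X♭` torsion, `char X♭ = (ξ)` and `G = ξ·h` with `ι G = C(ϖ)·ι L♭` — so `ξ ∣ G`, the UPPER divisibility BY NAME; the tree's
`SSFlatRoad.flatEulerChar_two` gives (K) for `ξ`; `constantCoeff_flat_two_of_isSprungPair_of_isNewformOf` gives
`G(0) = c♭·t`, `t = L(E,1)/Ω_E`, `c♭ = −a₂²+2a₂+1 ∈ {1, −7}`, whence (P) for `L' := G` (`c = 1`) or `L' := −G` (`c = 7`);
K67-A (EC by name + NF♭_H (v2.14: `classicalNoFiniteSubmoduleSSAtTwo_of_pub hPub` ∘ `stub_flatKernelCyclic`) + CDC_H by name (`OddBlindLocal.flatBlindControlCardHondaAtTwo_holds`),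
`flatBlindRegulatorCharacteristicHondaAtTwo_of`) gives (K₋₂′) for `ξ`; GZK (stub 1) gives
`rank W₂ = 1`, `Ш(W₂)[2^∞]` finite and a non-torsion point (`nonTorsionPoint_of_GZK`, v2.3 R17a); stub 6 gives (P₋₂′) for `G`
at that point (sign-insensitive: `valuation_neg_eq`); then the blind certificate and the tree lever
(`bsdp_two_of_oneDivisibility_of_oddBlindControl`).  v2.18 (R1, director (905)(b)(ii)): the Kato half is read on the CONTRAGREDIENT (print)
♭ dual `D′` of key `γ⁻¹` (★★ p831246 `SSFlatRoad.flatUpper_two_of_flatColemanKato_of_fineMu_contra`: `char D′ = (ξ′)`, `ι₂(ξ′·h) = C(ϖ)·ι₂ L♭`), and the line's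
datum is its `ι`-image read on the key-`γ` twin `D`: `ξ := ι ξ′` (`char D = (ι ξ′)`, `sharpFlatSelmerDualData_charIdeal_eq_span_invol`), `L′ := ±ι(ξ′·h)` — same
constant term (`constantCoeff_invol`) and same value at `−2` (`evalAt_neg_two_invol`: `0`, `−2` are the two `ι`-fixed points), so (P), (P₋₂′), (K), (K₋₂′)
are read exactly as before.  No sorry of its own. [folklore] -/
theorem bsdp_two_of_genericOdd (hPub : PublishedInputsAtTwo)
    (hFD : UniformFlatHondaDataAtTwo) (hMu : FineMuZeroOnHabitatAtTwo)
    (hNF : FlatBlindNoCotorsionHondaAtTwo)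
    (hCD : FlatBlindControlFiniteHondaAtTwo ∧ FlatBlindControlCardHondaAtTwo) (hVal : OddFlatBlindValueLawAtTwo)
    (W : WeierstrassCurve ℚ) [W.IsElliptic] [W.IsGloballyMinimal]
    (hCM : ¬ W.HasCM) (hr : W.analyticRank = 0) (hss : GoodSS W 2)
    (hodd : W.rootNumber * ZMod.χ₈ (W.conductorNorm ℤ : ZMod 8) = -1)
    (W₂ : WeierstrassCurve ℚ) [W₂.IsElliptic] [W₂.IsGloballyMinimal]
    (htw : ∃ C : WeierstrassCurve.VariableChange ℚ, C • W.quadraticTwist 2 = W₂) (han : W₂.analyticRank = 1) :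
    BSDp W 2 := by
  have hA : FlatBlindRegulatorCharacteristicHondaAtTwo :=
    flatBlindRegulatorCharacteristicHondaAtTwo_of flatBlindEulerCharAtTwo_holds hNF
      (flatBlindControlDualityHondaAtTwo_of_splitHonda hCD.1 hCD.2)
  have hirr : W.HasIrreducibleModPGaloisRep 2 := P2.irr_two_of_goodSS_two W hss
  have hL1 : W.entireLFunction 1 ≠ 0 :=
    Literature.NumberTheory.EllipticCurves.Rank1Residual.entireLFunction_one_ne_zero_of_analyticRank_eq_zero hPub.2.1.1 W hr
  -- the cyclotomic `ℤ₂`-extension, a topological generator carrying the cyclotomic variable, and the place over `2`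
  obtain ⟨κ, hκ, γ, hγ, hγ'⟩ := exists_isCyclotomic_isTopGenerator_isCyclotomicVariable_holds 2
  set v : HeightOneSpectrum (𝓞 ℚ) := (Rat.HeightOneSpectrum.primesEquiv (R := 𝓞 ℚ)).symm ⟨2, Nat.prime_two⟩
    with hv_def
  have hv : (2 : 𝓞 ℚ) ∈ v.asIdeal := by
    have h := natCast_mem_asIdeal_primesEquiv_symm 2 Nat.prime_two
    simpa [hv_def] using h
  -- stub 2 at this tuple: Sprung's local ♭ data with the Honda₂ clauses, the Honda legality (v2.7), COUNT♭ and CK♭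
  obtain ⟨g, c, hg, hc, hTr, hinj, hsat, hH, hcount, hCK⟩ := hFD W hCM hr hss κ γ hκ hγ hγ' v hv
  -- (K) at every ♭ dual datum: the tree's EC♭ at `2` fed by COUNT♭
  have hEC : ∀ (D : SharpFlatSelmerDualData W κ γ (closureEmb (K := ℚ) (v.adicCompletion ℚ))
      (W.frobeniusTrace 2) g c .flat) [Module.Finite (IwasawaAlgebra 2) D.X],
      Module.IsTorsion (IwasawaAlgebra 2) D.X →
      ∀ f : IwasawaAlgebra 2, D.charIdeal = Ideal.span {f} → Finite (W.selmerGroupPInfty 2) →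
        ∃ u : ℤ_[2]ˣ, ((PowerSeries.constantCoeff f : ℤ_[2]) : ℚ_[2]) =
          ((u : ℤ_[2]) : ℚ_[2]) * ((2 : ℕ) : ℚ_[2]) ^ (padicValNat 2 W.tamagawaProduct) *
            (Nat.card (W.selmerGroupPInfty 2) : ℚ_[2]) :=
    fun D _ hX f hf hfin ↦
      Summit.BirchSwinnertonDyer.BirchSwinnertonDyer.Theorems.SSFlatRoad.flatEulerChar_two W hss κ hγ hv hg hc hTr
        hinj hsat hcount D hX f hf hfin
  -- the Kato half at `2` (tree + §D84K): `X♭` torsion, `char X♭ = (ξ)`, `ι(ξ·h) = C(ϖ)·ι L♭`, fed by (A) at `(E,2)` (v2.12)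
  have hup : ∀ [NeZero (W.conductorNorm ℤ)] (f : CuspForm (Gamma0 (W.conductorNorm ℤ)) 2),
        IsNewformOf W f → ∀ (ϖ : ℚ), (ϖ : ℝ) * W.realPeriodRat = plusPeriod f →
      ∀ (Ls Lf : IwasawaAlgebra 2), IsSprungPair f 2 (W.frobeniusTrace 2) Ls Lf →
      ∀ (D' : SharpFlatSelmerDualData W κ γ⁻¹ (closureEmb (K := ℚ) (v.adicCompletion ℚ))
          (W.frobeniusTrace 2) g c .flat),
        Module.IsTorsion (IwasawaAlgebra 2) D'.X ∧
        ∃ g' h : IwasawaAlgebra 2, D'.charIdeal = Ideal.span {g'} ∧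
          iwasawaToPowerSeries 2 (g' * h) = PowerSeries.C (ϖ : ℚ_[2]) * iwasawaToPowerSeries 2 Lf := by
    -- v2.18 (R1): the T-84 closer on the contragredient (key-`γ⁻¹`) duals, ★★ p831246
    exact Summit.BirchSwinnertonDyer.BirchSwinnertonDyer.Theorems.SSFlatRoad.flatUpper_two_of_flatColemanKato_of_fineMu_contra W _
      g c hPub.2.2.1.1 hPub.2.2.1.2 hss.1 hss.2 hL1 hκ hγ hγ'
      (hMu W hCM hr hss) hCK
  -- modularity (stub 1): the newform `f` of `W` and the rational period ratio `ϖ`; Sprung's pair at `2`; a dual datum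
  haveI : NeZero (W.conductorNorm ℤ) := ⟨(W.conductorNorm_pos_holds).ne'⟩
  obtain ⟨Dm⟩ := hPub.2.1.1 W
  have hf : IsNewformOf W Dm.f := Dm.isNewformOf
  obtain ⟨ϖ, hϖpos, hϖeq, hΩpos⟩ := Dm.exists_rat_mul_realPeriodRat_eq_plusPeriod
  obtain ⟨Ls, Lf, hSP⟩ := exists_isSprungPair_two hf hss.1 hss.2
  obtain ⟨D⟩ := nonempty_sharpFlatSelmerDualData W κ (closureEmb (K := ℚ) (v.adicCompletion ℚ))
    (W.frobeniusTrace 2) g c Chroma.flat hγ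
  haveI : Module.Finite (IwasawaAlgebra 2) D.X := D.moduleFinite hγ
  -- v2.18 (R1): the contragredient twin `D'` of key `γ⁻¹`; the Kato half is read there and carried to `D` by `ι`
  obtain ⟨D'⟩ := nonempty_sharpFlatSelmerDualData_of_mul_eq_one (mul_inv_cancel γ) D
  obtain ⟨hTors', ξ', h, hchar', hgh⟩ := hup Dm.f hf ϖ hϖeq Ls Lf hSP D'
  have hTors : Module.IsTorsion (IwasawaAlgebra 2) D.X := (sharpFlatSelmerDualData_isTorsion_inv_iff D D').2 hTors'
  set ξ : IwasawaAlgebra 2 := Literature.NumberTheory.EllipticCurves.IwasawaAlgebra.invol 2 ξ' with hξ_def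
  have hchar : D.charIdeal = Ideal.span {ξ} :=
    Summit.BirchSwinnertonDyer.BirchSwinnertonDyer.Theorems.SSFlatRoad.sharpFlatSelmerDualData_charIdeal_eq_span_invol W κ D D' hchar'
  -- the `ι`-image of THE avatar `G = ξ'·h`: same constant term, same value at `−2`
  have hιG0 : PowerSeries.constantCoeff (Literature.NumberTheory.EllipticCurves.IwasawaAlgebra.invol 2 (ξ' * h)) = PowerSeries.constantCoeff (ξ' * h) :=
    Literature.NumberTheory.EllipticCurves.IwasawaAlgebra.constantCoeff_invol 2 _
  have hιG2 : evalAt (-2 : ℤ_[2]) (Literature.NumberTheory.EllipticCurves.IwasawaAlgebra.invol 2 (ξ' * h)) = evalAt (-2 : ℤ_[2]) (ξ' * h) := Summit.BirchSwinnertonDyer.BirchSwinnertonDyer.Theorems.AlignedTransportAtTwoTwinValueAlgebra.evalAt_neg_two_invol _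
  -- GZK for the twist (analytic rank `1`, stub 1): rank `1`, `Ш(W₂)[2^∞]` finite (R389d) and a NON-TORSION POINT —
  -- v2.3 (LEAD ss-1 g17 R17a): the Gross–Zagier existence half is obtained HERE from `hPub`, not inside stub 6
  have hG2 := hPub.2.1.2 W₂ han.le
  have hr₂ : W₂.mordellWeilRank = 1 := hG2.1.trans han
  have hsha : Finite (AddCommGroup.primaryComponent W₂.sha 2) := by
    haveI := hG2.2
    infer_instance
  obtain ⟨ι, P, hPt⟩ := nonTorsionPoint_of_GZK hPub W₂ han
  -- stub 6 for the PINNED `G := ξ·h`: (P₋₂′) for `G` at every non-torsion point, under the GZK binders just obtained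
  have hlaw := hVal W hCM hr hss hodd Dm.f hf ϖ hϖeq Ls Lf hSP (ξ' * h) hgh W₂ htw han hr₂ hsha
  -- (P) at the trivial character: `G(0) = c♭·t`, `t = L(E,1)/Ω_E = ϖ·[0]⁺_f`, `c♭ = −a₂² + 2a₂ + 1 ∈ {1, −7}`
  set s₀ : ℚ := ratPlusSymbol Dm.f 0 with hs_def
  set t : ℚ := ϖ * s₀ with ht_def
  have hLval : W.entireLFunction 1 = (((s₀ : ℝ) * plusPeriod Dm.f : ℝ) : ℂ) := hf.entireLFunction_one_eq
  have ht : W.entireLFunction 1 / (W.realPeriodRat : ℂ) = ((t : ℚ) : ℂ) := by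
    rw [hLval, ← hϖeq, div_eq_iff (Complex.ofReal_ne_zero.mpr hΩpos.ne'), ht_def]
    push_cast
    ring
  set cf : ℚ := -(W.frobeniusTrace 2 : ℚ) ^ 2 + 2 * (W.frobeniusTrace 2) + 1 with hcf_def
  have hLf0 := constantCoeff_flat_two_of_isSprungPair_of_isNewformOf hf hss.1 hSP
  have hϖLf : (ϖ : ℚ_[2]) * ((PowerSeries.constantCoeff Lf : ℤ_[2]) : ℚ_[2]) = (((cf * t : ℚ)) : ℚ_[2]) := by
    rw [hLf0, ht_def, hcf_def]
    push_cast
    ring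
  have hG0 : ((PowerSeries.constantCoeff (Literature.NumberTheory.EllipticCurves.IwasawaAlgebra.invol 2 (ξ' * h)) : ℤ_[2]) : ℚ_[2]) = (((cf * t : ℚ)) : ℚ_[2]) := by
    have hc0 := congrArg PowerSeries.constantCoeff hgh
    rw [map_mul PowerSeries.constantCoeff (PowerSeries.C (ϖ : ℚ_[2])), PowerSeries.constantCoeff_C,
      constantCoeff_iwasawaToPowerSeries, constantCoeff_iwasawaToPowerSeries, hϖLf] at hc0
    rw [hιG0]
    exact hc0
  have hcf1 : cf = 1 ∨ cf = -7 := by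
    rcases frobeniusTrace_two_eq_zero_or W hss.1 hss.2 with h0 | h0 | h0
    · left; rw [hcf_def, h0]; norm_num
    · left; rw [hcf_def, h0]; norm_num
    · right; rw [hcf_def, h0]; norm_num
  -- the signed avatar `L' = ±G` with its odd constant `c ∈ {1, 7}`, (P) and (P₋₂′)
  obtain ⟨L', cc, hL', hcodd, hP0, hIb⟩ : ∃ (L' : IwasawaAlgebra 2) (cc : ℕ),
      (L' = Literature.NumberTheory.EllipticCurves.IwasawaAlgebra.invol 2 (ξ' * h) ∨ L' = -(Literature.NumberTheory.EllipticCurves.IwasawaAlgebra.invol 2 (ξ' * h))) ∧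
      ¬ 2 ∣ cc ∧ (⟨ξ, L', cc⟩ : SignedDatum W 2).Interpolation ∧
      BlindRegulatorInterpolation (⟨ξ, L', cc⟩ : SignedDatum W 2) W₂ 0 := by
    rcases hcf1 with h1 | h1
    · refine ⟨Literature.NumberTheory.EllipticCurves.IwasawaAlgebra.invol 2 (ξ' * h), 1, Or.inl rfl, by norm_num, ⟨t, ht, ?_⟩, ?_⟩
      · show ((PowerSeries.constantCoeff (Literature.NumberTheory.EllipticCurves.IwasawaAlgebra.invol 2 (ξ' * h)) : ℤ_[2]) : ℚ_[2]) =
          ((1 : ℕ) : ℚ_[2]) * ((t : ℚ) : ℚ_[2])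
        rw [hG0, h1]
        push_cast
        ring
      · intro _ _ _ ι' P' hPt'
        obtain ⟨h1', h2'⟩ := hlaw ι' P' hPt'
        refine ⟨by rw [hιG2]; exact h1', ?_⟩
        show (((evalAt (-2 : ℤ_[2]) (Literature.NumberTheory.EllipticCurves.IwasawaAlgebra.invol 2 (ξ' * h))).valuation : ℤ)) = _
        rw [hιG2, h2']
        push_cast
        ring
    · refine ⟨-(Literature.NumberTheory.EllipticCurves.IwasawaAlgebra.invol 2 (ξ' * h)), 7, Or.inr rfl, by norm_num, ⟨t, ht, ?_⟩, ?_⟩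
      · show ((PowerSeries.constantCoeff (-(Literature.NumberTheory.EllipticCurves.IwasawaAlgebra.invol 2 (ξ' * h))) : ℤ_[2]) : ℚ_[2]) =
          ((7 : ℕ) : ℚ_[2]) * ((t : ℚ) : ℚ_[2])
        rw [map_neg, PadicInt.coe_neg, hG0, h1]
        push_cast
        ring
      · intro _ _ _ ι' P' hPt'
        obtain ⟨h1', h2'⟩ := hlaw ι' P' hPt'
        refine ⟨?_, ?_⟩
        · show evalAt (-2 : ℤ_[2]) (-(Literature.NumberTheory.EllipticCurves.IwasawaAlgebra.invol 2 (ξ' * h))) ≠ 0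
          rw [evalAt_neg norm_neg_two_lt_one, hιG2]
          exact neg_ne_zero.mpr h1'
        · show (((evalAt (-2 : ℤ_[2]) (-(Literature.NumberTheory.EllipticCurves.IwasawaAlgebra.invol 2 (ξ' * h)))).valuation : ℤ)) = _
          rw [evalAt_neg norm_neg_two_lt_one, valuation_neg_eq, hιG2, h2']
          push_cast
          ring
  -- the datum `(ξ, L', cc)`: (K) by EC♭, the UPPER divisibility `ξ ∣ L'` by the Kato half, (K₋₂′) by K67-A
  have hK : (⟨ξ, L', cc⟩ : SignedDatum W 2).EulerCharacteristic := fun hfin ↦ hEC D hTors ξ hchar hfin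
  have hdvd : ξ ∣ L' := by
    have hd : ξ ∣ Literature.NumberTheory.EllipticCurves.IwasawaAlgebra.invol 2 (ξ' * h) := ⟨Literature.NumberTheory.EllipticCurves.IwasawaAlgebra.invol 2 h, by rw [hξ_def, ← map_mul]⟩
    rcases hL' with h1 | h1 <;> rw [h1]
    exacts [hd, hd.neg_right]
  have hdiv : (⟨ξ, L', cc⟩ : SignedDatum W 2).LowerDivisibility ∨ (⟨ξ, L', cc⟩ : SignedDatum W 2).UpperDivisibility :=
    Or.inr hdvd
  have hKb : BlindRegulatorCharacteristicAt (⟨ξ, L', cc⟩ : SignedDatum W 2) W₂ 0 := by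
    intro htw' hr₂' hsha' ι' P' hPt'
    obtain ⟨h1, h2⟩ := hA W hCM hss hodd κ γ hκ hγ hγ' v hv g c hg hc hTr hinj hsat hH D hTors ξ hchar W₂ htw' hr₂'
      hsha' ι' P' hPt'
    refine ⟨h1, ?_⟩
    rw [h2]
    push_cast
    ring
  exact bsdp_two_of_oneDivisibility_of_oddBlindControl W hPub.2.1.2 hirr hL1 ⟨ξ, L', cc⟩ hcodd hK hP0 hdiv htw hr₂ hsha
    ι P hPt hKb hIb

/-- **v2.17 (W-88): KERNEL of the TWIST-PINCH branch (sorry-free).**  On the twist-pinch locus — an avatar `G` of `ϖ·L♭` (binders `f, ϖ, (L♯, L♭), G`: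
`IsNewformOf W f`, `ϖ·Ω_W = Ω⁺_f`, `IsSprungPair f 2 a₂ L♯ L♭`, `ι G = C(ϖ)·ι L♭`) with the TABLE BITS `μ(G) = 0 ∧ λ(G) ≤ 1`, and a `ℚ`-model `W₂ ≅ E^{(2)}` with
`corank_{ℤ₂} Sel_{2^∞}(W₂/ℚ) ≥ 2` — `BSDp W 2` follows from stubs 1–3 ALONE: the cyclotomic `(κ, γ)` and `v ∋ 2` as in `bsdp_two_of_genericOdd`; stub 2
(`UniformFlatHondaDataAtTwo`, rebuilt from `stub_pub` + the landed (C1) + `stub_flatPackage`) gives Sprung's local ♭ data `(g, c)`, COUNT♭ and CK♭; a ♭ dual datum `D`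
(`nonempty_sharpFlatSelmerDualData`, f.g. by `moduleFinite`); the tree's Kato half `SSFlatRoad.flatUpper_two_of_flatColemanKato_of_fineMu` (fed by statement (A) at `(E,2)` =
stub 3) AT THE CERTIFICATE's `(f, ϖ, L♯, L♭)` gives `X♭` torsion, `char X♭ = (ξ)` and `ι(ξ·h) = C(ϖ)·ι L♭`, whence `G = ξ·h` (`iwasawaToPowerSeries_injective`) and `ξ ∣ G`;
(K) for `ξ` from EC♭ ★ `SSFlatRoad.flatEulerChar_two` fed by COUNT♭; the BLIND ZERO `(T+2) ∣ ξ` from K87-C ★★ p827897 `BlindPinch.blindZeroOfTwistSelmerCorankAtTwo`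
(t42 GEN 46; `corank ≥ 2` ⟹ the `conj_γ`-anti-invariants of `Sel♭` are infinite ⟹ `X♭/(T+2)` infinite); then ONE call of -imc's avatar consumer ★ p830132
`FlatBlindPinch.bsdp_two_of_flatBlindPinch_of_avatar` (sign bookkeeping `c♭ ∈ {1, −7}` + ★★ p829313 `bsdp_two_of_flatBlindPinch`: `ξ ∣ G`, `μ(G) = 0`, `λ(G) ≤ 1`,
`(T+2) ∣ ξ` force `(ξ) = (G) = (T+2)` up to `Λˣ`, i.e. the EQUALITY of the main conjecture at this curve, and the blind descent closes `BSD₂`) with GZK = `hPub.2.1.2`.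
v2.18 (R1): the Kato half, EC♭ and K87-C are read on the contragredient (key-`γ⁻¹`) dual `D′` BY NAME (★★ p831246 `…_contra` closer, ROAD-CONTRA part 2
`SSFlatRoad.flatEulerChar_two_contra` / `blindZeroOfTwistSelmerCorankAtTwo_contra`), so `ξ′ ∣ G`, (K) and the blind zero all concern the SAME `ξ′`.
No value law, no lower-bound stub, no sorry of its own. [cite: Sprung2017, Thm. 1.12, Cor. 4.4] [cite: Kobayashi2003, Thm. 1.2 (shape)] -/
theorem bsdp_two_of_twistPinch (hPub : PublishedInputsAtTwo)
    (hFD : UniformFlatHondaDataAtTwo) (hMu : FineMuZeroOnHabitatAtTwo)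
    (W : WeierstrassCurve ℚ) [W.IsElliptic] [W.IsGloballyMinimal]
    (hCM : ¬ W.HasCM) (hr : W.analyticRank = 0) (hss : GoodSS W 2)
    [NeZero (W.conductorNorm ℤ)] {f : CuspForm (Gamma0 (W.conductorNorm ℤ)) 2} (hf : IsNewformOf W f)
    {ϖ : ℚ} (hϖ : (ϖ : ℝ) * W.realPeriodRat = plusPeriod f)
    {Ls Lf : IwasawaAlgebra 2} (hSP : IsSprungPair f 2 (W.frobeniusTrace 2) Ls Lf)
    {G : IwasawaAlgebra 2} (hG : iwasawaToPowerSeries 2 G = PowerSeries.C (ϖ : ℚ_[2]) * iwasawaToPowerSeries 2 Lf)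
    (hμ : Summit.BirchSwinnertonDyer.Rank1Residual.X1.MuLambda.mu G = 0)
    (hlam : Summit.BirchSwinnertonDyer.Rank1Residual.X1.MuLambda.lam G ≤ 1)
    (W₂ : WeierstrassCurve ℚ) [W₂.IsElliptic]
    (htw : ∃ C : WeierstrassCurve.VariableChange ℚ, C • W.quadraticTwist 2 = W₂) (h2 : 2 ≤ W₂.selmerCorank 2) :
    BSDp W 2 := by
  have hL1 : W.entireLFunction 1 ≠ 0 :=
    Literature.NumberTheory.EllipticCurves.Rank1Residual.entireLFunction_one_ne_zero_of_analyticRank_eq_zero hPub.2.1.1 W hr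
  -- the cyclotomic `ℤ₂`-extension, a topological generator carrying the cyclotomic variable, and the place over `2`
  obtain ⟨κ, hκ, γ, hγ, hγ'⟩ := exists_isCyclotomic_isTopGenerator_isCyclotomicVariable_holds 2
  set v : HeightOneSpectrum (𝓞 ℚ) := (Rat.HeightOneSpectrum.primesEquiv (R := 𝓞 ℚ)).symm ⟨2, Nat.prime_two⟩
    with hv_def
  have hv : (2 : 𝓞 ℚ) ∈ v.asIdeal := by
    have h := natCast_mem_asIdeal_primesEquiv_symm 2 Nat.prime_two
    simpa [hv_def] using h
  -- stub 2 at this tuple: Sprung's local ♭ data with the Honda₂ clauses, the Honda legality, COUNT♭ and CK♭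
  obtain ⟨g, c, hg, hc, hTr, hinj, hsat, hH, hcount, hCK⟩ := hFD W hCM hr hss κ γ hκ hγ hγ' v hv
  -- a ♭ dual datum of key `γ` and its contragredient twin `D'` of key `γ⁻¹` (v2.18 R1: the print module)
  obtain ⟨D⟩ := nonempty_sharpFlatSelmerDualData W κ (closureEmb (K := ℚ) (v.adicCompletion ℚ))
    (W.frobeniusTrace 2) g c Chroma.flat hγ
  obtain ⟨D'⟩ := nonempty_sharpFlatSelmerDualData_of_mul_eq_one (mul_inv_cancel γ) D
  -- the Kato half at `2` fed by (A) at `(E,2)`, AT THE CERTIFICATE's `(f, ϖ, L♯, L♭)`, on `D'`: torsion, `char = (ξ)`, `ι₂(ξ·h) = C(ϖ)·ι₂ L♭`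
  obtain ⟨hTors, ξ, h, hchar, hgh⟩ :=
    Summit.BirchSwinnertonDyer.BirchSwinnertonDyer.Theorems.SSFlatRoad.flatUpper_two_of_flatColemanKato_of_fineMu_contra W _
      g c hPub.2.2.1.1 hPub.2.2.1.2 hss.1 hss.2 hL1 hκ hγ hγ' (hMu W hCM hr hss) hCK f hf ϖ hϖ Ls Lf hSP D'
  -- the avatar is unique: `G = ξ·h`
  have hGeq : G = ξ * h := iwasawaToPowerSeries_injective 2 (hG.trans hgh.symm)
  -- (K) for `ξ`: the tree's EC♭ at `2` fed by COUNT♭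
  have hK : Finite (W.selmerGroupPInfty 2) →
      ∃ u : ℤ_[2]ˣ, ((PowerSeries.constantCoeff ξ : ℤ_[2]) : ℚ_[2]) =
        ((u : ℤ_[2]) : ℚ_[2]) * ((2 : ℕ) : ℚ_[2]) ^ (padicValNat 2 W.tamagawaProduct) *
          (Nat.card (W.selmerGroupPInfty 2) : ℚ_[2]) := fun hfin ↦
    Summit.BirchSwinnertonDyer.BirchSwinnertonDyer.Theorems.SSFlatRoad.flatEulerChar_two_contra W hss κ hγ hv hg hc hTr
      hinj hsat hcount D' hTors ξ hchar hfin
  -- the blind zero `(T+2) ∣ ξ` from `corank Sel_{2^∞}(E^{(2)}/ℚ) ≥ 2` (K87-C ★★ p827897, read on `D'`)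
  have hZ : (PowerSeries.X + PowerSeries.C (2 : ℤ_[2]) : IwasawaAlgebra 2) ∣ ξ :=
    Summit.BirchSwinnertonDyer.BirchSwinnertonDyer.Theorems.SSFlatRoad.blindZeroOfTwistSelmerCorankAtTwo_contra W hss κ γ hκ hγ hγ'
      v hv g c Chroma.flat D' hTors ξ hchar W₂ htw h2
  -- the pinch from the avatar (W-88 ★ p830132)
  exact Summit.BirchSwinnertonDyer.BirchSwinnertonDyer.Theorems.FlatBlindPinch.bsdp_two_of_flatBlindPinch_of_avatar W hPub.2.1.2
    hss hL1 hf hϖ hSP hG (hGeq ▸ dvd_mul_right ξ h) hK hμ hlam hZ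

/-- **COMPOSITION = THE SKELETON: the crux BY NAME from exactly the five stubs** (v2.21: stub 2 = `uniformFlatHondaDataAtTwo_of_pub hPub (flatCKPackageAtTwo_of_flatZetaPackage
(flatZetaPackageAtTwo_of_flatImage hPub stub_flatPackage))` [(α) ⇒ ♭ zeta package by the capstone ★★★ `SSFlatCap.flatZetaPackage_body_of_pinnedFlatImage`; F1♭ by ★★ p837143; COUNT♭ ★ p829198], slot 4 = `classicalNoFiniteSubmoduleSSAtTwo_of_pub hPub` +
`flatKernelCyclicHondaAtTwo_of_pub hPub` [both by name, mod print] through NF♭_H; slot 5 fed by the unconditional tree theorem `OddBlindLocal.flatBlindControlCardHondaAtTwo_holds`),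
a THREE-WAY split: (1) the GENERIC ODD half (`w(E)·χ₈(N) = −1` and some globally minimal `W₂ ≅ E^{(2)}` has `r_an = 1`) by `bsdp_two_of_genericOdd`; (2) the TWIST-PINCH
locus (v2.17, W-88: an avatar `G` of `ϖ·L♭` with `μ(G) = 0 ∧ λ(G) ≤ 1` and a `W₂ ≅ E^{(2)}` with `corank Sel_{2^∞}(W₂/ℚ) ≥ 2`) by `bsdp_two_of_twistPinch` — stubs 1–3 only;
(3) elsewhere Miller's two halves — UPPER by the T-84 consumer (v2.18: its contragredient twin `…_of_fineMu_contra`, ★★ p831246) (Kato side fed by statement (A) at `(E,2)`, no image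
hypothesis), LOWER by `stub_lowerOffGenericOdd` whose escape clauses are discharged by the negated case hypotheses (v2.19, W-92: the Ш_an-UNIT locus `v₂ #Ш_an ≤ 0` is tried
first — there the lower half is trivial and `hU` alone closes) — and `bsdp_of_missingPPartAt`.
Kernel-checked, no sorry of its own. -/
theorem SupersingularRankZeroAtTwo_of :
    Summit.BirchSwinnertonDyer.BirchSwinnertonDyer.Theses.ByReductionTypeAtTwo.SupersingularRankZeroAtTwo := by
  intro W _ _ hCM hr hss
  have hPub := stub_pub
  have hFD : UniformFlatHondaDataAtTwo :=
    uniformFlatHondaDataAtTwo_of_pub hPub (flatCKPackageAtTwo_of_flatZetaPackage (flatZetaPackageAtTwo_of_flatImage hPub stub_flatPackage))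
  haveI : NeZero (W.conductorNorm ℤ) := ⟨(W.conductorNorm_pos_holds).ne'⟩
  by_cases hgen : W.rootNumber * ZMod.χ₈ (W.conductorNorm ℤ : ZMod 8) = -1 ∧
      ∃ (W₂ : WeierstrassCurve ℚ) (_ : W₂.IsElliptic) (_ : W₂.IsGloballyMinimal),
        (∃ C : WeierstrassCurve.VariableChange ℚ, C • W.quadraticTwist 2 = W₂) ∧ W₂.analyticRank = 1
  · obtain ⟨hodd, W₂, _, _, htw, han⟩ := hgen
    exact bsdp_two_of_genericOdd hPub hFD stub_fineMu
      (flatBlindNoCotorsionHondaAtTwo_of_flatNoFiniteSubmoduleHondaAtTwo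
        (flatNoFiniteSubmoduleHondaAtTwo_of_classical_of_kernelCyclic (classicalNoFiniteSubmoduleSSAtTwo_of_pub hPub)
          (flatKernelCyclicHondaAtTwo_of_pub hPub)))
      (flatBlindControlHonda_pairHonda_of_cardHonda
        Summit.BirchSwinnertonDyer.BirchSwinnertonDyer.Theorems.OddBlindLocal.flatBlindControlCardHondaAtTwo_holds)
      stub_oddFlatValueLaw
      W hCM hr hss hodd W₂ htw han
  · by_cases hpinch : ∃ (f : CuspForm (Gamma0 (W.conductorNorm ℤ)) 2) (ϖ : ℚ) (Ls Lf G : IwasawaAlgebra 2)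
        (W₂ : WeierstrassCurve ℚ) (_ : W₂.IsElliptic),
        IsNewformOf W f ∧ (ϖ : ℝ) * W.realPeriodRat = plusPeriod f ∧ IsSprungPair f 2 (W.frobeniusTrace 2) Ls Lf ∧
        iwasawaToPowerSeries 2 G = PowerSeries.C (ϖ : ℚ_[2]) * iwasawaToPowerSeries 2 Lf ∧
        Summit.BirchSwinnertonDyer.Rank1Residual.X1.MuLambda.mu G = 0 ∧
        Summit.BirchSwinnertonDyer.Rank1Residual.X1.MuLambda.lam G ≤ 1 ∧
        (∃ C : WeierstrassCurve.VariableChange ℚ, C • W.quadraticTwist 2 = W₂) ∧ 2 ≤ W₂.selmerCorank 2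
    · obtain ⟨f, ϖ, Ls, Lf, G, W₂, _, hf, hϖ, hSP, hG, hμ, hlam, htw, h2⟩ := hpinch
      exact bsdp_two_of_twistPinch hPub hFD stub_fineMu W hCM hr hss hf hϖ hSP hG hμ hlam W₂ htw h2
    · have hU : MissingUpperBoundAt W 2 :=
        Summit.BirchSwinnertonDyer.BirchSwinnertonDyer.Theorems.SSFlatRoad.missingUpperBoundAt_two_of_uniformFlat_of_fineMu_contra
          hPub.2.1 hPub.2.2.1.1 hPub.2.2.1.2 (uniformFlatDataAtTwo_of_honda hFD) stub_fineMu W hCM hr hss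
      -- v2.19 (W-92): on the Ш_an-UNIT locus Miller's lower half is trivial — BSD₂ from the UPPER half (stubs 1–3) alone
      by_cases hsha : ∃ q : ℚ, shaAn W = (q : ℂ) ∧ padicValRat 2 q ≤ 0
      · obtain ⟨q, hq, hle⟩ := hsha
        exact bsdp_of_missingPPartAt W 2 hPub.2.1.2 (by omega)
          (missingPPartAt_of_lower_of_upper W 2 ⟨q, hq, hle.trans (by exact_mod_cast Nat.zero_le _)⟩ hU)
      have hL : MissingLowerBoundAt W 2 := by
        refine stub_lowerOffGenericOdd W hCM hr hss ?_ ?_ ?_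
        · intro hodd W₂ _ _ htw han
          exact hgen ⟨hodd, W₂, ‹_›, ‹_›, htw, han⟩
        · intro _ f hf ϖ hϖ Ls Lf hSP G hG hμ hlam W₂ _ htw
          by_contra h2
          exact hpinch ⟨f, ϖ, Ls, Lf, G, W₂, ‹_›, hf, hϖ, hSP, hG, hμ, hlam, htw, by omega⟩
        · intro q hq
          by_contra hlt
          exact hsha ⟨q, hq, by omega⟩
      exact bsdp_of_missingPPartAt W 2 hPub.2.1.2 (by omega) (missingPPartAt_of_lower_of_upper W 2 hL hU)

end OddBlindPackage

end Summit.BirchSwinnertonDyer.BirchSwinnertonDyer.Cruxes.SupersingularRankZeroAtTwo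

end
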